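import Literature.Topology.FourManifolds.OpenTrace
import Literature.Topology.FourManifolds.TraceCollarProfile
import Literature.Topology.FourManifolds.SmoothEmbeddingComp
import Literature.Topology.FourManifolds.SmoothEmbeddingCriteria
import Literature.Topology.FourManifolds.ZeroSurgeryHomotopyBallSliceConstruction
import Mathlib.Analysis.InnerProductSpace.Calculus

/-!
# The collared end of the open trace of an integral knot surgery

Topic `Literature/Topology/FourManifolds`. This file discharges the named fact
`Literature.Topology.FourManifolds.Knot.exists_openTrace_of_isIntegralSurgery` of
`ZeroSurgeryHomotopyBallSliceConstruction.lean` (D-0014):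

* `Knot.exists_openTrace_of_isIntegralSurgery_holds` — for a knot `K`, an integer `m` and a
  3-manifold `Y` which is the `m`-surgery on `K` (`IsIntegralSurgery (𝓡 3) Y K m`, witnessed by a
  tubular neighbourhood `ν` of `K`), the **open trace** `T = OpenTrace ν'` of the 2-handle
  attachment along the fibre-shrunken tube `ν'` (`OpenTrace.lean`: `ℝ⁴` glued to the open
  2-handle `ℝ² × ℝ²`) contains `K` as the boundary of the smooth core disc
  (`TubeNbhd.isSliceDiscIn`), and the complement of the compact core
  `C = inl(B̄⁴) ∪ coreDisc(𝔻²)` is a **product end** `Y × ℝ ≅ T ∖ C`: an open partial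
  homeomorphism `c` with source `Y × ℝ`, target `T ∖ C`, smooth with smooth inverse, with
  `C ∪ c(Y × (-∞, a])` compact and `c(Y × [a, ∞))` closed for every `a` (the height `σ → -∞`
  at the core and `σ → +∞` at infinity). Kirby, *The Topology of 4-Manifolds* (1989), Ch. I §5
  (the trace of a surgery; `∂X_m(K) = S³_m(K)`); Gompf–Stipsicz (1999), §5.3.

## The construction

Write `ν` for the tube of the tubular neighbourhood, `ν' = ν.shrink` for the tube
`ν'(u, w'') = ν(u, univBall 0 2 w'')` with range the open tube `ν(𝕊¹ × B(0,2))` (so that the tube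
coordinates of `ν` extend across the frontier of `range ν'`), and `Y = jA(S³ ∖ K) ∪ jB(D̊² × 𝕊¹)`
with `jA (ν(u, τ v)) = jB (τ u, v)` for `0 < τ < 1` (`tubeSurgeryRel`). The collar
`c : Y × ℝ → T`, `(y, σ) ↦ c(y, σ)`, is given by three formulas on an open cover
(`TubeNbhd.collar`):

* **radial** (`TubeNbhd.cRad`), over `jA(S³ ∖ ν(𝕊¹ × B̄(0,2)))`: `c(jA a, σ) = inl (t • a)` with
  `ξ(1/t) = e^{-σ}`, where `ξ(α) = α/(1-α²)` (`TraceCollar.ξ`, inverse `TraceCollar.αof`);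
* **tube** (`TubeNbhd.cTube`), over `jA(ν(𝕊¹ × ℝ²) ∖ K)`:
  `c(jA (ν(u, w)), σ) = inl ((αof X)⁻¹ • ν(u, 2e^{-Y} ŵ))` where `(X, Y) = Φ⁻¹(e^{-σ}, ‖w‖)` for
  the corner-turning profile diffeomorphism `Φ = (N, T)` of `TraceCollarProfile.lean`
  (radial regime `Φ(X, Y) = (X, 2e^{-Y})` for `Y ≤ 0`, flat regime
  `Φ(X, Y) = (ψ Y, 2e^{-Y} X/ψ Y)` near the axis);
* **flat** (`TubeNbhd.cFlat`), near the core circle `jB({0} × 𝕊¹)` of the surgery solid torus,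
  in the handle chart: `c(jB (p, v), σ) = inr ((Gs(‖p‖²k²) k) • p, univBall⁻¹ (2e^{-ψinv D} v))`,
  `D = e^{-σ}`, `k = D e^{ψinv D}/2`.

The formulas agree on the overlaps (`cRad_eq_cTube`, `cTube_eq_cFlat`, by the closed forms of
`Φ⁻¹` in the radial and flat regimes), and so do the three formulas `ΨRad`, `ΨTube`, `ΨFlat` of
the inverse `TubeNbhd.collarInv` (`ΨRad_eq_ΨTube`, `ΨTube_eq_ΨFlat`). We prove
`collarInv ∘ collar = id` (`collarInv_collar`), `collar ∘ collarInv = id` off `C`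
(`collar_collarInv`), `range collar = Cᶜ` (`range_collar`), smoothness of both maps from the
smoothness of the local formulas (`contMDiff_collar`, `contMDiffOn_collarInv`), package them as
`TubeNbhd.collarPH`, and prove the two end clauses from the lower bounds
`e^{-σ} ≥ ξ(1/‖y‖)` at `inl y` and `e^{-σ} ≥ ψ(log(2/‖w‖))` at `inr(x, w'')`
(`isClosed_image_collar_ge`, `isCompact_coreC_union_image_le`).

## Design notes

* Everything is stated for a general tube `ν : TubeNbhd (𝓡 3) c` in `S³` and a general open
  gluing `Y` along `tubeSurgeryRel ν` (`TubeNbhd.IsSurgeryWith`); the knot case is obtained at the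
  end through the definitional bridges `Knot.TubularNbhd.toTubeNbhd_complement` and
  `tubeSurgeryRel_toTubeNbhd`.
* `jA`, `jB`, `inl`, `inr` are inverted by `Function.invFun` (total functions, smooth on the
  ranges by comparison with `IsOpenEmbedding.toOpenPartialHomeomorph`), and made total on `S³`,
  `ℝ² × 𝕊¹` by `TubeNbhd.toOpens'` (junk values off the open pieces).
* No declaration in this file uses `sorry`. [folklore] tags mark standard differential topology.

## References

* R. C. Kirby, *The Topology of 4-Manifolds*, LNM 1374 (1989), Ch. I §5. [cite: Kirby1989, Ch. I §5]
* R. E. Gompf, A. I. Stipsicz, *4-Manifolds and Kirby Calculus* (1999), §5.3.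
* C. Manolescu, L. Piccirillo, *From zero surgeries to candidates for exotic definite
  4-manifolds*, J. London Math. Soc. (2023), §3.2. [cite: ManolescuPiccirillo2023, §3.2 Def. 3.4]
-/

open Set Real Metric Function
open scoped ContDiff Topology Manifold

noncomputable section

namespace Literature.Topology.FourManifolds

namespace TraceCollar

/-! ### The radial coordinate `X = ξ(α) = α/(1-α²)` and its inverse -/

/-- The **radial coordinate** `X = ξ(α) = α/(1 - α²)` of the collar in terms of the inverse ball-chart radius `α = 1/t ∈ [0, 1)`: a diffeomorphism `[0, 1) → [0, ∞)` with `ξ(α) ~ α` near `0`. [folklore] -/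
def ξ (α : ℝ) : ℝ := α / (1 - α ^ 2)

/-- The inverse of `ξ` on `[0, ∞)`: `αof X = 2X/(1 + √(1 + 4X²)) ∈ [0, 1)` [folklore] -/
def αof (X : ℝ) : ℝ := 2 * X / (1 + Real.sqrt (1 + 4 * X ^ 2))

/-- `1 ≤ √(1 + 4X²)`. [folklore] -/
theorem one_le_sqrt_aux (X : ℝ) : 1 ≤ Real.sqrt (1 + 4 * X ^ 2) :=
  (Real.le_sqrt zero_le_one (by positivity)).2 (by nlinarith)

/-- `0 < 1 + √(1 + 4X²)`. [folklore] -/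
theorem denom_pos (X : ℝ) : 0 < 1 + Real.sqrt (1 + 4 * X ^ 2) := by
  have := one_le_sqrt_aux X; linarith

/-- `αof X ≥ 0` for `X ≥ 0`. [folklore] -/
theorem αof_nonneg {X : ℝ} (hX : 0 ≤ X) : 0 ≤ αof X :=
  div_nonneg (by linarith) (denom_pos X).le

/-- `αof X > 0` for `X > 0`. [folklore] -/
theorem αof_pos {X : ℝ} (hX : 0 < X) : 0 < αof X :=
  div_pos (by linarith) (denom_pos X)

/-- `αof X < 1`. [folklore] -/
theorem αof_lt_one (X : ℝ) : αof X < 1 := by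
  rw [αof, div_lt_one (denom_pos X)]
  have hs : (2 * X) ^ 2 < (1 + Real.sqrt (1 + 4 * X ^ 2)) ^ 2 := by
    have h1 := Real.sq_sqrt (show 0 ≤ 1 + 4 * X ^ 2 by positivity)
    nlinarith [one_le_sqrt_aux X]
  have h2 : |2 * X| < |1 + Real.sqrt (1 + 4 * X ^ 2)| := sq_lt_sq.1 hs
  rw [abs_of_pos (denom_pos X)] at h2
  exact (le_abs_self _).trans_lt h2

/-- `|αof X| < 1`. [folklore] -/
theorem abs_αof_lt_one (X : ℝ) : |αof X| < 1 := by
  rw [abs_lt]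
  refine ⟨?_, αof_lt_one X⟩
  have h := αof_lt_one (-X)
  have : αof (-X) = -αof X := by simp [αof, neg_div]
  linarith

/-- `1 - (αof X)² = 2/(1 + √(1 + 4X²))` [folklore] -/
theorem one_sub_αof_sq (X : ℝ) : 1 - αof X ^ 2 = 2 / (1 + Real.sqrt (1 + 4 * X ^ 2)) := by
  have hd := denom_pos X
  have hs := Real.sq_sqrt (show 0 ≤ 1 + 4 * X ^ 2 by positivity)
  rw [αof, div_pow, eq_div_iff hd.ne', sub_mul, one_mul, mul_pow]
  field_simp
  nlinarith [hs]

/-- `ξ (αof X) = X`: `αof` is a right inverse of `ξ` on all of `ℝ`. [folklore] -/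
theorem ξ_αof (X : ℝ) : ξ (αof X) = X := by
  have hd := denom_pos X
  rw [ξ, one_sub_αof_sq, αof]
  field_simp

/-- `αof (ξ α) = α` for `α ∈ [0, 1)`. [folklore] -/
theorem αof_ξ {α : ℝ} (h0 : 0 ≤ α) (h1 : α < 1) : αof (ξ α) = α := by
  have hα : 0 < 1 - α ^ 2 := by nlinarith
  have hs : Real.sqrt (1 + 4 * ξ α ^ 2) = (1 + α ^ 2) / (1 - α ^ 2) := by
    rw [show 1 + 4 * ξ α ^ 2 = ((1 + α ^ 2) / (1 - α ^ 2)) ^ 2 by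
      rw [ξ]; field_simp; ring]
    exact Real.sqrt_sq (by positivity)
  rw [αof, hs, ξ]
  field_simp
  ring

/-- `ξ α ≥ 0` for `α ∈ [0, 1)`. [folklore] -/
theorem ξ_nonneg {α : ℝ} (h0 : 0 ≤ α) (h1 : α < 1) : 0 ≤ ξ α :=
  div_nonneg h0 (by nlinarith)

/-- `ξ α > 0` for `α ∈ (0, 1)`. [folklore] -/
theorem ξ_pos {α : ℝ} (h0 : 0 < α) (h1 : α < 1) : 0 < ξ α :=
  div_pos h0 (by nlinarith)

/-- `ξ α / α = 1/(1 - α²)` [folklore] -/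
theorem ξ_eq_mul (α : ℝ) : ξ α = (1 - α ^ 2)⁻¹ * α := by
  rw [ξ, div_eq_inv_mul]

/-- `αof` is smooth. [folklore] -/
theorem contDiff_αof : ContDiff ℝ ∞ αof := by
  have h1 : ContDiff ℝ ∞ fun X : ℝ ↦ Real.sqrt (1 + 4 * X ^ 2) :=
    (contDiff_const.add (contDiff_const.mul (contDiff_id.pow 2))).sqrt fun X ↦ by positivity
  exact (contDiff_const.mul contDiff_id).div (contDiff_const.add h1) fun X ↦ (denom_pos X).ne'

/-- `ξ` is smooth on `(-1, 1)` [folklore] -/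
theorem contDiffOn_ξ : ContDiffOn ℝ ∞ ξ (Ioo (-1) 1) := by
  refine (contDiffOn_id.div (contDiffOn_const.sub (contDiffOn_id.pow 2)) fun α hα ↦ ?_)
  have : α ^ 2 < 1 := by nlinarith [hα.1, hα.2]
  exact (sub_pos.2 this).ne'

/-- `ξ` is smooth on `(-1, 1)`. [folklore] -/
theorem contDiffAt_ξ {α : ℝ} (hα : |α| < 1) : ContDiffAt ℝ ∞ ξ α :=
  contDiffOn_ξ.contDiffAt (Ioo_mem_nhds (abs_lt.1 hα).1 (abs_lt.1 hα).2)

/-- The smooth even factor `αof X / X = 2/(1 + √(1 + 4X²))` [folklore] -/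
def Gs (q : ℝ) : ℝ := 2 / (1 + Real.sqrt (1 + 4 * q))

/-- `αof X = Gs(X²) · X` with `Gs` smooth: the form of `αof` used at `X = 0`. [folklore] -/
theorem αof_eq_Gs_mul (X : ℝ) : αof X = Gs (X ^ 2) * X := by
  rw [αof, Gs]; ring

/-- `Gs q > 0` for `q ≥ 0`. [folklore] -/
theorem Gs_pos {q : ℝ} (hq : 0 ≤ q) : 0 < Gs q := by
  have : 1 ≤ Real.sqrt (1 + 4 * q) := (Real.le_sqrt zero_le_one (by linarith)).2 (by nlinarith)
  exact div_pos two_pos (by linarith)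

/-- `Gs` is smooth on `(-1/4, ∞)`. [folklore] -/
theorem contDiffOn_Gs : ContDiffOn ℝ ∞ Gs (Ioi (-4⁻¹)) := by
  have h1 : ContDiffOn ℝ ∞ (fun q : ℝ ↦ Real.sqrt (1 + 4 * q)) (Ioi (-4⁻¹)) :=
    (contDiffOn_const.add (contDiffOn_const.mul contDiffOn_id)).sqrt fun q hq ↦ by
      simp only [mem_Ioi, id_eq] at *; linarith
  refine contDiffOn_const.div (contDiffOn_const.add h1) fun q hq ↦ ?_
  have : 0 ≤ Real.sqrt (1 + 4 * q) := Real.sqrt_nonneg _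
  linarith

/-- `Gs` is smooth at every `q ≥ 0`. [folklore] -/
theorem contDiffAt_Gs {q : ℝ} (hq : 0 ≤ q) : ContDiffAt ℝ ∞ Gs q :=
  contDiffOn_Gs.contDiffAt (Ioi_mem_nhds (by linarith))

/-- The inverse ball radius `t = 1/αof X = (1 + √(1+4X²))/(2X)` as a smooth function on `X > 0` [folklore] -/
def tof (X : ℝ) : ℝ := (αof X)⁻¹

/-- `tof X > 1` for `X > 0`. [folklore] -/
theorem one_lt_tof {X : ℝ} (hX : 0 < X) : 1 < tof X :=
  (one_lt_inv₀ (αof_pos hX)).2 (αof_lt_one X)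

/-- `tof X > 0` for `X > 0`. [folklore] -/
theorem tof_pos {X : ℝ} (hX : 0 < X) : 0 < tof X := one_pos.trans (one_lt_tof hX)

/-- `tof` is smooth on `(0, ∞)`. [folklore] -/
theorem contDiffAt_tof {X : ℝ} (hX : 0 < X) : ContDiffAt ℝ ∞ tof X :=
  contDiff_αof.contDiffAt.inv (αof_pos hX).ne'

/-- `(tof X)⁻¹ = αof X`. [folklore] -/
theorem inv_tof (X : ℝ) : (tof X)⁻¹ = αof X := inv_inv _

end TraceCollar

/-- Local notation: `𝔼 n` is the model Euclidean space `EuclideanSpace ℝ (Fin n)`. -/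
local notation "𝔼 " n:arg => EuclideanSpace ℝ (Fin n)

/-- Local notation: `𝕊 n` is the unit sphere in `EuclideanSpace ℝ (Fin (n + 1))`. -/
local notation "𝕊 " n:arg => (Metric.sphere (0 : EuclideanSpace ℝ (Fin (n + 1))) 1)

/-- Local notation: `𝔻²` is the closed unit disc in `ℝ²`. -/
local notation "𝔻²" => Metric.closedBall (0 : EuclideanSpace ℝ (Fin 2)) 1

namespace TubeNbhd

variable {c : 𝕊 1 → 𝕊 3} (ν : TubeNbhd (𝓡 3) c)

/-! ### Shrinking a tube in the fibre -/

/-- The fibre reparametrisation `id × univBall 0 2` of `𝕊¹ × ℝ²` onto `𝕊¹ × B(0, 2)` [folklore] -/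
def fibreShrink : OpenPartialHomeomorph ((𝕊 1) × (𝔼 2)) ((𝕊 1) × (𝔼 2)) :=
  (OpenPartialHomeomorph.refl (𝕊 1)).prod (OpenPartialHomeomorph.univBall (0 : 𝔼 2) 2)

/-- The fibre reparametrisation as a function. [folklore] -/
@[simp] theorem fibreShrink_apply (q : (𝕊 1) × (𝔼 2)) :
    fibreShrink q = (q.1, OpenPartialHomeomorph.univBall (0 : 𝔼 2) 2 q.2) := rfl

/-- The fibre reparametrisation is defined everywhere. [folklore] -/
@[simp] theorem fibreShrink_source : fibreShrink.source = (univ : Set ((𝕊 1) × (𝔼 2))) := by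
  simp [fibreShrink]

/-- The fibre reparametrisation maps onto `𝕊¹ × B(0, 2)`. [folklore] -/
@[simp] theorem fibreShrink_target :
    fibreShrink.target = (univ : Set (𝕊 1)) ×ˢ Metric.ball (0 : 𝔼 2) 2 := by
  simp [fibreShrink, OpenPartialHomeomorph.univBall_target _ (show (0 : ℝ) < 2 by norm_num)]

/-- The fibre reparametrisation is smooth. [folklore] -/
theorem contMDiffOn_fibreShrink :
    ContMDiffOn ((𝓡 1).prod 𝓘(ℝ, 𝔼 2)) ((𝓡 1).prod 𝓘(ℝ, 𝔼 2)) ∞ fibreShrink fibreShrink.source := by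
  rw [fibreShrink_source]
  exact (contMDiff_id.prodMap
    (OpenPartialHomeomorph.contDiff_univBall (c := (0 : 𝔼 2)) (r := 2)).contMDiff).contMDiffOn

/-- The inverse fibre reparametrisation is smooth on `𝕊¹ × B(0, 2)`. [folklore] -/
theorem contMDiffOn_fibreShrink_symm :
    ContMDiffOn ((𝓡 1).prod 𝓘(ℝ, 𝔼 2)) ((𝓡 1).prod 𝓘(ℝ, 𝔼 2)) ∞ fibreShrink.symm fibreShrink.target := by
  rw [fibreShrink_target]
  have h : ContMDiffOn 𝓘(ℝ, 𝔼 2) 𝓘(ℝ, 𝔼 2) ∞ (OpenPartialHomeomorph.univBall (0 : 𝔼 2) 2).symm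
      (Metric.ball (0 : 𝔼 2) 2) :=
    OpenPartialHomeomorph.contDiffOn_univBall_symm.contMDiffOn
  exact contMDiffOn_id.prodMap h

/-- **the shrunken tube** `ν' (u, w'') = ν (u, univBall 0 2 w'')`, a tube around the same circle whose
range `ν(𝕊¹ × B(0,2))` has tube coordinates (those of `ν`) across its frontier [folklore] -/
def shrink : TubeNbhd (𝓡 3) c where
  toFun := ν.toFun ∘ fibreShrink
  isSmoothEmbedding := ν.isSmoothEmbedding.comp_openPartialHomeomorph fibreShrink fibreShrink_source
    contMDiffOn_fibreShrink contMDiffOn_fibreShrink_symm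
  isOpen_range := by
    rw [OpenPartialHomeomorph.range_comp_eq_image_target _ fibreShrink_source]
    exact ν.isOpenEmbedding.isOpenMap _ fibreShrink.open_target
  apply_zero u := by
    simp [ν.apply_zero]

/-- The shrunken tube as a function: `ν' (u, w'') = ν (u, univBall 0 2 w'')`. [folklore] -/
theorem shrink_apply (q : (𝕊 1) × (𝔼 2)) :
    ν.shrink.toFun q = ν.toFun (q.1, OpenPartialHomeomorph.univBall (0 : 𝔼 2) 2 q.2) := rfl

/-- The range of the shrunken tube is the open tube `ν(𝕊¹ × B(0, 2))` of radius `2`. [folklore] -/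
theorem range_shrink : range ν.shrink.toFun = ν.toFun '' ((univ : Set (𝕊 1)) ×ˢ Metric.ball (0 : 𝔼 2) 2) := by
  rw [shrink, OpenPartialHomeomorph.range_comp_eq_image_target _ fibreShrink_source, fibreShrink_target]

/-- `‖univBall 0 2 w‖ < 2`. [folklore] -/
theorem norm_univBall_lt (w : 𝔼 2) : ‖OpenPartialHomeomorph.univBall (0 : 𝔼 2) 2 w‖ < 2 := by
  have h := (OpenPartialHomeomorph.univBall (0 : 𝔼 2) 2).map_source (x := w)
    (by rw [OpenPartialHomeomorph.univBall_source]; trivial)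
  rw [OpenPartialHomeomorph.univBall_target _ (by norm_num : (0 : ℝ) < 2)] at h
  simpa using h

/-- `univBall⁻¹ (univBall w) = w`. [folklore] -/
theorem univBall_symm_apply_apply (w : 𝔼 2) :
    (OpenPartialHomeomorph.univBall (0 : 𝔼 2) 2).symm (OpenPartialHomeomorph.univBall (0 : 𝔼 2) 2 w) = w :=
  (OpenPartialHomeomorph.univBall (0 : 𝔼 2) 2).left_inv
    (by rw [OpenPartialHomeomorph.univBall_source]; trivial)

/-- `univBall (univBall⁻¹ w) = w` for `‖w‖ < 2`. [folklore] -/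
theorem univBall_apply_symm_apply {w : 𝔼 2} (hw : ‖w‖ < 2) :
    OpenPartialHomeomorph.univBall (0 : 𝔼 2) 2 ((OpenPartialHomeomorph.univBall (0 : 𝔼 2) 2).symm w) = w :=
  (OpenPartialHomeomorph.univBall (0 : 𝔼 2) 2).right_inv
    (by rw [OpenPartialHomeomorph.univBall_target _ (by norm_num : (0 : ℝ) < 2)]; simpa using hw)

end TubeNbhd


namespace TubeNbhd

variable {c : 𝕊 1 → 𝕊 3} (ν : TubeNbhd (𝓡 3) c)

/-! ### Points of the open trace of the shrunken tube in tube coordinates -/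

section PtT

variable (ν' : TubeNbhd (𝓡 3) c)

/-- The point of the open trace with base coordinates `(α, r)` and angles `(u, v)`:
`inl (α⁻¹ • ν(u, r • v))` [folklore] -/
def ptT (α r : ℝ) (u v : 𝕊 1) : ν'.OpenTrace :=
  ν'.traceGlueData.inl (α⁻¹ • ((ν.toFun (u, r • (v : 𝔼 2)) : 𝕊 3) : 𝔼 4))

/-- The ball-chart radius of `α⁻¹ • ν(u, r v)` is `α⁻¹`. [folklore] -/
theorem norm_ptT_arg {α : ℝ} (hα : 0 < α) (r : ℝ) (u v : 𝕊 1) :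
    ‖α⁻¹ • ((ν.toFun (u, r • (v : 𝔼 2)) : 𝕊 3) : 𝔼 4)‖ = α⁻¹ := by
  rw [norm_smul, norm_inv, Real.norm_of_nonneg hα.le, norm_eq_of_mem_sphere, mul_one]

/-- The direction of `α⁻¹ • ν(u, r v)` is `ν(u, r v)`. [folklore] -/
theorem radialProjection_ptT_arg {α : ℝ} (hα : 0 < α) (r : ℝ) (u v : 𝕊 1) :
    radialProjection (spherePt 3) (α⁻¹ • ((ν.toFun (u, r • (v : 𝔼 2)) : 𝕊 3) : 𝔼 4)) =
      ν.toFun (u, r • (v : 𝔼 2)) :=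
  radialProjection_smul _ (inv_pos.2 hα) _

/-- **the handle-chart form** of `ptT`: for `0 < α` and `0 < r < 2`,
`inl (α⁻¹ • ν(u, r v)) = inr (α • u, univBall⁻¹ (r • v))` in the open trace of the shrunken tube [folklore] -/
theorem ptT_eq_inr {α r : ℝ} (hα : 0 < α) (hr : 0 < r) (hr2 : r < 2) (u v : 𝕊 1) :
    ν.ptT ν.shrink α r u v = ν.shrink.traceGlueData.inr
      (α • (u : 𝔼 2), (OpenPartialHomeomorph.univBall (0 : 𝔼 2) 2).symm (r • (v : 𝔼 2))) := by
  rw [ptT, ν.shrink.inl_eq_inr_iff]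
  refine ⟨smul_ne_zero hα.ne' (ne_zero_of_mem_unit_sphere u), ?_⟩
  rw [ν.shrink.traceBwd_apply hα, shrink_apply]
  congr 2
  simp only
  rw [univBall_apply_symm_apply]
  rw [norm_smul_coe_sphere hr.le]; exact hr2

/-- `ptT` lies off the core `C = inl(B̄⁴) ∪ coreDisc(𝔻²)` when `0 < α < 1` and `r ≠ 0` [folklore] -/
theorem ptT_not_mem_core (ν' : TubeNbhd (𝓡 3) c) {α r : ℝ} (hα : 0 < α) (hα1 : α < 1) (hr : r ≠ 0)
    (u v : 𝕊 1) :
    ν.ptT ν' α r u v ∉ ν'.traceGlueData.inl '' Metric.closedBall (0 : 𝔼 4) 1 ∪ ν'.coreDisc '' 𝔻² := by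
  rw [ptT, ν'.inl_mem_core_iff, norm_ptT_arg _ hα]
  rintro (h | ⟨u', t, ht, h⟩)
  · exact (one_lt_inv₀ hα |>.2 hα1).not_ge h
  · have h1 := congrArg (radialProjection (spherePt 3)) h
    rw [radialProjection_ptT_arg _ hα, radialProjection_smul _ (one_pos.trans_le ht),
      ← ν'.apply_zero] at h1
    -- `ν (u, r v) = c u' = ν' (u', 0)`: both lie on the core circle
    have hmem : ν.toFun (u, r • (v : 𝔼 2)) ∈ range c := by rw [h1, ν'.apply_zero]; exact ⟨u', rfl⟩
    rw [ν.apply_mem_range_iff] at hmem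
    exact smul_ne_zero hr (ne_zero_of_mem_unit_sphere v) hmem

end PtT

/-! ### Total versions of maps defined on open pieces -/

section ToOpens

variable {M : Type*} [TopologicalSpace M]

open Classical in
/-- Push a point of `M` into the open subset `U` (junk `u₀` outside) [folklore] -/
def toOpens' (U : TopologicalSpace.Opens M) (u₀ : U) (z : M) : U :=
  if hz : z ∈ U then ⟨z, hz⟩ else u₀

/-- `toOpens'` is the identity on `U`. [folklore] -/
theorem toOpens'_of_mem {U : TopologicalSpace.Opens M} (u₀ : U) {z : M} (hz : z ∈ U) :
    toOpens' U u₀ z = ⟨z, hz⟩ := by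
  rw [toOpens', dif_pos hz]

/-- `toOpens'` is the identity on `U` (coerced form). [folklore] -/
theorem coe_toOpens'_of_mem {U : TopologicalSpace.Opens M} (u₀ : U) {z : M} (hz : z ∈ U) :
    (toOpens' U u₀ z : M) = z := by
  rw [toOpens'_of_mem u₀ hz]

/-- `toOpens' U u₀ : M → U` is smooth on `U`. [folklore] -/
theorem contMDiffOn_toOpens' {E H : Type*} [NormedAddCommGroup E] [NormedSpace ℝ E] [TopologicalSpace H]
    {I : ModelWithCorners ℝ E H} [ChartedSpace H M] (U : TopologicalSpace.Opens M) (u₀ : U) :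
    ContMDiffOn I I ∞ (toOpens' U u₀) U := by
  intro z hz
  refine (ContMDiffAt.contMDiffWithinAt ?_)
  rw [← ContMDiffAt.subtypeVal_comp_iff]
  have hev : (Subtype.val ∘ toOpens' U u₀) =ᶠ[𝓝 z] id := by
    filter_upwards [U.isOpen.mem_nhds hz] with z' hz'
    simp [toOpens'_of_mem u₀ hz']
  exact contMDiffAt_id.congr_of_eventuallyEq hev

end ToOpens

/-! ### Points of the surgered manifold in tube coordinates -/

section PtY

variable {Y : Type*} {jA : ν.complement → Y} {jB : ↥solidTorus → Y}

/-- `jA` made total on `S³` [folklore] -/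
def jAt (jA : ν.complement → Y) (a : 𝕊 3) : Y := jA (toOpens' ν.complement ν.basePtA a)

/-- `jB` made total on `ℝ² × 𝕊¹` [folklore] -/
def jBt (jB : ↥solidTorus → Y) (b : (𝔼 2) × (𝕊 1)) : Y := jB (toOpens' solidTorus basePtB b)

/-- `jAt` agrees with `jA` off the core circle. [folklore] -/
theorem jAt_of_mem (jA : ν.complement → Y) {a : 𝕊 3} (ha : a ∉ range c) :
    ν.jAt jA a = jA ⟨a, ha⟩ := by
  rw [jAt, toOpens'_of_mem _ (show a ∈ ν.complement from ha)]

/-- `jBt` agrees with `jB` on the open solid torus. [folklore] -/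
theorem jBt_of_norm_lt (jB : ↥solidTorus → Y) {b : (𝔼 2) × (𝕊 1)} (hb : ‖b.1‖ < 1) :
    jBt jB b = jB ⟨b, (mem_solidTorus_iff b).2 hb⟩ := by
  rw [jBt, toOpens'_of_mem _ ((mem_solidTorus_iff b).2 hb)]

/-- The point of `Y` with tube coordinates `(τ, u, v)`, `τ ≠ 0`: `jA (ν(u, τ • v))` [folklore] -/
def ptY (jA : ν.complement → Y) (τ : ℝ) (u v : 𝕊 1) : Y := ν.jAt jA (ν.toFun (u, τ • (v : 𝔼 2)))

/-- `ν (u, τ • v)` is off the core circle for `τ ≠ 0`. [folklore] -/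
theorem apply_smul_not_mem_range {τ : ℝ} (hτ : τ ≠ 0) (u v : 𝕊 1) :
    ν.toFun (u, τ • (v : 𝔼 2)) ∉ range c := by
  rw [ν.apply_mem_range_iff]; exact smul_ne_zero hτ (ne_zero_of_mem_unit_sphere v)

/-- `ptY τ u v = jA (ν(u, τ v))` for `τ ≠ 0`. [folklore] -/
theorem ptY_eq (jA : ν.complement → Y) {τ : ℝ} (hτ : τ ≠ 0) (u v : 𝕊 1) :
    ν.ptY jA τ u v = jA ⟨ν.toFun (u, τ • (v : 𝔼 2)), ν.apply_smul_not_mem_range hτ u v⟩ :=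
  ν.jAt_of_mem jA _

/-- **the solid-torus form** of `ptY`: for `0 < τ < 1`, `jA (ν(u, τ v)) = jB (τ u, v)` (the gluing
relation of the surgery) [folklore] -/
theorem ptY_eq_jB [TopologicalSpace Y] [ChartedSpace (𝔼 3) Y] (hG : IsOpenGluingWith (𝓡 3) (𝓘(ℝ, 𝔼 2).prod (𝓡 1)) (𝓡 3) (A := ↥ν.complement)
      (B := ↥solidTorus) (P := Y) (tubeSurgeryRel ν) jA jB)
    {τ : ℝ} (hτ : 0 < τ) (hτ1 : τ < 1) (u v : 𝕊 1) :
    ν.ptY jA τ u v = jBt jB (τ • (u : 𝔼 2), v) := by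
  rw [ν.ptY_eq jA hτ.ne', jBt_of_norm_lt jB (by simpa [norm_smul_coe_sphere hτ.le] using hτ1)]
  exact (hG.2.2.2.2.2 _ _).2 ⟨u, τ, ⟨hτ, hτ1⟩, rfl, rfl⟩

end PtY

/-! ### The collar and its inverse: definitions -/

section Defs

variable {Y : Type*}

/-- The complement of the core circle is nonempty. [folklore] -/
instance instNonemptyComplement : Nonempty ν.complement := ⟨ν.basePtA⟩

/-- The open solid torus is nonempty. [folklore] -/
instance instNonemptySolidTorus : Nonempty ↥solidTorus := ⟨basePtB⟩

/-- **radial formula** — the collar on the part of `Y` outside the tube: `(a, σ) ↦ inl (t(σ) • a)`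
with `t = 1/αof (e^{-σ})` (so that `ξ(1/t) = e^{-σ}`) [folklore] -/
def cRad (a : 𝕊 3) (σ : ℝ) : ν.shrink.OpenTrace :=
  ν.shrink.traceGlueData.inl (TraceCollar.tof (Real.exp (-σ)) • (a : 𝔼 4))

/-- The base coordinates `(X, Y) = Φ⁻¹ (e^{-σ}, ‖w‖)` of the collar point over the tube point
`a = ν (u, w)` at collar height `σ` [folklore] -/
def baseP (a : 𝕊 3) (σ : ℝ) : ℝ × ℝ :=
  TraceCollar.Φinv (Real.exp (-σ), ‖(ν.toHomeo.symm a).2‖)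

/-- **tube formula** — the collar on the tube part of `Y`: `(ν(u, w), σ) ↦ inl ((αof X)⁻¹ • ν(u, 2e^{-Y} ŵ))`
with `(X, Y) = Φ⁻¹ (e^{-σ}, ‖w‖)` [folklore] -/
def cTube (a : 𝕊 3) (σ : ℝ) : ν.shrink.OpenTrace :=
  ν.ptT ν.shrink (TraceCollar.αof (ν.baseP a σ).1) (2 * Real.exp (-(ν.baseP a σ).2))
    (ν.toHomeo.symm a).1 (radialProjection (spherePt 1) (ν.toHomeo.symm a).2)

/-- The scale factor `k = D e^{ψinv D}/2` of the flat regime (`X = τ k`) [folklore] -/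
def kOf (σ : ℝ) : ℝ := Real.exp (-σ) * Real.exp (TraceCollar.ψinv (Real.exp (-σ))) / 2

/-- **flat formula** — the collar near the core circle of the surgery solid torus, in the handle chart:
`((p, v), σ) ↦ inr ((Gs(‖p‖² k²) k) • p, univBall⁻¹ (2e^{-ψinv D} • v))` [folklore] -/
def cFlat (b : (𝔼 2) × (𝕊 1)) (σ : ℝ) : ν.shrink.OpenTrace :=
  ν.shrink.traceGlueData.inr
    ((TraceCollar.Gs (‖b.1‖ ^ 2 * kOf σ ^ 2) * kOf σ) • b.1,
      (OpenPartialHomeomorph.univBall (0 : 𝔼 2) 2).symm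
        ((2 * Real.exp (-TraceCollar.ψinv (Real.exp (-σ)))) • (b.2 : 𝔼 2)))

/-- The closed tube of radius `2`: `ν(𝕊¹ × B̄(0, 2))` [folklore] -/
def closedTube : Set (𝕊 3) := ν.toFun '' ((univ : Set (𝕊 1)) ×ˢ Metric.closedBall (0 : 𝔼 2) 2)

/-- The part of `Y` outside the closed tube of radius `2` (where the radial formula is used) [folklore] -/
def radSet (jA : ν.complement → Y) : Set Y := jA '' {a | (a : 𝕊 3) ∉ ν.closedTube}

/-- The point of `S³` under a point of `jA(S³ ∖ c)` (junk elsewhere) [folklore] -/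
def invA (jA : ν.complement → Y) (y : Y) : 𝕊 3 := ((Function.invFun jA y : ν.complement) : 𝕊 3)

/-- The point of `ℝ² × 𝕊¹` under a point of `jB(D̊² × 𝕊¹)` (junk elsewhere) [folklore] -/
def invB (jB : ↥solidTorus → Y) (y : Y) : (𝔼 2) × (𝕊 1) :=
  ((Function.invFun jB y : ↥solidTorus) : (𝔼 2) × (𝕊 1))

open Classical in
/-- **the collar** `Y × ℝ → OpenTrace ν'` [folklore] -/
def collar (jA : ν.complement → Y) (jB : ↥solidTorus → Y) (p : Y × ℝ) : ν.shrink.OpenTrace :=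
  if p.1 ∈ ν.radSet jA then ν.cRad (ν.invA jA p.1) p.2
  else if p.1 ∈ range jA then ν.cTube (ν.invA jA p.1) p.2
  else ν.cFlat (invB jB p.1) p.2

/-- **radial inverse formula**: `y ↦ (jA (y/‖y‖), -log ξ(1/‖y‖))` [folklore] -/
def ΨRad (jA : ν.complement → Y) (y : 𝔼 4) : Y × ℝ :=
  (ν.jAt jA (radialProjection (spherePt 3) y), -Real.log (TraceCollar.ξ ‖y‖⁻¹))

/-- The profile values `(N, T) = Φ (ξ(1/‖y‖), log (2/‖w‖))` at the ball-chart point `y = t • ν(u, w)` [folklore] -/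
def profP (y : 𝔼 4) : ℝ × ℝ :=
  TraceCollar.Φ (TraceCollar.ξ ‖y‖⁻¹,
    Real.log (2 / ‖(ν.toHomeo.symm (radialProjection (spherePt 3) y)).2‖))

/-- **tube inverse formula**: `t • ν(u, w) ↦ (ptY T u ŵ, -log N)` [folklore] -/
def ΨTube (jA : ν.complement → Y) (y : 𝔼 4) : Y × ℝ :=
  (ν.ptY jA (ν.profP y).2 (ν.toHomeo.symm (radialProjection (spherePt 3) y)).1
      (radialProjection (spherePt 1) (ν.toHomeo.symm (radialProjection (spherePt 3) y)).2),
    -Real.log (ν.profP y).1)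

/-- The tube radius `‖w‖` of the handle-chart point `(x, w'')`, `w = univBall w''` [folklore] -/
def radF (z : (𝔼 2) × (𝔼 2)) : ℝ := ‖OpenPartialHomeomorph.univBall (0 : 𝔼 2) 2 z.2‖

/-- **flat inverse formula**: `(x, w'') ↦ (jB (p, ŵ), -log ψ(Y))`, `Y = log (2/‖w‖)`,
`p = (‖w‖/ψ Y)(1 - ‖x‖²)⁻¹ • x` [folklore] -/
def ΨFlat (jB : ↥solidTorus → Y) (z : (𝔼 2) × (𝔼 2)) : Y × ℝ :=
  (jBt jB ((radF z / TraceCollar.ψ (Real.log (2 / radF z)) * (1 - ‖z.1‖ ^ 2)⁻¹) • z.1,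
      radialProjection (spherePt 1) (OpenPartialHomeomorph.univBall (0 : 𝔼 2) 2 z.2)),
    -Real.log (TraceCollar.ψ (Real.log (2 / radF z))))

/-- The part of the open trace whose ball-chart direction is outside the closed tube of radius `2` [folklore] -/
def radSetT : Set ν.shrink.OpenTrace :=
  ν.shrink.traceGlueData.inl '' {y | y ≠ 0 ∧ radialProjection (spherePt 3) y ∉ ν.closedTube}

/-- The ball-chart coordinate of a point of `inl(ℝ⁴)` (junk elsewhere). [folklore] -/
def invInl (z : ν.shrink.OpenTrace) : 𝔼 4 := Function.invFun ν.shrink.traceGlueData.inl z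

/-- The handle-chart coordinate of a point of `inr(ℝ² × ℝ²)` (junk elsewhere). [folklore] -/
def invInr (z : ν.shrink.OpenTrace) : (𝔼 2) × (𝔼 2) := Function.invFun ν.shrink.traceGlueData.inr z

open Classical in
/-- **the inverse collar** `OpenTrace ν' → Y × ℝ` (meaningful off the core `C`) [folklore] -/
def collarInv (jA : ν.complement → Y) (jB : ↥solidTorus → Y) (z : ν.shrink.OpenTrace) : Y × ℝ :=
  if z ∈ ν.radSetT then ν.ΨRad jA (ν.invInl z)
  else if z ∈ range ν.shrink.traceGlueData.inl then ν.ΨTube jA (ν.invInl z)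
  else ΨFlat jB (ν.invInr z)

end Defs

/-! ### Branch evaluation -/

section Branches

variable {Y : Type*} [TopologicalSpace Y] [ChartedSpace (𝔼 3) Y]

/-- The hypothesis "`Y` is the surgery along `ν`, with gluing maps `jA`, `jB`" [folklore] -/
abbrev IsSurgeryWith (jA : ν.complement → Y) (jB : ↥solidTorus → Y) : Prop :=
  IsOpenGluingWith (𝓡 3) (𝓘(ℝ, 𝔼 2).prod (𝓡 1)) (𝓡 3) (A := ↥ν.complement)
    (B := ↥solidTorus) (P := Y) (tubeSurgeryRel ν) jA jB

variable {jA : ν.complement → Y} {jB : ↥solidTorus → Y}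

/-- `jA` is injective. [folklore] -/
theorem injective_jA (hG : ν.IsSurgeryWith jA jB) : Injective jA := hG.1.isEmbedding.injective

/-- `jB` is injective. [folklore] -/
theorem injective_jB (hG : ν.IsSurgeryWith jA jB) : Injective jB := hG.2.2.1.isEmbedding.injective

/-- The gluing relation of the surgery. [folklore] -/
theorem jA_eq_jB_iff (hG : ν.IsSurgeryWith jA jB) (a : ν.complement) (b : ↥solidTorus) : jA a = jB b ↔ tubeSurgeryRel ν a b :=
  hG.2.2.2.2.2 a b

/-- The two pieces cover `Y`. [folklore] -/
theorem exists_jA_or_jB (hG : ν.IsSurgeryWith jA jB) (y : Y) : (∃ a, jA a = y) ∨ ∃ b, jB b = y := by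
  have := hG.2.2.2.2.1 ▸ mem_univ y
  exact this

/-- `invA (jA a) = a`. [folklore] -/
theorem invA_apply (hG : ν.IsSurgeryWith jA jB) (a : ν.complement) : ν.invA jA (jA a) = a := by
  rw [invA, Function.leftInverse_invFun (ν.injective_jA hG) a]

/-- `invB (jB b) = b`. [folklore] -/
theorem invB_apply (hG : ν.IsSurgeryWith jA jB) (b : ↥solidTorus) : invB jB (jB b) = b := by
  rw [invB, Function.leftInverse_invFun (ν.injective_jB hG) b]

/-- The core circle of the surgery solid torus is not in the first piece [folklore] -/
theorem jB_zero_not_mem_range (hG : ν.IsSurgeryWith jA jB) (v : 𝕊 1) (h : ((0 : 𝔼 2), v) ∈ solidTorus) :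
    jB ⟨((0 : 𝔼 2), v), h⟩ ∉ range jA := by
  rintro ⟨a, ha⟩
  obtain ⟨u, t, ht, hb, -⟩ := (ν.jA_eq_jB_iff hG a _).1 ha
  simp only at hb
  exact smul_ne_zero ht.1.ne' (ne_zero_of_mem_unit_sphere u) hb.symm

/-- A point of the second piece off its core circle lies in the first piece [folklore] -/
theorem jB_mem_range_of_ne_zero (hG : ν.IsSurgeryWith jA jB) (b : ↥solidTorus) (hb : (b : (𝔼 2) × (𝕊 1)).1 ≠ 0) :
    jB b ∈ range jA := by
  have hlt : ‖(b : (𝔼 2) × (𝕊 1)).1‖ < 1 := (mem_solidTorus_iff _).1 b.2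
  have hpos : 0 < ‖(b : (𝔼 2) × (𝕊 1)).1‖ := norm_pos_iff.2 hb
  refine ⟨⟨ν.toFun (radialProjection (spherePt 1) (b : (𝔼 2) × (𝕊 1)).1,
    ‖(b : (𝔼 2) × (𝕊 1)).1‖ • ((b : (𝔼 2) × (𝕊 1)).2 : 𝔼 2)),
    ν.apply_smul_not_mem_range hpos.ne' _ _⟩, ?_⟩
  rw [ν.jA_eq_jB_iff hG]
  exact ⟨_, _, ⟨hpos, hlt⟩, (norm_smul_coe_radialProjection _ _).symm, rfl⟩

/-- A point of `Y` outside the first piece lies on the core circle `jB({0} × 𝕊¹)` of the surgery solid torus. [folklore] -/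
theorem eq_jB_zero_of_not_mem_range (hG : ν.IsSurgeryWith jA jB) {y : Y} (hy : y ∉ range jA) :
    ∃ (v : 𝕊 1) (h : ((0 : 𝔼 2), v) ∈ solidTorus), jB ⟨((0 : 𝔼 2), v), h⟩ = y := by
  obtain (⟨a, rfl⟩ | ⟨b, rfl⟩) := ν.exists_jA_or_jB hG y
  · exact absurd (mem_range_self a) hy
  · have hb : (b : (𝔼 2) × (𝕊 1)).1 = 0 := by
      by_contra h; exact hy (ν.jB_mem_range_of_ne_zero hG b h)
    refine ⟨(b : (𝔼 2) × (𝕊 1)).2, ?_, ?_⟩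
    · simp [mem_solidTorus_iff]
    · congr 1; ext1
      exact Prod.ext hb.symm rfl

/-- `ν (u, w)` lies in the closed tube of radius `2` iff `‖w‖ ≤ 2`. [folklore] -/
theorem mem_closedTube_iff {u : 𝕊 1} {w : 𝔼 2} : ν.toFun (u, w) ∈ ν.closedTube ↔ ‖w‖ ≤ 2 := by
  rw [closedTube, ν.injective.mem_set_image]
  simp

/-- The core circle lies in the closed tube. [folklore] -/
theorem range_curve_subset_closedTube : range c ⊆ ν.closedTube := by
  rintro _ ⟨u, rfl⟩
  rw [← ν.apply_zero, mem_closedTube_iff]; simp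

/-- The closed tube lies in the open tube `ν(𝕊¹ × ℝ²)`. [folklore] -/
theorem closedTube_subset_range : ν.closedTube ⊆ range ν.toFun := image_subset_range _ _

/-- The closed tube `ν(𝕊¹ × B̄(0, 2))` is compact. [folklore] -/
theorem isCompact_closedTube : IsCompact ν.closedTube :=
  (isCompact_univ.prod (isCompact_closedBall _ _)).image ν.continuous

/-- The closed tube is closed in `S³`. [folklore] -/
theorem isClosed_closedTube : IsClosed ν.closedTube := ν.isCompact_closedTube.isClosed

/-- `jA a ∈ radSet` iff `a` is outside the closed tube. [folklore] -/
theorem jA_mem_radSet_iff (hG : ν.IsSurgeryWith jA jB) (a : ν.complement) : jA a ∈ ν.radSet jA ↔ (a : 𝕊 3) ∉ ν.closedTube :=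
  (ν.injective_jA hG).mem_set_image

omit [TopologicalSpace Y] [ChartedSpace (𝔼 3) Y] in
/-- `radSet ⊆ range jA`. [folklore] -/
theorem radSet_subset_range (jA : ν.complement → Y) : ν.radSet jA ⊆ range jA := image_subset_range _ _

/-- **branch R** [folklore] -/
theorem collar_of_not_mem_closedTube (hG : ν.IsSurgeryWith jA jB) (a : ν.complement) (ha : (a : 𝕊 3) ∉ ν.closedTube) (σ : ℝ) :
    ν.collar jA jB (jA a, σ) = ν.cRad a σ := by
  rw [collar, if_pos ((ν.jA_mem_radSet_iff hG a).2 ha), ν.invA_apply hG]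

/-- **branch P** [folklore] -/
theorem collar_of_mem_closedTube (hG : ν.IsSurgeryWith jA jB) (a : ν.complement) (ha : (a : 𝕊 3) ∈ ν.closedTube) (σ : ℝ) :
    ν.collar jA jB (jA a, σ) = ν.cTube a σ := by
  rw [collar, if_neg (fun h ↦ (ν.jA_mem_radSet_iff hG a).1 h ha), if_pos (mem_range_self a),
    ν.invA_apply hG]

/-- **branch F** (the core circle of the surgery solid torus) [folklore] -/
theorem collar_of_core (hG : ν.IsSurgeryWith jA jB) (v : 𝕊 1) (h : ((0 : 𝔼 2), v) ∈ solidTorus) (σ : ℝ) :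
    ν.collar jA jB (jB ⟨((0 : 𝔼 2), v), h⟩, σ) = ν.cFlat ((0 : 𝔼 2), v) σ := by
  have h1 := ν.jB_zero_not_mem_range hG v h
  rw [collar, if_neg (fun h' ↦ h1 (ν.radSet_subset_range jA h')), if_neg h1, ν.invB_apply hG]

/-- `invInl (inl y) = y`. [folklore] -/
theorem invInl_apply (y : 𝔼 4) : ν.invInl (ν.shrink.traceGlueData.inl y) = y :=
  Function.leftInverse_invFun ν.shrink.traceGlueData.inl_injective y

/-- `invInr (inr z) = z`. [folklore] -/
theorem invInr_apply (z : (𝔼 2) × (𝔼 2)) : ν.invInr (ν.shrink.traceGlueData.inr z) = z :=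
  Function.leftInverse_invFun ν.shrink.traceGlueData.inr_injective z

/-- `inl y ∈ radSetT` iff `y ≠ 0` and the direction of `y` is outside the closed tube. [folklore] -/
theorem inl_mem_radSetT_iff {y : 𝔼 4} :
    ν.shrink.traceGlueData.inl y ∈ ν.radSetT ↔ y ≠ 0 ∧ radialProjection (spherePt 3) y ∉ ν.closedTube :=
  ν.shrink.traceGlueData.inl_injective.mem_set_image

/-- `radSetT ⊆ range inl`. [folklore] -/
theorem radSetT_subset_range : ν.radSetT ⊆ range ν.shrink.traceGlueData.inl := image_subset_range _ _

omit [TopologicalSpace Y] [ChartedSpace (𝔼 3) Y] in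
/-- **branch R'** [folklore] -/
theorem collarInv_inl_of_not_mem {y : 𝔼 4} (hy : y ≠ 0)
    (h : radialProjection (spherePt 3) y ∉ ν.closedTube) :
    ν.collarInv jA jB (ν.shrink.traceGlueData.inl y) = ν.ΨRad jA y := by
  rw [collarInv, if_pos (ν.inl_mem_radSetT_iff.2 ⟨hy, h⟩), invInl_apply]

omit [TopologicalSpace Y] [ChartedSpace (𝔼 3) Y] in
/-- **branch P'** [folklore] -/
theorem collarInv_inl_of_mem {y : 𝔼 4} (h : radialProjection (spherePt 3) y ∈ ν.closedTube) :
    ν.collarInv jA jB (ν.shrink.traceGlueData.inl y) = ν.ΨTube jA y := by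
  rw [collarInv, if_neg (fun h' ↦ (ν.inl_mem_radSetT_iff.1 h').2 h), if_pos (mem_range_self y),
    invInl_apply]

omit [TopologicalSpace Y] [ChartedSpace (𝔼 3) Y] in
/-- **branch F'** (the cocore) [folklore] -/
theorem collarInv_inr_zero (w : 𝔼 2) :
    ν.collarInv jA jB (ν.shrink.traceGlueData.inr (0, w)) = ΨFlat jB ((0 : 𝔼 2), w) := by
  have h1 : ν.shrink.traceGlueData.inr ((0 : 𝔼 2), w) ∉ range ν.shrink.traceGlueData.inl := by
    rw [ν.shrink.inr_mem_range_inl_iff]; simp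
  rw [collarInv, if_neg (fun h' ↦ h1 (ν.radSetT_subset_range h')), if_neg h1, invInr_apply]

end Branches

/-! ### Computations in coordinates -/

section Computations

/-- `ν⁻¹ (ν (u, w)) = (u, w)`. [folklore] -/
theorem toHomeo_symm_apply' (u : 𝕊 1) (w : 𝔼 2) : ν.toHomeo.symm (ν.toFun (u, w)) = (u, w) :=
  ν.toHomeo_symm_apply (u, w)

/-- The base coordinates over the tube point `ν (u, w)`: `Φ⁻¹ (e^{-σ}, ‖w‖)`. [folklore] -/
theorem baseP_apply (u : 𝕊 1) (w : 𝔼 2) (σ : ℝ) :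
    ν.baseP (ν.toFun (u, w)) σ = TraceCollar.Φinv (Real.exp (-σ), ‖w‖) := by
  rw [baseP, toHomeo_symm_apply']

/-- `(e^{-σ}, ‖w‖)` lies in the open quadrant for `w ≠ 0`. [folklore] -/
theorem mem_Quad_of_ne_zero (σ : ℝ) {w : 𝔼 2} (hw : w ≠ 0) :
    (Real.exp (-σ), ‖w‖) ∈ TraceCollar.Quad :=
  ⟨Real.exp_pos _, norm_pos_iff.2 hw⟩

/-- The base coordinates over a tube point off the core circle have `X > 0`. [folklore] -/
theorem baseP_mem_Ωpos (u : 𝕊 1) {w : 𝔼 2} (hw : w ≠ 0) (σ : ℝ) :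
    ν.baseP (ν.toFun (u, w)) σ ∈ TraceCollar.Ωpos := by
  rw [baseP_apply]; exact TraceCollar.Φinv_mem (mem_Quad_of_ne_zero σ hw)

/-- The radial base coordinate `X` over a tube point off the core circle is positive. [folklore] -/
theorem fst_baseP_pos (u : 𝕊 1) {w : 𝔼 2} (hw : w ≠ 0) (σ : ℝ) : 0 < (ν.baseP (ν.toFun (u, w)) σ).1 :=
  ν.baseP_mem_Ωpos u hw σ

/-- `Φ (Φ⁻¹ (e^{-σ}, ‖w‖)) = (e^{-σ}, ‖w‖)` for `w ≠ 0`. [folklore] -/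
theorem Φ_baseP (u : 𝕊 1) {w : 𝔼 2} (hw : w ≠ 0) (σ : ℝ) :
    TraceCollar.Φ (ν.baseP (ν.toFun (u, w)) σ) = (Real.exp (-σ), ‖w‖) := by
  rw [baseP_apply]; exact TraceCollar.Φ_Φinv (mem_Quad_of_ne_zero σ hw)

/-- Over the closed tube of radius `2` the collar height `Y` is nonnegative (`T ≤ 2` forces `Y ≥ 0`) [folklore] -/
theorem snd_nonneg_of_Φ_snd_le_two {q : ℝ × ℝ} (hq : q ∈ TraceCollar.Ωpos)
    (h : (TraceCollar.Φ q).2 ≤ 2) : 0 ≤ q.2 := by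
  by_contra hY
  rw [not_le] at hY
  rw [TraceCollar.Φ_of_nonpos hq hY.le] at h
  have : 1 < Real.exp (-q.2) := Real.one_lt_exp_iff.2 (by linarith)
  simp only at h
  linarith

/-- Over the closed tube of radius `2` (off the core circle) the height base coordinate `Y` is nonnegative. [folklore] -/
theorem snd_baseP_nonneg (u : 𝕊 1) {w : 𝔼 2} (hw : w ≠ 0) (hw2 : ‖w‖ ≤ 2) (σ : ℝ) :
    0 ≤ (ν.baseP (ν.toFun (u, w)) σ).2 :=
  snd_nonneg_of_Φ_snd_le_two (ν.baseP_mem_Ωpos u hw σ) (by rw [ν.Φ_baseP u hw σ]; exact hw2)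

/-- The tube formula at `ν (u, w)` in terms of the base coordinates. [folklore] -/
theorem cTube_apply (u : 𝕊 1) (w : 𝔼 2) (σ : ℝ) :
    ν.cTube (ν.toFun (u, w)) σ = ν.ptT ν.shrink (TraceCollar.αof (ν.baseP (ν.toFun (u, w)) σ).1)
      (2 * Real.exp (-(ν.baseP (ν.toFun (u, w)) σ).2)) u (radialProjection (spherePt 1) w) := by
  rw [cTube, toHomeo_symm_apply']

/-- The profile values at a collar point `α⁻¹ • ν(u, r v)` [folklore] -/
theorem profP_ptT_arg {α r : ℝ} (hα : 0 < α) (hr : 0 < r) (u v : 𝕊 1) :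
    ν.profP (α⁻¹ • ((ν.toFun (u, r • (v : 𝔼 2)) : 𝕊 3) : 𝔼 4)) =
      TraceCollar.Φ (TraceCollar.ξ α, Real.log (2 / r)) := by
  rw [profP, norm_ptT_arg _ hα, inv_inv, radialProjection_ptT_arg _ hα, toHomeo_symm_apply',
    norm_smul_coe_sphere hr.le]

/-- The tube inverse formula at a collar point `α⁻¹ • ν(u, r v)`. [folklore] -/
theorem ΨTube_ptT_arg {Y : Type*} (jA : ν.complement → Y) {α r : ℝ} (hα : 0 < α) (hr : 0 < r)
    (u v : 𝕊 1) :
    ν.ΨTube jA (α⁻¹ • ((ν.toFun (u, r • (v : 𝔼 2)) : 𝕊 3) : 𝔼 4)) =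
      (ν.ptY jA (TraceCollar.Φ (TraceCollar.ξ α, Real.log (2 / r))).2 u v,
        -Real.log (TraceCollar.Φ (TraceCollar.ξ α, Real.log (2 / r))).1) := by
  rw [ΨTube, profP_ptT_arg _ hα hr]
  simp only [radialProjection_ptT_arg _ hα, toHomeo_symm_apply', radialProjection_smul _ hr]

/-- The radial inverse formula at `t • a`, `t > 0`. [folklore] -/
theorem ΨRad_smul {Y : Type*} (jA : ν.complement → Y) {t : ℝ} (ht : 0 < t) (a : 𝕊 3) :
    ν.ΨRad jA (t • (a : 𝔼 4)) = (ν.jAt jA a, -Real.log (TraceCollar.ξ t⁻¹)) := by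
  rw [ΨRad, radialProjection_smul _ ht, norm_smul_coe_sphere ht.le]

/-- `log (2 / (2 e^{-Y})) = Y` [folklore] -/
theorem log_two_div (Y : ℝ) : Real.log (2 / (2 * Real.exp (-Y))) = Y := by
  rw [show 2 / (2 * Real.exp (-Y)) = Real.exp Y by rw [Real.exp_neg]; field_simp, Real.log_exp]

/-- `2 e^{-log(2/r)} = r` [folklore] -/
theorem two_mul_exp_neg_log {r : ℝ} (hr : 0 < r) : 2 * Real.exp (-Real.log (2 / r)) = r := by
  rw [Real.exp_neg, Real.exp_log (by positivity)]
  field_simp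

end Computations

/-! ### `collarInv ∘ collar = id` -/

section LeftInverse

variable {Y : Type*} [TopologicalSpace Y] [ChartedSpace (𝔼 3) Y]
  {jA : ν.complement → Y} {jB : ↥solidTorus → Y}

/-- **branch R**: `collarInv (collar (jA a, σ)) = (jA a, σ)` outside the closed tube [folklore] -/
theorem collarInv_collar_rad (hG : ν.IsSurgeryWith jA jB) (a : ν.complement) (ha : (a : 𝕊 3) ∉ ν.closedTube)
    (σ : ℝ) : ν.collarInv jA jB (ν.collar jA jB (jA a, σ)) = (jA a, σ) := by
  have hD : 0 < Real.exp (-σ) := Real.exp_pos _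
  have ht : 0 < TraceCollar.tof (Real.exp (-σ)) := TraceCollar.tof_pos hD
  rw [ν.collar_of_not_mem_closedTube hG a ha, cRad,
    ν.collarInv_inl_of_not_mem (smul_ne_zero ht.ne' (ne_zero_of_mem_unit_sphere _))
      (by rwa [radialProjection_smul _ ht]),
    ΨRad_smul _ _ ht, TraceCollar.inv_tof, TraceCollar.ξ_αof, Real.log_exp, neg_neg,
    ν.jAt_of_mem jA a.2]

/-- **branch P**: `collarInv (collar (jA a, σ)) = (jA a, σ)` over the closed tube [folklore] -/
theorem collarInv_collar_tube (hG : ν.IsSurgeryWith jA jB) (a : ν.complement) (ha : (a : 𝕊 3) ∈ ν.closedTube)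
    (σ : ℝ) : ν.collarInv jA jB (ν.collar jA jB (jA a, σ)) = (jA a, σ) := by
  -- write `a = ν (u, w)` with `0 < ‖w‖ ≤ 2`
  obtain ⟨⟨u, w⟩, ⟨-, hw2⟩, hqa⟩ := ha
  rw [Metric.mem_closedBall, dist_zero_right] at hw2
  have hw : w ≠ 0 := fun h ↦ a.2 (by rw [← hqa, h, ν.apply_zero]; exact mem_range_self u)
  have hwpos : 0 < ‖w‖ := norm_pos_iff.2 hw
  have haeq : (a : 𝕊 3) = ν.toFun (u, w) := hqa.symm
  set q := ν.baseP (ν.toFun (u, w)) σ with hq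
  have hX : 0 < q.1 := ν.fst_baseP_pos u hw σ
  have hY : 0 ≤ q.2 := ν.snd_baseP_nonneg u hw hw2 σ
  have hα : 0 < TraceCollar.αof q.1 := TraceCollar.αof_pos hX
  have hα1 : TraceCollar.αof q.1 < 1 := TraceCollar.αof_lt_one _
  have hr : 0 < 2 * Real.exp (-q.2) := by positivity
  have hr2 : 2 * Real.exp (-q.2) ≤ 2 := by
    have : Real.exp (-q.2) ≤ 1 := Real.exp_le_one_iff.2 (by linarith)
    linarith
  rw [ν.collar_of_mem_closedTube hG a ⟨(u, w), ⟨mem_univ _, by simpa using hw2⟩, hqa⟩, haeq,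
    cTube_apply, ptT]
  rw [ν.collarInv_inl_of_mem (by
    rw [radialProjection_ptT_arg _ hα, mem_closedTube_iff, norm_smul_coe_sphere hr.le]; exact hr2)]
  rw [ν.ΨTube_ptT_arg jA hα hr, TraceCollar.ξ_αof, log_two_div, show (q.1, q.2) = q from rfl,
    ν.Φ_baseP u hw σ]
  simp only [Real.log_exp, neg_neg]
  refine Prod.ext ?_ rfl
  show ν.ptY jA ‖w‖ u (radialProjection (spherePt 1) w) = jA a
  rw [ν.ptY_eq jA hwpos.ne']
  congr 1
  ext1
  rw [haeq]
  simp only [norm_smul_coe_radialProjection]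

/-- **branch F**: `collarInv (collar (y, σ)) = (y, σ)` on the core circle of the surgery torus [folklore] -/
theorem collarInv_collar_core (hG : ν.IsSurgeryWith jA jB) (v : 𝕊 1) (h : ((0 : 𝔼 2), v) ∈ solidTorus)
    (σ : ℝ) : ν.collarInv jA jB (ν.collar jA jB (jB ⟨((0 : 𝔼 2), v), h⟩, σ)) = (jB ⟨((0 : 𝔼 2), v), h⟩, σ) := by
  have hDpos : 0 < Real.exp (-σ) := Real.exp_pos _
  have hYd : 0 < TraceCollar.ψinv (Real.exp (-σ)) := TraceCollar.ψinv_pos _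
  have hrpos : 0 < 2 * Real.exp (-TraceCollar.ψinv (Real.exp (-σ))) := by positivity
  have hr2 : 2 * Real.exp (-TraceCollar.ψinv (Real.exp (-σ))) < 2 := by
    have : Real.exp (-TraceCollar.ψinv (Real.exp (-σ))) < 1 := Real.exp_lt_one_iff.2 (by linarith)
    linarith
  have hrv : ‖(2 * Real.exp (-TraceCollar.ψinv (Real.exp (-σ)))) • (v : 𝔼 2)‖ < 2 := by
    rwa [norm_smul_coe_sphere hrpos.le]
  rw [ν.collar_of_core hG v h, cFlat]
  simp only [smul_zero]
  rw [ν.collarInv_inr_zero, ΨFlat]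
  have hκ : OpenPartialHomeomorph.univBall (0 : 𝔼 2) 2
      ((OpenPartialHomeomorph.univBall (0 : 𝔼 2) 2).symm
        ((2 * Real.exp (-TraceCollar.ψinv (Real.exp (-σ)))) • (v : 𝔼 2))) =
      (2 * Real.exp (-TraceCollar.ψinv (Real.exp (-σ)))) • (v : 𝔼 2) :=
    univBall_apply_symm_apply hrv
  have hrad : radF ((0 : 𝔼 2), (OpenPartialHomeomorph.univBall (0 : 𝔼 2) 2).symm
      ((2 * Real.exp (-TraceCollar.ψinv (Real.exp (-σ)))) • (v : 𝔼 2))) =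
      2 * Real.exp (-TraceCollar.ψinv (Real.exp (-σ))) := by
    rw [radF, hκ, norm_smul_coe_sphere hrpos.le]
  rw [hrad, hκ, radialProjection_smul _ hrpos, log_two_div, TraceCollar.ψ_ψinv hDpos, Real.log_exp,
    neg_neg, smul_zero]
  refine Prod.ext ?_ rfl
  exact jBt_of_norm_lt jB (by simp)

/-- **`collarInv ∘ collar = id` on `Y × ℝ`** [folklore] -/
theorem collarInv_collar (hG : ν.IsSurgeryWith jA jB) (p : Y × ℝ) :
    ν.collarInv jA jB (ν.collar jA jB p) = p := by
  obtain ⟨y, σ⟩ := p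
  by_cases hy : y ∈ range jA
  · obtain ⟨a, rfl⟩ := hy
    by_cases ha : (a : 𝕊 3) ∈ ν.closedTube
    · exact ν.collarInv_collar_tube hG a ha σ
    · exact ν.collarInv_collar_rad hG a ha σ
  · obtain ⟨v, h, rfl⟩ := ν.eq_jB_zero_of_not_mem_range hG hy
    exact ν.collarInv_collar_core hG v h σ

end LeftInverse

/-! ### `collar ∘ collarInv = id` off the core -/

section RightInverse

variable {Y : Type*} [TopologicalSpace Y] [ChartedSpace (𝔼 3) Y]
  {jA : ν.complement → Y} {jB : ↥solidTorus → Y}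

omit [TopologicalSpace Y] [ChartedSpace (𝔼 3) Y] in
/-- The core `C = inl(B̄⁴) ∪ coreDisc(𝔻²)` of the open trace of the shrunken tube [folklore] -/
abbrev coreC : Set ν.shrink.OpenTrace :=
  ν.shrink.traceGlueData.inl '' Metric.closedBall (0 : 𝔼 4) 1 ∪ ν.shrink.coreDisc '' 𝔻²

omit [TopologicalSpace Y] [ChartedSpace (𝔼 3) Y] in
/-- A ball-chart point off the core has radius `> 1`. [folklore] -/
theorem one_lt_norm_of_not_mem_coreC {y : 𝔼 4} (h : ν.shrink.traceGlueData.inl y ∉ ν.coreC) : 1 < ‖y‖ := by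
  rw [coreC, ν.shrink.inl_mem_core_iff, not_or] at h
  exact not_le.1 h.1

omit [TopologicalSpace Y] [ChartedSpace (𝔼 3) Y] in
/-- The direction of a ball-chart point off the core is off the core circle. [folklore] -/
theorem radialProjection_not_mem_range_of_not_mem_coreC {y : 𝔼 4}
    (h : ν.shrink.traceGlueData.inl y ∉ ν.coreC) : radialProjection (spherePt 3) y ∉ range c := by
  have h1 := ν.one_lt_norm_of_not_mem_coreC h
  rw [coreC, ν.shrink.inl_mem_core_iff, not_or] at h
  rintro ⟨u, hu⟩
  refine h.2 ⟨u, ‖y‖, h1.le, ?_⟩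
  rw [hu, norm_smul_coe_radialProjection]

omit [TopologicalSpace Y] [ChartedSpace (𝔼 3) Y] in
/-- The cocore point `inr (0, w'')` is off the core iff `w'' ≠ 0`. [folklore] -/
theorem inr_zero_not_mem_coreC_iff {w : 𝔼 2} :
    ν.shrink.traceGlueData.inr ((0 : 𝔼 2), w) ∉ ν.coreC ↔ w ≠ 0 := by
  rw [coreC, ν.shrink.inr_mem_core_iff]
  simp

omit [TopologicalSpace Y] [ChartedSpace (𝔼 3) Y] in
/-- `univBall 0 2 w ≠ 0` for `w ≠ 0`. [folklore] -/
theorem univBall_ne_zero {w : 𝔼 2} (hw : w ≠ 0) : OpenPartialHomeomorph.univBall (0 : 𝔼 2) 2 w ≠ 0 := by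
  intro h
  have h0 : OpenPartialHomeomorph.univBall (0 : 𝔼 2) 2 0 = 0 := OpenPartialHomeomorph.univBall_apply_zero _ _
  have := (OpenPartialHomeomorph.univBall (0 : 𝔼 2) 2).injOn
    (show w ∈ (OpenPartialHomeomorph.univBall (0 : 𝔼 2) 2).source by
      rw [OpenPartialHomeomorph.univBall_source]; trivial)
    (show (0 : 𝔼 2) ∈ (OpenPartialHomeomorph.univBall (0 : 𝔼 2) 2).source by
      rw [OpenPartialHomeomorph.univBall_source]; trivial) (h.trans h0.symm)
  exact hw this

omit [TopologicalSpace Y] [ChartedSpace (𝔼 3) Y] in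
/-- `T ≤ 2 e^{-Y}` [folklore] -/
theorem Tf_le (q : ℝ × ℝ) : TraceCollar.Tf q ≤ 2 * Real.exp (-q.2) := by
  rw [TraceCollar.Tf]
  exact mul_le_of_le_one_right (by positivity) (TraceCollar.ΘY_le_one q)

/-- **branch R'**: `collar (collarInv z) = z` for `z = inl y` with direction outside the closed tube [folklore] -/
theorem collar_collarInv_rad (hG : ν.IsSurgeryWith jA jB) {y : 𝔼 4}
    (hC : ν.shrink.traceGlueData.inl y ∉ ν.coreC)
    (h : radialProjection (spherePt 3) y ∉ ν.closedTube) :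
    ν.collar jA jB (ν.collarInv jA jB (ν.shrink.traceGlueData.inl y)) = ν.shrink.traceGlueData.inl y := by
  have h1 : 1 < ‖y‖ := ν.one_lt_norm_of_not_mem_coreC hC
  have hy : y ≠ 0 := by rintro rfl; norm_num at h1
  have hypos : 0 < ‖y‖ := norm_pos_iff.2 hy
  have hinv0 : 0 < ‖y‖⁻¹ := inv_pos.2 hypos
  have hinv1 : ‖y‖⁻¹ < 1 := inv_lt_one_of_one_lt₀ h1
  have hrange : radialProjection (spherePt 3) y ∉ range c :=
    fun hr ↦ h (ν.range_curve_subset_closedTube hr)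
  rw [ν.collarInv_inl_of_not_mem hy h, ΨRad, ν.jAt_of_mem jA hrange,
    ν.collar_of_not_mem_closedTube hG ⟨_, hrange⟩ h, cRad]
  congr 1
  simp only [neg_neg]
  rw [Real.exp_log (TraceCollar.ξ_pos hinv0 hinv1), TraceCollar.tof, TraceCollar.αof_ξ hinv0.le hinv1,
    inv_inv, norm_smul_coe_radialProjection]

/-- **branch P'**: `collar (collarInv z) = z` for `z = inl y` with direction in the closed tube [folklore] -/
theorem collar_collarInv_tube (hG : ν.IsSurgeryWith jA jB) {y : 𝔼 4}
    (hC : ν.shrink.traceGlueData.inl y ∉ ν.coreC)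
    (h : radialProjection (spherePt 3) y ∈ ν.closedTube) :
    ν.collar jA jB (ν.collarInv jA jB (ν.shrink.traceGlueData.inl y)) = ν.shrink.traceGlueData.inl y := by
  have h1 : 1 < ‖y‖ := ν.one_lt_norm_of_not_mem_coreC hC
  have hy : y ≠ 0 := by rintro rfl; norm_num at h1
  have hypos : 0 < ‖y‖ := norm_pos_iff.2 hy
  have hrange : radialProjection (spherePt 3) y ∉ range c := ν.radialProjection_not_mem_range_of_not_mem_coreC hC
  -- write the direction as `ν (u, w)` with `0 < ‖w‖ ≤ 2`
  obtain ⟨⟨u, w⟩, ⟨-, hw2⟩, hqa⟩ := h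
  rw [Metric.mem_closedBall, dist_zero_right] at hw2
  have hw : w ≠ 0 := fun h0 ↦ hrange (by rw [← hqa, h0, ν.apply_zero]; exact mem_range_self u)
  have hwpos : 0 < ‖w‖ := norm_pos_iff.2 hw
  -- `y = α⁻¹ • ν (u, ‖w‖ • ŵ)` with `α = ‖y‖⁻¹`
  set α : ℝ := ‖y‖⁻¹ with hαdef
  have hα : 0 < α := inv_pos.2 hypos
  have hα1 : α < 1 := inv_lt_one_of_one_lt₀ h1
  have hyeq : y = α⁻¹ • ((ν.toFun (u, ‖w‖ • ((radialProjection (spherePt 1) w : 𝕊 1) : 𝔼 2)) : 𝕊 3) : 𝔼 4) := by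
    rw [norm_smul_coe_radialProjection, hqa, hαdef, inv_inv, norm_smul_coe_radialProjection]
  -- the profile point
  set q : ℝ × ℝ := (TraceCollar.ξ α, Real.log (2 / ‖w‖)) with hqdef
  have hqpos : q ∈ TraceCollar.Ωpos := TraceCollar.ξ_pos hα hα1
  have hY : 0 ≤ q.2 := by
    show 0 ≤ Real.log (2 / ‖w‖)
    exact Real.log_nonneg ((le_div_iff₀ hwpos).2 (by linarith))
  have hNT : TraceCollar.Φ q ∈ TraceCollar.Quad := TraceCollar.Φ_mem_Quad hqpos
  have hN : 0 < (TraceCollar.Φ q).1 := hNT.1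
  have hT : 0 < (TraceCollar.Φ q).2 := hNT.2
  have hT2 : (TraceCollar.Φ q).2 ≤ 2 := by
    refine (Tf_le q).trans ?_
    have : Real.exp (-q.2) ≤ 1 := Real.exp_le_one_iff.2 (by linarith)
    linarith
  -- evaluate `collarInv`
  rw [ν.collarInv_inl_of_mem ⟨(u, w), ⟨mem_univ _, by simpa using hw2⟩, hqa⟩, hyeq,
    ν.ΨTube_ptT_arg jA hα hwpos, ← hqdef, ν.ptY_eq jA hT.ne']
  -- evaluate `collar` (branch P at the new point)
  have hmem : ν.toFun (u, (TraceCollar.Φ q).2 • ((radialProjection (spherePt 1) w : 𝕊 1) : 𝔼 2)) ∈ ν.closedTube := by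
    rw [mem_closedTube_iff, norm_smul_coe_sphere hT.le]; exact hT2
  rw [ν.collar_of_mem_closedTube hG _ hmem, cTube_apply]
  have hbase : ν.baseP (ν.toFun (u, (TraceCollar.Φ q).2 • ((radialProjection (spherePt 1) w : 𝕊 1) : 𝔼 2)))
      (-Real.log (TraceCollar.Φ q).1) = q := by
    rw [baseP_apply, neg_neg, Real.exp_log hN, norm_smul_coe_sphere hT.le, Prod.mk.eta,
      TraceCollar.Φinv_Φ hqpos]
  rw [hbase, radialProjection_smul _ hT, ptT]
  congr 2
  · show (TraceCollar.αof q.1)⁻¹ = α⁻¹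
    rw [show q.1 = TraceCollar.ξ α from rfl, TraceCollar.αof_ξ hα.le hα1]
  · rw [show q.2 = Real.log (2 / ‖w‖) from rfl, two_mul_exp_neg_log hwpos]

/-- **branch F'**: `collar (collarInv z) = z` on the cocore [folklore] -/
theorem collar_collarInv_cocore (hG : ν.IsSurgeryWith jA jB) {w : 𝔼 2} (hw : w ≠ 0) :
    ν.collar jA jB (ν.collarInv jA jB (ν.shrink.traceGlueData.inr (0, w))) =
      ν.shrink.traceGlueData.inr (0, w) := by
  set w' := OpenPartialHomeomorph.univBall (0 : 𝔼 2) 2 w with hw'def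
  have hw' : w' ≠ 0 := univBall_ne_zero hw
  have hw'pos : 0 < ‖w'‖ := norm_pos_iff.2 hw'
  have hw'2 : ‖w'‖ < 2 := norm_univBall_lt w
  have hYy : 0 < Real.log (2 / ‖w'‖) := Real.log_pos ((lt_div_iff₀ hw'pos).2 (by linarith))
  have hψ : 0 < TraceCollar.ψ (Real.log (2 / ‖w'‖)) := TraceCollar.ψ_pos hYy
  have hsolid : ((0 : 𝔼 2), radialProjection (spherePt 1) w') ∈ solidTorus := by simp [mem_solidTorus_iff]
  rw [ν.collarInv_inr_zero, ΨFlat]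
  simp only [smul_zero]
  rw [show radF ((0 : 𝔼 2), w) = ‖w'‖ from rfl, jBt_of_norm_lt jB (by simp), ν.collar_of_core hG _ hsolid, cFlat]
  simp only [smul_zero, neg_neg]
  rw [Real.exp_log hψ, TraceCollar.ψinv_ψ hYy, two_mul_exp_neg_log hw'pos, norm_smul_coe_radialProjection,
    hw'def, univBall_symm_apply_apply]

/-- **`collar ∘ collarInv = id` off the core** [folklore] -/
theorem collar_collarInv (hG : ν.IsSurgeryWith jA jB) {z : ν.shrink.OpenTrace} (hz : z ∉ ν.coreC) :
    ν.collar jA jB (ν.collarInv jA jB z) = z := by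
  obtain (⟨y, rfl⟩ | ⟨w, rfl⟩) := ν.shrink.eq_inl_or_eq_inr_zero z
  · by_cases h : radialProjection (spherePt 3) y ∈ ν.closedTube
    · exact ν.collar_collarInv_tube hG hz h
    · exact ν.collar_collarInv_rad hG hz h
  · exact ν.collar_collarInv_cocore hG (ν.inr_zero_not_mem_coreC_iff.1 hz)

end RightInverse

/-! ### The collar misses the core -/

section NotMemCore

variable {Y : Type*} [TopologicalSpace Y] [ChartedSpace (𝔼 3) Y]
  {jA : ν.complement → Y} {jB : ↥solidTorus → Y}

omit [TopologicalSpace Y] [ChartedSpace (𝔼 3) Y] in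
/-- The radial formula takes values off the core. [folklore] -/
theorem cRad_not_mem_coreC (a : ν.complement) (σ : ℝ) : ν.cRad a σ ∉ ν.coreC := by
  have ht : 1 < TraceCollar.tof (Real.exp (-σ)) := TraceCollar.one_lt_tof (Real.exp_pos _)
  have ht0 : 0 < TraceCollar.tof (Real.exp (-σ)) := one_pos.trans ht
  rw [cRad, coreC, ν.shrink.inl_mem_core_iff, norm_smul_coe_sphere ht0.le, not_or]
  refine ⟨not_le.2 ht, ?_⟩
  rintro ⟨u, t, ht1, h⟩
  have h1 := congrArg (radialProjection (spherePt 3)) h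
  rw [radialProjection_smul _ ht0, radialProjection_smul _ (one_pos.trans_le ht1)] at h1
  exact a.2 ⟨u, h1.symm⟩

omit [TopologicalSpace Y] [ChartedSpace (𝔼 3) Y] in
/-- The tube formula takes values off the core. [folklore] -/
theorem cTube_not_mem_coreC (a : ν.complement) (ha : (a : 𝕊 3) ∈ ν.closedTube) (σ : ℝ) :
    ν.cTube a σ ∉ ν.coreC := by
  obtain ⟨⟨u, w⟩, -, hqa⟩ := ha
  have hw : w ≠ 0 := fun h ↦ a.2 (by rw [← hqa, h, ν.apply_zero]; exact mem_range_self u)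
  rw [← hqa, cTube_apply]
  exact ν.ptT_not_mem_core ν.shrink (TraceCollar.αof_pos (ν.fst_baseP_pos u hw σ)) (TraceCollar.αof_lt_one _)
    (by positivity) _ _

omit [TopologicalSpace Y] [ChartedSpace (𝔼 3) Y] in
/-- The flat formula on the core circle of the surgery torus takes values off the core. [folklore] -/
theorem cFlat_zero_not_mem_coreC (v : 𝕊 1) (σ : ℝ) : ν.cFlat ((0 : 𝔼 2), v) σ ∉ ν.coreC := by
  have hrpos : 0 < 2 * Real.exp (-TraceCollar.ψinv (Real.exp (-σ))) := by positivity
  have hYd : 0 < TraceCollar.ψinv (Real.exp (-σ)) := TraceCollar.ψinv_pos _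
  have hr2 : 2 * Real.exp (-TraceCollar.ψinv (Real.exp (-σ))) < 2 := by
    have : Real.exp (-TraceCollar.ψinv (Real.exp (-σ))) < 1 := Real.exp_lt_one_iff.2 (by linarith)
    linarith
  have hrv : ‖(2 * Real.exp (-TraceCollar.ψinv (Real.exp (-σ)))) • (v : 𝔼 2)‖ < 2 := by
    rwa [norm_smul_coe_sphere hrpos.le]
  rw [cFlat]
  simp only [smul_zero]
  rw [inr_zero_not_mem_coreC_iff]
  intro h
  have := congrArg (OpenPartialHomeomorph.univBall (0 : 𝔼 2) 2) h
  rw [univBall_apply_symm_apply hrv, OpenPartialHomeomorph.univBall_apply_zero] at this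
  exact smul_ne_zero hrpos.ne' (ne_zero_of_mem_unit_sphere v) this

/-- **the collar misses the core** [folklore] -/
theorem collar_not_mem_coreC (hG : ν.IsSurgeryWith jA jB) (p : Y × ℝ) : ν.collar jA jB p ∉ ν.coreC := by
  obtain ⟨y, σ⟩ := p
  by_cases hy : y ∈ range jA
  · obtain ⟨a, rfl⟩ := hy
    by_cases ha : (a : 𝕊 3) ∈ ν.closedTube
    · rw [ν.collar_of_mem_closedTube hG a ha]; exact ν.cTube_not_mem_coreC a ha σ
    · rw [ν.collar_of_not_mem_closedTube hG a ha]; exact ν.cRad_not_mem_coreC a σ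
  · obtain ⟨v, h, rfl⟩ := ν.eq_jB_zero_of_not_mem_range hG hy
    rw [ν.collar_of_core hG v h]; exact ν.cFlat_zero_not_mem_coreC v σ

/-- The inverse collar is injective off the core. [folklore] -/
theorem collarInv_injOn (hG : ν.IsSurgeryWith jA jB) : InjOn (ν.collarInv jA jB) (ν.coreC)ᶜ :=
  fun z hz z' hz' h ↦ by
    rw [← ν.collar_collarInv hG hz, ← ν.collar_collarInv hG hz', h]

/-- The collar is injective. [folklore] -/
theorem collar_injective (hG : ν.IsSurgeryWith jA jB) : Injective (ν.collar jA jB) :=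
  fun p p' h ↦ by rw [← ν.collarInv_collar hG p, ← ν.collarInv_collar hG p', h]

/-- **the image of the collar is exactly the complement of the core** [folklore] -/
theorem range_collar (hG : ν.IsSurgeryWith jA jB) : range (ν.collar jA jB) = (ν.coreC)ᶜ := by
  refine Subset.antisymm ?_ ?_
  · rintro _ ⟨p, rfl⟩; exact ν.collar_not_mem_coreC hG p
  · intro z hz; exact ⟨_, ν.collar_collarInv hG hz⟩

end NotMemCore

/-! ### Agreement of the local formulas on overlaps -/

section Agreement

variable {Y : Type*} {jA : ν.complement → Y} {jB : ↥solidTorus → Y}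

/-- **R = P on the overlap**: for `a = ν(u, w)` with `‖w‖ ≥ 2` the radial and tube formulas agree
(the profile is in its radial regime: `Φ⁻¹(D, ‖w‖) = (D, log(2/‖w‖))`) [folklore] -/
theorem cRad_eq_cTube (u : 𝕊 1) {w : 𝔼 2} (hw : 2 ≤ ‖w‖) (σ : ℝ) :
    ν.cRad (ν.toFun (u, w)) σ = ν.cTube (ν.toFun (u, w)) σ := by
  have hwpos : 0 < ‖w‖ := by linarith
  have hD : 0 < Real.exp (-σ) := Real.exp_pos _
  rw [cTube_apply, baseP_apply, TraceCollar.Φinv_of_two_le hD hw, ptT, cRad, TraceCollar.tof]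
  simp only
  rw [neg_neg, Real.exp_log (by positivity), mul_div_cancel₀ _ (two_ne_zero' ℝ),
    norm_smul_coe_radialProjection]

/-- **P = F on the overlap**: for `p ≠ 0` in the flat regime `‖p‖ e^{ψinv D} ≤ 1` the tube formula
at `ν(p̂, ‖p‖ v)` is the flat formula at `(p, v)` [folklore] -/
theorem cTube_eq_cFlat {pv : 𝔼 2} (hp : pv ≠ 0) (v : 𝕊 1) (σ : ℝ)
    (hflat : ‖pv‖ * Real.exp (TraceCollar.ψinv (Real.exp (-σ))) ≤ 1) :
    ν.cTube (ν.toFun (radialProjection (spherePt 1) pv, ‖pv‖ • (v : 𝔼 2))) σ = ν.cFlat (pv, v) σ := by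
  have hppos : 0 < ‖pv‖ := norm_pos_iff.2 hp
  have hD : 0 < Real.exp (-σ) := Real.exp_pos _
  have hYd : 0 < TraceCollar.ψinv (Real.exp (-σ)) := TraceCollar.ψinv_pos _
  have hk : 0 < kOf σ := by rw [kOf]; positivity
  -- the profile is in its flat regime
  have hfp : TraceCollar.Φinv (Real.exp (-σ), ‖‖pv‖ • (v : 𝔼 2)‖) =
      TraceCollar.flatPoint (Real.exp (-σ), ‖pv‖) := by
    rw [norm_smul_coe_sphere hppos.le]
    exact TraceCollar.Φinv_eq_flatPoint hD hppos hflat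
  have hX : (TraceCollar.flatPoint (Real.exp (-σ), ‖pv‖)).1 = ‖pv‖ * kOf σ := by
    simp only [TraceCollar.flatPoint, kOf]; ring
  have hXpos : 0 < ‖pv‖ * kOf σ := mul_pos hppos hk
  have hr : 0 < 2 * Real.exp (-TraceCollar.ψinv (Real.exp (-σ))) := by positivity
  have hr2 : 2 * Real.exp (-TraceCollar.ψinv (Real.exp (-σ))) < 2 := by
    have : Real.exp (-TraceCollar.ψinv (Real.exp (-σ))) < 1 := Real.exp_lt_one_iff.2 (by linarith)
    linarith
  rw [cTube_apply, baseP_apply, hfp, hX, show (TraceCollar.flatPoint (Real.exp (-σ), ‖pv‖)).2 =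
      TraceCollar.ψinv (Real.exp (-σ)) from rfl, radialProjection_smul _ hppos,
    ν.ptT_eq_inr (TraceCollar.αof_pos hXpos) hr hr2, cFlat]
  congr 2
  rw [TraceCollar.αof_eq_Gs_mul, coe_radialProjection_of_ne_zero _ hp, smul_smul]
  congr 1
  field_simp

/-- **R' = P' on the overlap**: for a ball-chart point `y` whose direction is `ν(u, w)` with `‖w‖ ≥ 2`
the radial and tube inverse formulas agree [folklore] -/
theorem ΨRad_eq_ΨTube (jA : ν.complement → Y) {y : 𝔼 4} (hy : 1 < ‖y‖) {u : 𝕊 1} {w : 𝔼 2}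
    (hw : 2 ≤ ‖w‖) (hyu : radialProjection (spherePt 3) y = ν.toFun (u, w)) :
    ν.ΨRad jA y = ν.ΨTube jA y := by
  have hwpos : 0 < ‖w‖ := by linarith
  have hypos : 0 < ‖y‖ := by linarith
  have hα : 0 < ‖y‖⁻¹ := inv_pos.2 hypos
  have hα1 : ‖y‖⁻¹ < 1 := inv_lt_one_of_one_lt₀ hy
  have hX : 0 < TraceCollar.ξ ‖y‖⁻¹ := TraceCollar.ξ_pos hα hα1
  have hY : Real.log (2 / ‖w‖) ≤ 0 := Real.log_nonpos (by positivity) ((div_le_one hwpos).2 hw)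
  have hΦ : ν.profP y = (TraceCollar.ξ ‖y‖⁻¹, 2 * Real.exp (-Real.log (2 / ‖w‖))) := by
    rw [profP, hyu, toHomeo_symm_apply']
    exact TraceCollar.Φ_of_nonpos (p := (TraceCollar.ξ ‖y‖⁻¹, Real.log (2 / ‖w‖))) hX hY
  rw [ΨTube, ΨRad, hΦ, hyu, toHomeo_symm_apply']
  simp only [two_mul_exp_neg_log hwpos]
  refine Prod.ext ?_ rfl
  show ν.jAt jA (ν.toFun (u, w)) = ν.ptY jA ‖w‖ u (radialProjection (spherePt 1) w)
  rw [ptY, norm_smul_coe_radialProjection]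

/-- **P' = F' on the overlap**: for a handle-chart point `(x, w'')` with `x ≠ 0` in the flat regime the tube
inverse formula at `‖x‖⁻¹ • ν'(x̂, w'')` is the flat inverse formula [folklore] -/
theorem ΨTube_eq_ΨFlat [TopologicalSpace Y] [ChartedSpace (𝔼 3) Y] (hG : ν.IsSurgeryWith jA jB)
    {x : 𝔼 2} (hx : x ≠ 0) (hx1 : ‖x‖ < 1) {w : 𝔼 2} (hw : w ≠ 0)
    (hflat : 2 * TraceCollar.ξ ‖x‖ ≤
      TraceCollar.ψ (Real.log (2 / ‖OpenPartialHomeomorph.univBall (0 : 𝔼 2) 2 w‖))) :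
    ν.ΨTube jA (ν.shrink.traceBwd (x, w)) = ΨFlat jB (x, w) := by
  set w' := OpenPartialHomeomorph.univBall (0 : 𝔼 2) 2 w with hw'def
  have hw' : w' ≠ 0 := univBall_ne_zero hw
  have hw'pos : 0 < ‖w'‖ := norm_pos_iff.2 hw'
  have hw'2 : ‖w'‖ < 2 := norm_univBall_lt w
  have hxpos : 0 < ‖x‖ := norm_pos_iff.2 hx
  have hYy : 0 < Real.log (2 / ‖w'‖) := Real.log_pos ((lt_div_iff₀ hw'pos).2 (by linarith))
  have hξ : 0 ≤ TraceCollar.ξ ‖x‖ := TraceCollar.ξ_nonneg hxpos.le hx1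
  -- the ball-chart point and its direction
  have hy : ν.shrink.traceBwd (x, w) = ‖x‖⁻¹ • ((ν.toFun (radialProjection (spherePt 1) x, w') : 𝕊 3) : 𝔼 4) := by
    conv_lhs => rw [← norm_smul_coe_radialProjection (spherePt 1) x]
    rw [ν.shrink.traceBwd_apply hxpos, shrink_apply]
  have hnorm : ‖ν.shrink.traceBwd (x, w)‖ = ‖x‖⁻¹ := by rw [ν.shrink.norm_traceBwd]
  have hdir : radialProjection (spherePt 3) (ν.shrink.traceBwd (x, w)) =
      ν.toFun (radialProjection (spherePt 1) x, w') := by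
    rw [hy, radialProjection_smul _ (inv_pos.2 hxpos)]
  -- the profile is in its flat regime
  have hΦ : ν.profP (ν.shrink.traceBwd (x, w)) =
      (TraceCollar.ψ (Real.log (2 / ‖w'‖)),
        2 * Real.exp (-Real.log (2 / ‖w'‖)) * (TraceCollar.ξ ‖x‖ / TraceCollar.ψ (Real.log (2 / ‖w'‖)))) := by
    rw [profP, hnorm, inv_inv, hdir, toHomeo_symm_apply']
    exact TraceCollar.Φ_of_flat (p := (TraceCollar.ξ ‖x‖, Real.log (2 / ‖w'‖))) hξ hYy hflat
  have hψ : 0 < TraceCollar.ψ (Real.log (2 / ‖w'‖)) := TraceCollar.ψ_pos hYy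
  -- the new tube radius is `< 1`, so the point is in the solid torus chart
  set τ : ℝ := 2 * Real.exp (-Real.log (2 / ‖w'‖)) * (TraceCollar.ξ ‖x‖ / TraceCollar.ψ (Real.log (2 / ‖w'‖)))
    with hτdef
  have hτeq : τ = ‖w'‖ * (TraceCollar.ξ ‖x‖ / TraceCollar.ψ (Real.log (2 / ‖w'‖))) := by
    rw [hτdef, two_mul_exp_neg_log hw'pos]
  have hτpos : 0 < τ := by
    rw [hτeq]; exact mul_pos hw'pos (div_pos (TraceCollar.ξ_pos hxpos hx1) hψ)
  have hτ1 : τ < 1 := by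
    rw [hτeq]
    have h1 : TraceCollar.ξ ‖x‖ / TraceCollar.ψ (Real.log (2 / ‖w'‖)) ≤ 2⁻¹ := by
      rw [div_le_iff₀ hψ]; linarith
    calc ‖w'‖ * (TraceCollar.ξ ‖x‖ / TraceCollar.ψ (Real.log (2 / ‖w'‖))) ≤ ‖w'‖ * 2⁻¹ := by gcongr
      _ < 1 := by linarith
  rw [ΨTube, hΦ, hdir, toHomeo_symm_apply', ΨFlat]
  simp only
  rw [ν.ptY_eq_jB hG hτpos hτ1, show radF (x, w) = ‖w'‖ from rfl]
  congr 2
  refine Prod.ext ?_ rfl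
  show τ • ((radialProjection (spherePt 1) x : 𝕊 1) : 𝔼 2) =
    (‖w'‖ / TraceCollar.ψ (Real.log (2 / ‖w'‖)) * (1 - ‖x‖ ^ 2)⁻¹) • x
  rw [hτeq, coe_radialProjection_of_ne_zero _ hx, smul_smul, TraceCollar.ξ_eq_mul]
  congr 1
  field_simp

end Agreement

/-! ### Smoothness of the three collar formulas in coordinates -/

section SmoothFormulas

/-- Scalar multiplication as a smooth map `ℝ × E → E` (helper for `ContMDiff` goals) [folklore] -/
theorem contDiff_smul_pair (E : Type*) [NormedAddCommGroup E] [NormedSpace ℝ E] :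
    ContDiff ℝ ∞ (fun p : ℝ × E ↦ p.1 • p.2) := contDiff_fst.smul contDiff_snd

/-- The radial formula in coordinates [folklore] -/
def fR (q : (𝕊 3) × ℝ) : 𝔼 4 := TraceCollar.tof (Real.exp (-q.2)) • ((q.1 : 𝕊 3) : 𝔼 4)

omit ν in
/-- The radial formula is smooth. [folklore] -/
theorem contMDiff_fR : ContMDiff ((𝓡 3).prod 𝓘(ℝ, ℝ)) 𝓘(ℝ, 𝔼 4) ∞ fR := by
  haveI : Fact (Module.finrank ℝ (𝔼 4) = 3 + 1) := ⟨by simp⟩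
  intro q
  have h1 : ContMDiffAt ((𝓡 3).prod 𝓘(ℝ, ℝ)) 𝓘(ℝ, 𝔼 4) ∞ (fun q : (𝕊 3) × ℝ ↦ ((q.1 : 𝕊 3) : 𝔼 4)) q :=
    ((contMDiff_coe_sphere (E := 𝔼 4) (n := 3)).comp contMDiff_fst).contMDiffAt
  have h2 : ContMDiffAt ((𝓡 3).prod 𝓘(ℝ, ℝ)) 𝓘(ℝ, ℝ) ∞ (fun q : (𝕊 3) × ℝ ↦ TraceCollar.tof (Real.exp (-q.2))) q := by
    have he : ContDiffAt ℝ ∞ (fun σ : ℝ ↦ Real.exp (-σ)) q.2 := (Real.contDiff_exp.comp contDiff_neg).contDiffAt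
    have ht : ContDiffAt ℝ ∞ (fun σ : ℝ ↦ TraceCollar.tof (Real.exp (-σ))) q.2 :=
      ContDiffAt.comp (g := TraceCollar.tof) (f := fun σ : ℝ ↦ Real.exp (-σ)) q.2
        (TraceCollar.contDiffAt_tof (X := Real.exp (-q.2)) (Real.exp_pos _)) he
    exact ht.contMDiffAt.comp q contMDiff_snd.contMDiffAt
  exact (contDiff_smul_pair (𝔼 4)).contMDiff.contMDiffAt.comp q (h2.prodMk_space h1)

/-- The tube formula in coordinates `((u, w), σ) ↦ (αof X)⁻¹ • ν(u, 2e^{-Y} ŵ)`, `(X, Y) = Φ⁻¹(e^{-σ}, ‖w‖)` [folklore] -/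
def fP (q : ((𝕊 1) × (𝔼 2)) × ℝ) : 𝔼 4 :=
  (TraceCollar.αof (TraceCollar.Φinv (Real.exp (-q.2), ‖q.1.2‖)).1)⁻¹ •
    ((ν.toFun (q.1.1, (2 * Real.exp (-(TraceCollar.Φinv (Real.exp (-q.2), ‖q.1.2‖)).2)) •
      ((radialProjection (spherePt 1) q.1.2 : 𝕊 1) : 𝔼 2)) : 𝕊 3) : 𝔼 4)

/-- The tube formula is `inl ∘ fP` in tube coordinates (definitionally). [folklore] -/
theorem cTube_eq_fP (a : 𝕊 3) (σ : ℝ) :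
    ν.cTube a σ = ν.shrink.traceGlueData.inl (ν.fP (ν.toHomeo.symm a, σ)) := rfl

/-- The radial formula is `inl ∘ fR` (definitionally). [folklore] -/
theorem cRad_eq_fR (a : 𝕊 3) (σ : ℝ) : ν.cRad a σ = ν.shrink.traceGlueData.inl (fR (a, σ)) := rfl

/-- The base map `((u, w), σ) ↦ Φ⁻¹ (e^{-σ}, ‖w‖)` is smooth where `w ≠ 0` [folklore] -/
theorem contMDiffAt_baseMap {q : ((𝕊 1) × (𝔼 2)) × ℝ} (hq : q.1.2 ≠ 0) :
    ContMDiffAt (((𝓡 1).prod 𝓘(ℝ, 𝔼 2)).prod 𝓘(ℝ, ℝ)) 𝓘(ℝ, ℝ × ℝ) ∞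
      (fun q : ((𝕊 1) × (𝔼 2)) × ℝ ↦ TraceCollar.Φinv (Real.exp (-q.2), ‖q.1.2‖)) q := by
  have h1 : ContMDiffAt (((𝓡 1).prod 𝓘(ℝ, 𝔼 2)).prod 𝓘(ℝ, ℝ)) 𝓘(ℝ, ℝ) ∞
      (fun q : ((𝕊 1) × (𝔼 2)) × ℝ ↦ Real.exp (-q.2)) q :=
    ((Real.contDiff_exp.comp contDiff_neg).contMDiff.comp contMDiff_snd).contMDiffAt
  have h2 : ContMDiffAt (((𝓡 1).prod 𝓘(ℝ, 𝔼 2)).prod 𝓘(ℝ, ℝ)) 𝓘(ℝ, ℝ) ∞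
      (fun q : ((𝕊 1) × (𝔼 2)) × ℝ ↦ ‖q.1.2‖) q :=
    (contDiffAt_norm ℝ hq).contMDiffAt.comp q (contMDiff_snd.comp contMDiff_fst).contMDiffAt
  exact (TraceCollar.contDiffAt_Φinv (mem_Quad_of_ne_zero q.2 hq)).contMDiffAt.comp q
    (h1.prodMk_space h2)

/-- The tube formula is smooth in tube coordinates off the core circle (`w ≠ 0`). [folklore] -/
theorem contMDiffOn_fP : ContMDiffOn (((𝓡 1).prod 𝓘(ℝ, 𝔼 2)).prod 𝓘(ℝ, ℝ)) 𝓘(ℝ, 𝔼 4) ∞ ν.fP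
    {q | q.1.2 ≠ 0} := by
  haveI : Fact (Module.finrank ℝ (𝔼 4) = 3 + 1) := ⟨by simp⟩
  haveI : Fact (Module.finrank ℝ (𝔼 2) = 1 + 1) := ⟨by simp⟩
  intro q hq
  have hq' : q.1.2 ≠ 0 := hq
  have hbase := contMDiffAt_baseMap hq'
  have hX : 0 < (TraceCollar.Φinv (Real.exp (-q.2), ‖q.1.2‖)).1 :=
    TraceCollar.Φinv_mem (mem_Quad_of_ne_zero q.2 hq')
  -- the scalar `(αof X)⁻¹`
  have h1 : ContMDiffAt (((𝓡 1).prod 𝓘(ℝ, 𝔼 2)).prod 𝓘(ℝ, ℝ)) 𝓘(ℝ, ℝ) ∞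
      (fun q : ((𝕊 1) × (𝔼 2)) × ℝ ↦ (TraceCollar.αof (TraceCollar.Φinv (Real.exp (-q.2), ‖q.1.2‖)).1)⁻¹) q := by
    have ha : ContDiffAt ℝ ∞ (fun r : ℝ × ℝ ↦ (TraceCollar.αof r.1)⁻¹) (TraceCollar.Φinv (Real.exp (-q.2), ‖q.1.2‖)) :=
      (TraceCollar.contDiff_αof.contDiffAt.comp _ contDiffAt_fst).inv (TraceCollar.αof_pos hX).ne'
    exact ContMDiffAt.comp (g := fun r : ℝ × ℝ ↦ (TraceCollar.αof r.1)⁻¹)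
      (f := fun q : ((𝕊 1) × (𝔼 2)) × ℝ ↦ TraceCollar.Φinv (Real.exp (-q.2), ‖q.1.2‖)) q ha.contMDiffAt hbase
  -- the radius `2 e^{-Y}`
  have h2 : ContMDiffAt (((𝓡 1).prod 𝓘(ℝ, 𝔼 2)).prod 𝓘(ℝ, ℝ)) 𝓘(ℝ, ℝ) ∞
      (fun q : ((𝕊 1) × (𝔼 2)) × ℝ ↦ 2 * Real.exp (-(TraceCollar.Φinv (Real.exp (-q.2), ‖q.1.2‖)).2)) q := by
    have ha : ContDiff ℝ ∞ (fun r : ℝ × ℝ ↦ 2 * Real.exp (-r.2)) :=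
      contDiff_const.mul (Real.contDiff_exp.comp contDiff_snd.neg)
    exact ha.contDiffAt.contMDiffAt.comp q hbase
  -- the direction `ŵ : 𝕊 1` as a vector
  have h3 : ContMDiffAt (((𝓡 1).prod 𝓘(ℝ, 𝔼 2)).prod 𝓘(ℝ, ℝ)) 𝓘(ℝ, 𝔼 2) ∞
      (fun q : ((𝕊 1) × (𝔼 2)) × ℝ ↦ ((radialProjection (spherePt 1) q.1.2 : 𝕊 1) : 𝔼 2)) q := by
    have hr : ContMDiffAt 𝓘(ℝ, 𝔼 2) (𝓡 1) ∞ (radialProjection (spherePt 1)) q.1.2 :=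
      (contMDiffOn_radialProjection (spherePt 1)).contMDiffAt (isOpen_ne.mem_nhds hq')
    exact (contMDiff_coe_sphere (E := 𝔼 2) (n := 1)).contMDiffAt.comp q
      (hr.comp q (contMDiff_snd.comp contMDiff_fst).contMDiffAt)
  -- the fibre vector `2 e^{-Y} • ŵ`
  have h4 : ContMDiffAt (((𝓡 1).prod 𝓘(ℝ, 𝔼 2)).prod 𝓘(ℝ, ℝ)) 𝓘(ℝ, 𝔼 2) ∞
      (fun q : ((𝕊 1) × (𝔼 2)) × ℝ ↦ (2 * Real.exp (-(TraceCollar.Φinv (Real.exp (-q.2), ‖q.1.2‖)).2)) •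
        ((radialProjection (spherePt 1) q.1.2 : 𝕊 1) : 𝔼 2)) q :=
    (contDiff_smul_pair (𝔼 2)).contMDiff.contMDiffAt.comp q (h2.prodMk_space h3)
  -- the tube point `ν (u, 2 e^{-Y} • ŵ)` as a vector of `ℝ⁴`
  have h5 : ContMDiffAt (((𝓡 1).prod 𝓘(ℝ, 𝔼 2)).prod 𝓘(ℝ, ℝ)) 𝓘(ℝ, 𝔼 4) ∞
      (fun q : ((𝕊 1) × (𝔼 2)) × ℝ ↦ ((ν.toFun (q.1.1,
        (2 * Real.exp (-(TraceCollar.Φinv (Real.exp (-q.2), ‖q.1.2‖)).2)) •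
          ((radialProjection (spherePt 1) q.1.2 : 𝕊 1) : 𝔼 2)) : 𝕊 3) : 𝔼 4)) q := by
    have hu : ContMDiffAt (((𝓡 1).prod 𝓘(ℝ, 𝔼 2)).prod 𝓘(ℝ, ℝ)) (𝓡 1) ∞
        (fun q : ((𝕊 1) × (𝔼 2)) × ℝ ↦ q.1.1) q := (contMDiff_fst.comp contMDiff_fst).contMDiffAt
    exact ((contMDiff_coe_sphere (E := 𝔼 4) (n := 3)).comp ν.contMDiff).contMDiffAt.comp q (hu.prodMk h4)
  exact ((contDiff_smul_pair (𝔼 4)).contMDiff.contMDiffAt.comp q (h1.prodMk_space h5)).contMDiffWithinAt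

/-- The flat formula in coordinates [folklore] -/
def fF (q : ((𝔼 2) × (𝕊 1)) × ℝ) : (𝔼 2) × (𝔼 2) :=
  ((TraceCollar.Gs (‖q.1.1‖ ^ 2 * kOf q.2 ^ 2) * kOf q.2) • q.1.1,
    (OpenPartialHomeomorph.univBall (0 : 𝔼 2) 2).symm
      ((2 * Real.exp (-TraceCollar.ψinv (Real.exp (-q.2)))) • ((q.1.2 : 𝕊 1) : 𝔼 2)))

/-- The flat formula is `inr ∘ fF` (definitionally). [folklore] -/
theorem cFlat_eq_fF (b : (𝔼 2) × (𝕊 1)) (σ : ℝ) : ν.cFlat b σ = ν.shrink.traceGlueData.inr (fF (b, σ)) := rfl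

omit ν in
/-- The flat-regime scale factor `k(σ)` is smooth. [folklore] -/
theorem contDiffAt_kOf (σ : ℝ) : ContDiffAt ℝ ∞ kOf σ := by
  have h1 : ContDiffAt ℝ ∞ (fun σ : ℝ ↦ Real.exp (-σ)) σ := (Real.contDiff_exp.comp contDiff_neg).contDiffAt
  have h2 : ContDiffAt ℝ ∞ (fun σ : ℝ ↦ TraceCollar.ψinv (Real.exp (-σ))) σ :=
    ContDiffAt.comp (g := TraceCollar.ψinv) (f := fun σ : ℝ ↦ Real.exp (-σ)) σ
      (TraceCollar.contDiffOn_ψinv.contDiffAt (x := Real.exp (-σ)) (Ioi_mem_nhds (Real.exp_pos _))) h1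
  unfold kOf
  exact (h1.mul (Real.contDiff_exp.contDiffAt.comp σ h2)).div_const _

omit ν in
/-- The flat formula is smooth on all of `(ℝ² × 𝕊¹) × ℝ`. [folklore] -/
theorem contMDiff_fF : ContMDiff ((𝓘(ℝ, 𝔼 2).prod (𝓡 1)).prod 𝓘(ℝ, ℝ)) 𝓘(ℝ, (𝔼 2) × (𝔼 2)) ∞ fF := by
  haveI : Fact (Module.finrank ℝ (𝔼 2) = 1 + 1) := ⟨by simp⟩
  intro q
  have hk : ContMDiffAt ((𝓘(ℝ, 𝔼 2).prod (𝓡 1)).prod 𝓘(ℝ, ℝ)) 𝓘(ℝ, ℝ) ∞ (fun q : ((𝔼 2) × (𝕊 1)) × ℝ ↦ kOf q.2) q :=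
    (contDiffAt_kOf q.2).contMDiffAt.comp q contMDiff_snd.contMDiffAt
  have hp : ContMDiffAt ((𝓘(ℝ, 𝔼 2).prod (𝓡 1)).prod 𝓘(ℝ, ℝ)) 𝓘(ℝ, 𝔼 2) ∞ (fun q : ((𝔼 2) × (𝕊 1)) × ℝ ↦ q.1.1) q :=
    (contMDiff_fst.comp contMDiff_fst).contMDiffAt
  -- first component
  have h1 : ContMDiffAt ((𝓘(ℝ, 𝔼 2).prod (𝓡 1)).prod 𝓘(ℝ, ℝ)) 𝓘(ℝ, 𝔼 2) ∞
      (fun q : ((𝔼 2) × (𝕊 1)) × ℝ ↦ (TraceCollar.Gs (‖q.1.1‖ ^ 2 * kOf q.2 ^ 2) * kOf q.2) • q.1.1) q := by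
    have hn : ContMDiffAt ((𝓘(ℝ, 𝔼 2).prod (𝓡 1)).prod 𝓘(ℝ, ℝ)) 𝓘(ℝ, ℝ) ∞
        (fun q : ((𝔼 2) × (𝕊 1)) × ℝ ↦ ‖q.1.1‖ ^ 2) q :=
      ((contDiff_norm_sq ℝ).contMDiff.comp (contMDiff_fst.comp contMDiff_fst)).contMDiffAt
    have harg : ContMDiffAt ((𝓘(ℝ, 𝔼 2).prod (𝓡 1)).prod 𝓘(ℝ, ℝ)) 𝓘(ℝ, ℝ) ∞
        (fun q : ((𝔼 2) × (𝕊 1)) × ℝ ↦ ‖q.1.1‖ ^ 2 * kOf q.2 ^ 2) q :=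
      (show ContDiff ℝ ∞ (fun r : ℝ × ℝ ↦ r.1 * r.2 ^ 2) from contDiff_fst.mul (contDiff_snd.pow 2)).contMDiff.contMDiffAt.comp
        q (hn.prodMk_space hk)
    have hG : ContMDiffAt ((𝓘(ℝ, 𝔼 2).prod (𝓡 1)).prod 𝓘(ℝ, ℝ)) 𝓘(ℝ, ℝ) ∞
        (fun q : ((𝔼 2) × (𝕊 1)) × ℝ ↦ TraceCollar.Gs (‖q.1.1‖ ^ 2 * kOf q.2 ^ 2)) q :=
      (TraceCollar.contDiffAt_Gs (by positivity)).contMDiffAt.comp q harg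
    have hGk : ContMDiffAt ((𝓘(ℝ, 𝔼 2).prod (𝓡 1)).prod 𝓘(ℝ, ℝ)) 𝓘(ℝ, ℝ) ∞
        (fun q : ((𝔼 2) × (𝕊 1)) × ℝ ↦ TraceCollar.Gs (‖q.1.1‖ ^ 2 * kOf q.2 ^ 2) * kOf q.2) q :=
      (show ContDiff ℝ ∞ (fun r : ℝ × ℝ ↦ r.1 * r.2) from contDiff_fst.mul contDiff_snd).contMDiff.contMDiffAt.comp
        q (hG.prodMk_space hk)
    exact (contDiff_smul_pair (𝔼 2)).contMDiff.contMDiffAt.comp q (hGk.prodMk_space hp)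
  -- second component
  have h2 : ContMDiffAt ((𝓘(ℝ, 𝔼 2).prod (𝓡 1)).prod 𝓘(ℝ, ℝ)) 𝓘(ℝ, 𝔼 2) ∞
      (fun q : ((𝔼 2) × (𝕊 1)) × ℝ ↦ (OpenPartialHomeomorph.univBall (0 : 𝔼 2) 2).symm
        ((2 * Real.exp (-TraceCollar.ψinv (Real.exp (-q.2)))) • ((q.1.2 : 𝕊 1) : 𝔼 2))) q := by
    have hr : ContMDiffAt ((𝓘(ℝ, 𝔼 2).prod (𝓡 1)).prod 𝓘(ℝ, ℝ)) 𝓘(ℝ, ℝ) ∞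
        (fun q : ((𝔼 2) × (𝕊 1)) × ℝ ↦ 2 * Real.exp (-TraceCollar.ψinv (Real.exp (-q.2)))) q := by
      have h0 : ContDiffAt ℝ ∞ (fun σ : ℝ ↦ 2 * Real.exp (-TraceCollar.ψinv (Real.exp (-σ)))) q.2 := by
        have he : ContDiffAt ℝ ∞ (fun σ : ℝ ↦ Real.exp (-σ)) q.2 := (Real.contDiff_exp.comp contDiff_neg).contDiffAt
        have ha : ContDiffAt ℝ ∞ (fun σ : ℝ ↦ TraceCollar.ψinv (Real.exp (-σ))) q.2 :=
          ContDiffAt.comp (g := TraceCollar.ψinv) (f := fun σ : ℝ ↦ Real.exp (-σ)) q.2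
            (TraceCollar.contDiffOn_ψinv.contDiffAt (x := Real.exp (-q.2)) (Ioi_mem_nhds (Real.exp_pos _))) he
        exact contDiffAt_const.mul (Real.contDiff_exp.contDiffAt.comp q.2 ha.neg)
      exact h0.contMDiffAt.comp q contMDiff_snd.contMDiffAt
    have hv : ContMDiffAt ((𝓘(ℝ, 𝔼 2).prod (𝓡 1)).prod 𝓘(ℝ, ℝ)) 𝓘(ℝ, 𝔼 2) ∞
        (fun q : ((𝔼 2) × (𝕊 1)) × ℝ ↦ ((q.1.2 : 𝕊 1) : 𝔼 2)) q :=
      ((contMDiff_coe_sphere (E := 𝔼 2) (n := 1)).comp (contMDiff_snd.comp contMDiff_fst)).contMDiffAt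
    have hsm : ContMDiffAt ((𝓘(ℝ, 𝔼 2).prod (𝓡 1)).prod 𝓘(ℝ, ℝ)) 𝓘(ℝ, 𝔼 2) ∞
        (fun q : ((𝔼 2) × (𝕊 1)) × ℝ ↦ (2 * Real.exp (-TraceCollar.ψinv (Real.exp (-q.2)))) • ((q.1.2 : 𝕊 1) : 𝔼 2)) q :=
      (contDiff_smul_pair (𝔼 2)).contMDiff.contMDiffAt.comp q (hr.prodMk_space hv)
    -- the argument lies in the ball of radius `2`
    have hmem : (2 * Real.exp (-TraceCollar.ψinv (Real.exp (-q.2)))) • ((q.1.2 : 𝕊 1) : 𝔼 2) ∈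
        Metric.ball (0 : 𝔼 2) 2 := by
      have hYd : 0 < TraceCollar.ψinv (Real.exp (-q.2)) := TraceCollar.ψinv_pos _
      have hpos : 0 < 2 * Real.exp (-TraceCollar.ψinv (Real.exp (-q.2))) := by positivity
      have : Real.exp (-TraceCollar.ψinv (Real.exp (-q.2))) < 1 := Real.exp_lt_one_iff.2 (by linarith)
      rw [Metric.mem_ball, dist_zero_right, norm_smul_coe_sphere hpos.le]; linarith
    have hκ : ContDiffAt ℝ ∞ (OpenPartialHomeomorph.univBall (0 : 𝔼 2) 2).symm
        ((2 * Real.exp (-TraceCollar.ψinv (Real.exp (-q.2)))) • ((q.1.2 : 𝕊 1) : 𝔼 2)) :=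
      OpenPartialHomeomorph.contDiffOn_univBall_symm.contDiffAt (Metric.isOpen_ball.mem_nhds hmem)
    exact hκ.contMDiffAt.comp q hsm
  exact h1.prodMk_space h2

end SmoothFormulas

/-! ### Smoothness of the collar -/

section SmoothCollar

variable {Y : Type*} [TopologicalSpace Y] [ChartedSpace (𝔼 3) Y]
  {jA : ν.complement → Y} {jB : ↥solidTorus → Y}

/-- `jA` is an open embedding. [folklore] -/
theorem isOpenEmbedding_jA (hG : ν.IsSurgeryWith jA jB) : Topology.IsOpenEmbedding jA := ⟨hG.1.isEmbedding, hG.2.1⟩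

/-- `jB` is an open embedding. [folklore] -/
theorem isOpenEmbedding_jB (hG : ν.IsSurgeryWith jA jB) : Topology.IsOpenEmbedding jB := ⟨hG.2.2.1.isEmbedding, hG.2.2.2.1⟩

/-- The inverse of `jA` is smooth on its range [folklore] -/
theorem contMDiffOn_invFun_jA (hG : ν.IsSurgeryWith jA jB) :
    ContMDiffOn (𝓡 3) (𝓡 3) ∞ (Function.invFun jA) (range jA) := by
  have h := contMDiffOn_symm_of_isSmoothEmbedding hG.1 (ν.isOpenEmbedding_jA hG)
  refine h.congr ?_
  rintro _ ⟨a, rfl⟩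
  rw [Function.leftInverse_invFun (ν.injective_jA hG) a]
  exact ((ν.isOpenEmbedding_jA hG).toOpenPartialHomeomorph_left_inv (x := a)).symm

/-- The inverse of `jB` is smooth on its range [folklore] -/
theorem contMDiffOn_invFun_jB (hG : ν.IsSurgeryWith jA jB) :
    ContMDiffOn (𝓡 3) (𝓘(ℝ, 𝔼 2).prod (𝓡 1)) ∞ (Function.invFun jB) (range jB) := by
  have h := contMDiffOn_symm_of_isSmoothEmbedding hG.2.2.1 (ν.isOpenEmbedding_jB hG)
  refine h.congr ?_
  rintro _ ⟨b, rfl⟩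
  rw [Function.leftInverse_invFun (ν.injective_jB hG) b]
  exact ((ν.isOpenEmbedding_jB hG).toOpenPartialHomeomorph_left_inv (x := b)).symm

/-- `invA : Y → S³` is smooth on `range jA`. [folklore] -/
theorem contMDiffOn_invA (hG : ν.IsSurgeryWith jA jB) : ContMDiffOn (𝓡 3) (𝓡 3) ∞ (ν.invA jA) (range jA) :=
  contMDiff_subtype_val.comp_contMDiffOn (ν.contMDiffOn_invFun_jA hG)

/-- `invB : Y → ℝ² × 𝕊¹` is smooth on `range jB`. [folklore] -/
theorem contMDiffOn_invB (hG : ν.IsSurgeryWith jA jB) :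
    ContMDiffOn (𝓡 3) (𝓘(ℝ, 𝔼 2).prod (𝓡 1)) ∞ (invB jB) (range jB) :=
  contMDiff_subtype_val.comp_contMDiffOn (ν.contMDiffOn_invFun_jB hG)

omit [TopologicalSpace Y] [ChartedSpace (𝔼 3) Y] in
/-- The tube part of `Y` (directions in the open tube `ν(𝕊¹ × ℝ²)`) [folklore] -/
def tubeSet (jA : ν.complement → Y) : Set Y := jA '' {a | (a : 𝕊 3) ∈ range ν.toFun}

/-- The tube part of `Y` is open. [folklore] -/
theorem isOpen_tubeSet (hG : ν.IsSurgeryWith jA jB) : IsOpen (ν.tubeSet jA) :=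
  (ν.isOpenEmbedding_jA hG).isOpenMap _ (ν.isOpen_range.preimage continuous_subtype_val)

/-- The radial part of `Y` is open. [folklore] -/
theorem isOpen_radSet (hG : ν.IsSurgeryWith jA jB) : IsOpen (ν.radSet jA) :=
  (ν.isOpenEmbedding_jA hG).isOpenMap _ (ν.isClosed_closedTube.isOpen_compl.preimage continuous_subtype_val)

/-- On the tube part the collar is the tube formula [folklore] -/
theorem collar_eq_cTube_of_mem_tubeSet (hG : ν.IsSurgeryWith jA jB) {p : Y × ℝ} (hp : p.1 ∈ ν.tubeSet jA) :
    ν.collar jA jB p = ν.shrink.traceGlueData.inl (ν.fP (ν.toHomeo.symm (ν.invA jA p.1), p.2)) := by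
  obtain ⟨y, σ⟩ := p
  obtain ⟨a, ha, rfl⟩ := hp
  simp only at ha ⊢
  rw [ν.invA_apply hG, ← cTube_eq_fP]
  by_cases hc : (a : 𝕊 3) ∈ ν.closedTube
  · exact ν.collar_of_mem_closedTube hG a hc σ
  · rw [ν.collar_of_not_mem_closedTube hG a hc]
    obtain ⟨⟨u, w⟩, hq⟩ := ha
    have hw : 2 ≤ ‖w‖ := by
      by_contra h
      exact hc (hq ▸ (mem_closedTube_iff ν).2 (not_le.1 h).le)
    rw [← hq]
    exact ν.cRad_eq_cTube u hw σ

/-- Outside the closed tube the collar is the radial formula [folklore] -/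
theorem collar_eq_cRad_of_mem_radSet (hG : ν.IsSurgeryWith jA jB) {p : Y × ℝ} (hp : p.1 ∈ ν.radSet jA) :
    ν.collar jA jB p = ν.shrink.traceGlueData.inl (fR (ν.invA jA p.1, p.2)) := by
  obtain ⟨y, σ⟩ := p
  obtain ⟨a, ha, rfl⟩ := hp
  simp only at ha ⊢
  rw [ν.invA_apply hG, ← cRad_eq_fR]
  exact ν.collar_of_not_mem_closedTube hG a ha σ

/-- The flat region of `Y × ℝ`: points of the solid-torus piece with `‖p‖ e^{ψinv (e^{-σ})} < 1` [folklore] -/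
def flatSetY (jB : ↥solidTorus → Y) : Set (Y × ℝ) :=
  (range jB ×ˢ univ) ∩ {p | ‖(invB jB p.1).1‖ * Real.exp (TraceCollar.ψinv (Real.exp (-p.2))) < 1}

/-- The flat region of `Y × ℝ` is open. [folklore] -/
theorem isOpen_flatSetY (hG : ν.IsSurgeryWith jA jB) : IsOpen (flatSetY jB) := by
  have ho : IsOpen (range jB ×ˢ (univ : Set ℝ)) := hG.2.2.2.1.prod isOpen_univ
  have hc : ContinuousOn (fun p : Y × ℝ ↦ ‖(invB jB p.1).1‖ * Real.exp (TraceCollar.ψinv (Real.exp (-p.2))))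
      (range jB ×ˢ (univ : Set ℝ)) := by
    refine ContinuousOn.mul ?_ ?_
    · refine (continuous_norm.comp continuous_fst).comp_continuousOn ?_
      exact (ν.contMDiffOn_invB hG).continuousOn.comp continuous_fst.continuousOn fun p hp ↦ hp.1
    · refine Continuous.continuousOn ?_
      refine Real.continuous_exp.comp ?_
      have h1 : Continuous fun p : Y × ℝ ↦ Real.exp (-p.2) := Real.continuous_exp.comp (continuous_neg.comp continuous_snd)
      exact TraceCollar.contDiffOn_ψinv.continuousOn.comp_continuous h1 fun p ↦ Real.exp_pos _
  exact hc.isOpen_inter_preimage ho isOpen_Iio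

/-- On the flat region the collar is the flat formula [folklore] -/
theorem collar_eq_cFlat_of_mem_flatSetY (hG : ν.IsSurgeryWith jA jB) {p : Y × ℝ} (hp : p ∈ flatSetY jB) :
    ν.collar jA jB p = ν.shrink.traceGlueData.inr (fF (invB jB p.1, p.2)) := by
  obtain ⟨y, σ⟩ := p
  obtain ⟨⟨hy, -⟩, hlt⟩ := hp
  obtain ⟨⟨⟨pv, v⟩, hb⟩, rfl⟩ := hy
  simp only [mem_setOf_eq] at hlt
  rw [ν.invB_apply hG] at hlt ⊢
  simp only at hlt ⊢
  rw [← cFlat_eq_fF]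
  by_cases hpv : pv = 0
  · subst hpv
    exact ν.collar_of_core hG v hb σ
  · -- the point is `jA (ν (p̂, ‖p‖ v))`
    have hlt1 : ‖pv‖ < 1 := (mem_solidTorus_iff (pv, v)).1 hb
    have hpos : 0 < ‖pv‖ := norm_pos_iff.2 hpv
    set a : ν.complement := ⟨ν.toFun (radialProjection (spherePt 1) pv, ‖pv‖ • (v : 𝔼 2)),
      ν.apply_smul_not_mem_range hpos.ne' _ _⟩ with hadef
    have hya : jB ⟨(pv, v), hb⟩ = jA a := by
      rw [eq_comm, ν.jA_eq_jB_iff hG]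
      exact ⟨_, _, ⟨hpos, hlt1⟩, (norm_smul_coe_radialProjection _ _).symm, rfl⟩
    have hmem : (a : 𝕊 3) ∈ ν.closedTube := by
      show ν.toFun _ ∈ _
      rw [mem_closedTube_iff, norm_smul_coe_sphere hpos.le]; linarith
    rw [hya, ν.collar_of_mem_closedTube hG a hmem]
    exact ν.cTube_eq_cFlat hpv v σ hlt.le

/-- Points of `Y × ℝ` over the core circle of the surgery torus lie in the flat region. [folklore] -/
theorem mem_flatSetY_of_not_mem_range (hG : ν.IsSurgeryWith jA jB) {p : Y × ℝ} (hp : p.1 ∉ range jA) :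
    p ∈ flatSetY jB := by
  obtain ⟨v, h, hy⟩ := ν.eq_jB_zero_of_not_mem_range hG hp
  refine ⟨⟨⟨_, hy⟩, mem_univ _⟩, ?_⟩
  show ‖(invB jB p.1).1‖ * Real.exp (TraceCollar.ψinv (Real.exp (-p.2))) < 1
  rw [← hy, ν.invB_apply hG]
  simp

omit [TopologicalSpace Y] [ChartedSpace (𝔼 3) Y] in
/-- Every point of `Y` is in the tube part, in the radial part, or on the core circle of the surgery torus. [folklore] -/
theorem mem_tubeSet_or (jA : ν.complement → Y) (y : Y) :
    y ∈ ν.tubeSet jA ∨ y ∈ ν.radSet jA ∨ y ∉ range jA := by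
  by_cases hy : y ∈ range jA
  · obtain ⟨a, rfl⟩ := hy
    by_cases ha : (a : 𝕊 3) ∈ range ν.toFun
    · exact Or.inl ⟨a, ha, rfl⟩
    · exact Or.inr (Or.inl ⟨a, fun h ↦ ha (ν.closedTube_subset_range h), rfl⟩)
  · exact Or.inr (Or.inr hy)

/-- **the collar is smooth** [folklore] -/
theorem contMDiff_collar (hG : ν.IsSurgeryWith jA jB) :
    ContMDiff ((𝓡 3).prod 𝓘(ℝ, ℝ)) 𝓘(ℝ, 𝔼 4) ∞ (ν.collar jA jB) := by
  intro p
  rcases ν.mem_tubeSet_or jA p.1 with hp | hp | hp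
  · -- tube part: `collar = inl ∘ fP ∘ (ν⁻¹ ∘ invA × id)`
    have hopen : IsOpen ((ν.tubeSet jA) ×ˢ (univ : Set ℝ)) := (ν.isOpen_tubeSet hG).prod isOpen_univ
    have hev : ν.collar jA jB =ᶠ[𝓝 p]
        fun p ↦ ν.shrink.traceGlueData.inl (ν.fP (ν.toHomeo.symm (ν.invA jA p.1), p.2)) := by
      filter_upwards [hopen.mem_nhds ⟨hp, mem_univ _⟩] with p' hp'
      exact ν.collar_eq_cTube_of_mem_tubeSet hG hp'.1
    refine ContMDiffAt.congr_of_eventuallyEq ?_ hev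
    -- coordinates
    have hco : ContMDiffOn (𝓡 3) ((𝓡 1).prod 𝓘(ℝ, 𝔼 2)) ∞ (fun y ↦ ν.toHomeo.symm (ν.invA jA y)) (ν.tubeSet jA) := by
      refine ν.contMDiffOn_toHomeo_symm.comp ((ν.contMDiffOn_invA hG).mono (image_subset_range _ _)) ?_
      rintro _ ⟨a, ha, rfl⟩
      show ν.invA jA (jA a) ∈ range ν.toFun
      rw [ν.invA_apply hG]; exact ha
    have hco' : ContMDiffAt ((𝓡 3).prod 𝓘(ℝ, ℝ)) (((𝓡 1).prod 𝓘(ℝ, 𝔼 2)).prod 𝓘(ℝ, ℝ)) ∞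
        (fun p : Y × ℝ ↦ (ν.toHomeo.symm (ν.invA jA p.1), p.2)) p :=
      ((hco.contMDiffAt ((ν.isOpen_tubeSet hG).mem_nhds hp)).comp p contMDiffAt_fst).prodMk contMDiffAt_snd
    -- the fibre coordinate is nonzero
    obtain ⟨a, ⟨q, hq⟩, hpa⟩ := hp
    have hw : (ν.toHomeo.symm (ν.invA jA p.1)).2 ≠ 0 := by
      rw [← hpa, ν.invA_apply hG, ← hq, ν.toHomeo_symm_apply]
      intro h0
      apply a.2
      rw [← hq, show q = (q.1, q.2) from rfl, h0, ν.apply_zero]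
      exact mem_range_self _
    have hfP : ContMDiffAt (((𝓡 1).prod 𝓘(ℝ, 𝔼 2)).prod 𝓘(ℝ, ℝ)) 𝓘(ℝ, 𝔼 4) ∞ ν.fP
        (ν.toHomeo.symm (ν.invA jA p.1), p.2) :=
      ν.contMDiffOn_fP.contMDiffAt ((isOpen_ne.preimage (continuous_snd.comp continuous_fst)).mem_nhds hw)
    exact ν.shrink.traceGlueData.contMDiff_inl.contMDiffAt.comp p
      (ContMDiffAt.comp (g := ν.fP) (f := fun p : Y × ℝ ↦ (ν.toHomeo.symm (ν.invA jA p.1), p.2)) p hfP hco')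
  · -- radial part: `collar = inl ∘ fR ∘ (invA × id)`
    have hopen : IsOpen ((ν.radSet jA) ×ˢ (univ : Set ℝ)) := (ν.isOpen_radSet hG).prod isOpen_univ
    have hev : ν.collar jA jB =ᶠ[𝓝 p] fun p ↦ ν.shrink.traceGlueData.inl (fR (ν.invA jA p.1, p.2)) := by
      filter_upwards [hopen.mem_nhds ⟨hp, mem_univ _⟩] with p' hp'
      exact ν.collar_eq_cRad_of_mem_radSet hG hp'.1
    refine ContMDiffAt.congr_of_eventuallyEq ?_ hev
    have hco : ContMDiffAt ((𝓡 3).prod 𝓘(ℝ, ℝ)) ((𝓡 3).prod 𝓘(ℝ, ℝ)) ∞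
        (fun p : Y × ℝ ↦ (ν.invA jA p.1, p.2)) p :=
      (((ν.contMDiffOn_invA hG).contMDiffAt (hG.2.1.mem_nhds (ν.radSet_subset_range jA hp))).comp p
        contMDiffAt_fst).prodMk contMDiffAt_snd
    exact ν.shrink.traceGlueData.contMDiff_inl.contMDiffAt.comp p
      (ContMDiffAt.comp (g := fR) (f := fun p : Y × ℝ ↦ (ν.invA jA p.1, p.2)) p contMDiff_fR.contMDiffAt hco)
  · -- flat region: `collar = inr ∘ fF ∘ (invB × id)`
    have hmem : p ∈ flatSetY jB := ν.mem_flatSetY_of_not_mem_range hG hp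
    have hev : ν.collar jA jB =ᶠ[𝓝 p] fun p ↦ ν.shrink.traceGlueData.inr (fF (invB jB p.1, p.2)) := by
      filter_upwards [(ν.isOpen_flatSetY hG).mem_nhds hmem] with p' hp'
      exact ν.collar_eq_cFlat_of_mem_flatSetY hG hp'
    refine ContMDiffAt.congr_of_eventuallyEq ?_ hev
    have hco : ContMDiffAt ((𝓡 3).prod 𝓘(ℝ, ℝ)) ((𝓘(ℝ, 𝔼 2).prod (𝓡 1)).prod 𝓘(ℝ, ℝ)) ∞
        (fun p : Y × ℝ ↦ (invB jB p.1, p.2)) p :=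
      (((ν.contMDiffOn_invB hG).contMDiffAt (hG.2.2.2.1.mem_nhds hmem.1.1)).comp p contMDiffAt_fst).prodMk
        contMDiffAt_snd
    exact ν.shrink.traceGlueData.contMDiff_inr.contMDiffAt.comp p
      (ContMDiffAt.comp (g := fF) (f := fun p : Y × ℝ ↦ (invB jB p.1, p.2)) p contMDiff_fF.contMDiffAt hco)

end SmoothCollar

/-! ### Smoothness of the inverse collar -/

section SmoothInv

variable {Y : Type*} [TopologicalSpace Y] [ChartedSpace (𝔼 3) Y]
  {jA : ν.complement → Y} {jB : ↥solidTorus → Y}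

/-- `jAt` is smooth on the complement of the core circle [folklore] -/
theorem contMDiffOn_jAt (hG : ν.IsSurgeryWith jA jB) : ContMDiffOn (𝓡 3) (𝓡 3) ∞ (ν.jAt jA) ν.complement :=
  hG.1.contMDiff.comp_contMDiffOn (contMDiffOn_toOpens' (I := 𝓡 3) ν.complement ν.basePtA)

/-- `jBt` is smooth on the open solid torus [folklore] -/
theorem contMDiffOn_jBt (hG : ν.IsSurgeryWith jA jB) :
    ContMDiffOn (𝓘(ℝ, 𝔼 2).prod (𝓡 1)) (𝓡 3) ∞ (jBt jB) solidTorus :=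
  hG.2.2.1.contMDiff.comp_contMDiffOn (contMDiffOn_toOpens' (I := 𝓘(ℝ, 𝔼 2).prod (𝓡 1)) solidTorus basePtB)

/-- The collar height `-log ξ(1/‖y‖)` is smooth on `‖y‖ > 1` [folklore] -/
theorem contDiffAt_heightR {y : 𝔼 4} (hy : 1 < ‖y‖) :
    ContDiffAt ℝ ∞ (fun y : 𝔼 4 ↦ -Real.log (TraceCollar.ξ ‖y‖⁻¹)) y := by
  have hy0 : y ≠ 0 := by rintro rfl; norm_num at hy
  have hpos : 0 < ‖y‖ := by linarith
  have hα : 0 < ‖y‖⁻¹ := inv_pos.2 hpos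
  have hα1 : ‖y‖⁻¹ < 1 := inv_lt_one_of_one_lt₀ hy
  have h1 : ContDiffAt ℝ ∞ (fun y : 𝔼 4 ↦ ‖y‖⁻¹) y := (contDiffAt_norm ℝ hy0).inv hpos.ne'
  have h2 : ContDiffAt ℝ ∞ (fun y : 𝔼 4 ↦ TraceCollar.ξ ‖y‖⁻¹) y :=
    ContDiffAt.comp (g := TraceCollar.ξ) (f := fun y : 𝔼 4 ↦ ‖y‖⁻¹) y
      (TraceCollar.contDiffAt_ξ (by rw [abs_of_pos hα]; exact hα1)) h1
  exact (h2.log (TraceCollar.ξ_pos hα hα1).ne').neg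

omit ν in
/-- The radial projection `ℝ⁴ ∖ 0 → S³` is smooth. [folklore] -/
theorem contMDiffAt_radialProjection3 {y : 𝔼 4} (hy : y ≠ 0) :
    ContMDiffAt 𝓘(ℝ, 𝔼 4) (𝓡 3) ∞ (radialProjection (spherePt 3)) y :=
  (contMDiffOn_radialProjection (spherePt 3)).contMDiffAt (isOpen_ne.mem_nhds hy)

/-- The radial inverse formula is smooth on `{‖y‖ > 1, ŷ ∉ c(𝕊¹)}` [folklore] -/
theorem contMDiffAt_ΨRad (hG : ν.IsSurgeryWith jA jB) {y : 𝔼 4} (hy : 1 < ‖y‖)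
    (hc : radialProjection (spherePt 3) y ∉ range c) :
    ContMDiffAt 𝓘(ℝ, 𝔼 4) ((𝓡 3).prod 𝓘(ℝ, ℝ)) ∞ (ν.ΨRad jA) y := by
  have hy0 : y ≠ 0 := by rintro rfl; norm_num at hy
  have h1 : ContMDiffAt 𝓘(ℝ, 𝔼 4) (𝓡 3) ∞ (fun y : 𝔼 4 ↦ ν.jAt jA (radialProjection (spherePt 3) y)) y :=
    ((ν.contMDiffOn_jAt hG).contMDiffAt (ν.complement.isOpen.mem_nhds hc)).comp y
      (contMDiffAt_radialProjection3 hy0)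
  exact h1.prodMk (contDiffAt_heightR hy).contMDiffAt

/-- The tube coordinates `ν⁻¹ (y/‖y‖)` are smooth where the direction is in the tube [folklore] -/
theorem contMDiffAt_tubeCoords {y : 𝔼 4} (hy : y ≠ 0) (h : radialProjection (spherePt 3) y ∈ range ν.toFun) :
    ContMDiffAt 𝓘(ℝ, 𝔼 4) ((𝓡 1).prod 𝓘(ℝ, 𝔼 2)) ∞
      (fun y : 𝔼 4 ↦ ν.toHomeo.symm (radialProjection (spherePt 3) y)) y :=
  (ν.contMDiffOn_toHomeo_symm.contMDiffAt (ν.isOpen_range.mem_nhds h)).comp y (contMDiffAt_radialProjection3 hy)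

/-- The profile arguments `(ξ(1/‖y‖), log (2/‖w‖))` are smooth [folklore] -/
theorem contMDiffAt_profArgs {y : 𝔼 4} (hy : 1 < ‖y‖) (h : radialProjection (spherePt 3) y ∈ range ν.toFun)
    (hw : (ν.toHomeo.symm (radialProjection (spherePt 3) y)).2 ≠ 0) :
    ContMDiffAt 𝓘(ℝ, 𝔼 4) 𝓘(ℝ, ℝ × ℝ) ∞ (fun y : 𝔼 4 ↦ (TraceCollar.ξ ‖y‖⁻¹,
      Real.log (2 / ‖(ν.toHomeo.symm (radialProjection (spherePt 3) y)).2‖))) y := by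
  have hy0 : y ≠ 0 := by rintro rfl; norm_num at hy
  have hpos : 0 < ‖y‖ := by linarith
  have hα : 0 < ‖y‖⁻¹ := inv_pos.2 hpos
  have hα1 : ‖y‖⁻¹ < 1 := inv_lt_one_of_one_lt₀ hy
  have h1 : ContMDiffAt 𝓘(ℝ, 𝔼 4) 𝓘(ℝ, ℝ) ∞ (fun y : 𝔼 4 ↦ TraceCollar.ξ ‖y‖⁻¹) y := by
    have ha : ContDiffAt ℝ ∞ (fun y : 𝔼 4 ↦ TraceCollar.ξ ‖y‖⁻¹) y :=
      ContDiffAt.comp (g := TraceCollar.ξ) (f := fun y : 𝔼 4 ↦ ‖y‖⁻¹) y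
        (TraceCollar.contDiffAt_ξ (by rw [abs_of_pos hα]; exact hα1)) ((contDiffAt_norm ℝ hy0).inv hpos.ne')
    exact ha.contMDiffAt
  have h2 : ContMDiffAt 𝓘(ℝ, 𝔼 4) 𝓘(ℝ, ℝ) ∞
      (fun y : 𝔼 4 ↦ Real.log (2 / ‖(ν.toHomeo.symm (radialProjection (spherePt 3) y)).2‖)) y := by
    have hw' : ContMDiffAt 𝓘(ℝ, 𝔼 4) 𝓘(ℝ, 𝔼 2) ∞ (fun y : 𝔼 4 ↦ (ν.toHomeo.symm (radialProjection (spherePt 3) y)).2) y :=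
      contMDiffAt_snd.comp y (ν.contMDiffAt_tubeCoords hy0 h)
    have hl : ContDiffAt ℝ ∞ (fun w : 𝔼 2 ↦ Real.log (2 / ‖w‖)) (ν.toHomeo.symm (radialProjection (spherePt 3) y)).2 := by
      have hn : ContDiffAt ℝ ∞ (fun w : 𝔼 2 ↦ ‖w‖) _ := contDiffAt_norm ℝ hw
      have hpos' : 0 < ‖(ν.toHomeo.symm (radialProjection (spherePt 3) y)).2‖ := norm_pos_iff.2 hw
      exact ((contDiffAt_const.div hn hpos'.ne').log (div_pos two_pos hpos').ne')
    exact hl.contMDiffAt.comp y hw'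
  exact h1.prodMk_space h2

/-- The tube inverse formula is smooth on `{‖y‖ > 1, ŷ ∈ ν(𝕊¹ × (ℝ² ∖ 0))}` [folklore] -/
theorem contMDiffAt_ΨTube (hG : ν.IsSurgeryWith jA jB) {y : 𝔼 4} (hy : 1 < ‖y‖)
    (h : radialProjection (spherePt 3) y ∈ range ν.toFun)
    (hw : (ν.toHomeo.symm (radialProjection (spherePt 3) y)).2 ≠ 0) :
    ContMDiffAt 𝓘(ℝ, 𝔼 4) ((𝓡 3).prod 𝓘(ℝ, ℝ)) ∞ (ν.ΨTube jA) y := by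
  haveI : Fact (Module.finrank ℝ (𝔼 2) = 1 + 1) := ⟨by simp⟩
  have hy0 : y ≠ 0 := by rintro rfl; norm_num at hy
  have hpos : 0 < ‖y‖ := by linarith
  have hα : 0 < ‖y‖⁻¹ := inv_pos.2 hpos
  have hα1 : ‖y‖⁻¹ < 1 := inv_lt_one_of_one_lt₀ hy
  have hargs := ν.contMDiffAt_profArgs hy h hw
  -- the profile point is off the axis, so `Φ` is smooth there and `N, T > 0`
  have hX : 0 < TraceCollar.ξ ‖y‖⁻¹ := TraceCollar.ξ_pos hα hα1
  have hΩ : (TraceCollar.ξ ‖y‖⁻¹, Real.log (2 / ‖(ν.toHomeo.symm (radialProjection (spherePt 3) y)).2‖)) ∈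
      TraceCollar.Ωpos := hX
  have hprof : ContMDiffAt 𝓘(ℝ, 𝔼 4) 𝓘(ℝ, ℝ × ℝ) ∞ (ν.profP) y :=
    ContMDiffAt.comp (g := TraceCollar.Φ)
      (f := fun y : 𝔼 4 ↦ (TraceCollar.ξ ‖y‖⁻¹, Real.log (2 / ‖(ν.toHomeo.symm (radialProjection (spherePt 3) y)).2‖)))
      y (TraceCollar.contDiffAt_Φ (TraceCollar.Ωpos_subset_Ω hΩ)).contMDiffAt hargs
  have hNT : ν.profP y ∈ TraceCollar.Quad := TraceCollar.Φ_mem_Quad hΩ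
  have hN : 0 < (ν.profP y).1 := hNT.1
  have hT : 0 < (ν.profP y).2 := hNT.2
  -- second component `-log N`
  have h2 : ContMDiffAt 𝓘(ℝ, 𝔼 4) 𝓘(ℝ, ℝ) ∞ (fun y : 𝔼 4 ↦ -Real.log (ν.profP y).1) y := by
    have hl : ContDiffAt ℝ ∞ (fun r : ℝ × ℝ ↦ -Real.log r.1) (ν.profP y) := (contDiffAt_fst.log hN.ne').neg
    exact ContMDiffAt.comp (g := fun r : ℝ × ℝ ↦ -Real.log r.1) (f := ν.profP) y hl.contMDiffAt hprof
  -- first component `jAt (ν (u, T • v̂))`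
  have hcoords := ν.contMDiffAt_tubeCoords hy0 h
  have hu : ContMDiffAt 𝓘(ℝ, 𝔼 4) (𝓡 1) ∞ (fun y : 𝔼 4 ↦ (ν.toHomeo.symm (radialProjection (spherePt 3) y)).1) y :=
    contMDiffAt_fst.comp y hcoords
  have hv : ContMDiffAt 𝓘(ℝ, 𝔼 4) 𝓘(ℝ, 𝔼 2) ∞
      (fun y : 𝔼 4 ↦ ((radialProjection (spherePt 1) (ν.toHomeo.symm (radialProjection (spherePt 3) y)).2 : 𝕊 1) : 𝔼 2)) y := by
    have hr : ContMDiffAt 𝓘(ℝ, 𝔼 2) (𝓡 1) ∞ (radialProjection (spherePt 1)) (ν.toHomeo.symm (radialProjection (spherePt 3) y)).2 :=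
      (contMDiffOn_radialProjection (spherePt 1)).contMDiffAt (isOpen_ne.mem_nhds hw)
    exact (contMDiff_coe_sphere (E := 𝔼 2) (n := 1)).contMDiffAt.comp y (hr.comp y (contMDiffAt_snd.comp y hcoords))
  have hTm : ContMDiffAt 𝓘(ℝ, 𝔼 4) 𝓘(ℝ, ℝ) ∞ (fun y : 𝔼 4 ↦ (ν.profP y).2) y :=
    ContMDiffAt.comp (g := fun r : ℝ × ℝ ↦ r.2) (f := ν.profP) y contDiffAt_snd.contMDiffAt hprof
  have hfib : ContMDiffAt 𝓘(ℝ, 𝔼 4) 𝓘(ℝ, 𝔼 2) ∞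
      (fun y : 𝔼 4 ↦ (ν.profP y).2 • ((radialProjection (spherePt 1) (ν.toHomeo.symm (radialProjection (spherePt 3) y)).2 : 𝕊 1) : 𝔼 2)) y :=
    (contDiff_smul_pair (𝔼 2)).contMDiff.contMDiffAt.comp y (hTm.prodMk_space hv)
  have hpt : ContMDiffAt 𝓘(ℝ, 𝔼 4) (𝓡 3) ∞
      (fun y : 𝔼 4 ↦ ν.toFun ((ν.toHomeo.symm (radialProjection (spherePt 3) y)).1,
        (ν.profP y).2 • ((radialProjection (spherePt 1) (ν.toHomeo.symm (radialProjection (spherePt 3) y)).2 : 𝕊 1) : 𝔼 2))) y :=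
    ν.contMDiff.contMDiffAt.comp y (hu.prodMk hfib)
  have hmem : ν.toFun ((ν.toHomeo.symm (radialProjection (spherePt 3) y)).1,
      (ν.profP y).2 • ((radialProjection (spherePt 1) (ν.toHomeo.symm (radialProjection (spherePt 3) y)).2 : 𝕊 1) : 𝔼 2)) ∈
      ν.complement := ν.apply_smul_not_mem_range hT.ne' _ _
  have h1 : ContMDiffAt 𝓘(ℝ, 𝔼 4) (𝓡 3) ∞ (fun y : 𝔼 4 ↦ ν.ptY jA (ν.profP y).2
      (ν.toHomeo.symm (radialProjection (spherePt 3) y)).1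
      (radialProjection (spherePt 1) (ν.toHomeo.symm (radialProjection (spherePt 3) y)).2)) y :=
    ((ν.contMDiffOn_jAt hG).contMDiffAt (ν.complement.isOpen.mem_nhds hmem)).comp y hpt
  exact h1.prodMk h2

/-- The flat-regime set of the handle chart [folklore] -/
def flatSetT : Set ((𝔼 2) × (𝔼 2)) :=
  {z | ‖z.1‖ < 1 ∧ z.2 ≠ 0 ∧ 2 * TraceCollar.ξ ‖z.1‖ <
    TraceCollar.ψ (Real.log (2 / ‖OpenPartialHomeomorph.univBall (0 : 𝔼 2) 2 z.2‖))}

omit ν in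
/-- The tube radius `‖univBall w''‖` is smooth in the handle chart where `w'' ≠ 0`. [folklore] -/
theorem contDiffAt_radF {z : (𝔼 2) × (𝔼 2)} (hz : z.2 ≠ 0) : ContDiffAt ℝ ∞ radF z := by
  unfold radF
  exact (contDiffAt_norm ℝ (univBall_ne_zero hz)).comp z
    ((OpenPartialHomeomorph.contDiff_univBall (c := (0 : 𝔼 2)) (r := 2)).contDiffAt.comp z contDiffAt_snd)

omit ν in
/-- The flat-regime set of the handle chart is open. [folklore] -/
theorem isOpen_flatSetT : IsOpen flatSetT := by
  have h1 : IsOpen {z : (𝔼 2) × (𝔼 2) | ‖z.1‖ < 1} := isOpen_lt (continuous_norm.comp continuous_fst) continuous_const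
  have h2 : IsOpen {z : (𝔼 2) × (𝔼 2) | z.2 ≠ 0} := isOpen_ne.preimage continuous_snd
  have h12 : IsOpen ({z : (𝔼 2) × (𝔼 2) | ‖z.1‖ < 1} ∩ {z | z.2 ≠ 0}) := h1.inter h2
  have hc : ContinuousOn (fun z : (𝔼 2) × (𝔼 2) ↦ TraceCollar.ψ (Real.log (2 / radF z)) - 2 * TraceCollar.ξ ‖z.1‖)
      ({z : (𝔼 2) × (𝔼 2) | ‖z.1‖ < 1} ∩ {z | z.2 ≠ 0}) := by
    intro z hz
    have hr : 0 < radF z := norm_pos_iff.2 (univBall_ne_zero hz.2)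
    refine ContinuousAt.continuousWithinAt ?_
    have hY : ContDiffAt ℝ ∞ (fun z : (𝔼 2) × (𝔼 2) ↦ Real.log (2 / radF z)) z :=
      (contDiffAt_const.div (contDiffAt_radF hz.2) hr.ne').log (div_pos two_pos hr).ne'
    have hψY : ContDiffAt ℝ ∞ (fun z : (𝔼 2) × (𝔼 2) ↦ TraceCollar.ψ (Real.log (2 / radF z))) z :=
      ContDiffAt.comp (g := TraceCollar.ψ) (f := fun z : (𝔼 2) × (𝔼 2) ↦ Real.log (2 / radF z)) z
        TraceCollar.contDiff_ψ.contDiffAt hY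
    have hξ : ContinuousAt (fun z : (𝔼 2) × (𝔼 2) ↦ TraceCollar.ξ ‖z.1‖) z :=
      ContinuousAt.comp (g := TraceCollar.ξ) (f := fun z : (𝔼 2) × (𝔼 2) ↦ ‖z.1‖)
        (TraceCollar.contDiffAt_ξ (by rw [abs_of_nonneg (norm_nonneg _)]; exact hz.1)).continuousAt
        (continuous_norm.comp continuous_fst).continuousAt
    exact hψY.continuousAt.sub (continuousAt_const.mul hξ)
  have heq : flatSetT = ({z : (𝔼 2) × (𝔼 2) | ‖z.1‖ < 1} ∩ {z | z.2 ≠ 0}) ∩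
      (fun z : (𝔼 2) × (𝔼 2) ↦ TraceCollar.ψ (Real.log (2 / radF z)) - 2 * TraceCollar.ξ ‖z.1‖) ⁻¹' Ioi 0 := by
    ext z
    simp only [flatSetT, radF, mem_setOf_eq, mem_inter_iff, mem_preimage, mem_Ioi, sub_pos, and_assoc]
  rw [heq]
  exact hc.isOpen_inter_preimage h12 isOpen_Ioi

/-- The flat inverse formula is smooth on the flat-regime set [folklore] -/
theorem contMDiffAt_ΨFlat (hG : ν.IsSurgeryWith jA jB) {z : (𝔼 2) × (𝔼 2)} (hz : z ∈ flatSetT) :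
    ContMDiffAt 𝓘(ℝ, (𝔼 2) × (𝔼 2)) ((𝓡 3).prod 𝓘(ℝ, ℝ)) ∞ (ΨFlat jB) z := by
  haveI : Fact (Module.finrank ℝ (𝔼 2) = 1 + 1) := ⟨by simp⟩
  obtain ⟨hx1, hw, hflat⟩ := hz
  have hw' : OpenPartialHomeomorph.univBall (0 : 𝔼 2) 2 z.2 ≠ 0 := univBall_ne_zero hw
  have hr : 0 < radF z := norm_pos_iff.2 hw'
  have hr2 : radF z < 2 := norm_univBall_lt z.2
  have hYy : 0 < Real.log (2 / radF z) := Real.log_pos ((lt_div_iff₀ hr).2 (by linarith))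
  have hψ : 0 < TraceCollar.ψ (Real.log (2 / radF z)) := TraceCollar.ψ_pos hYy
  have hξ0 : 0 ≤ TraceCollar.ξ ‖z.1‖ := TraceCollar.ξ_nonneg (norm_nonneg _) hx1
  -- smooth real ingredients
  have hrad : ContDiffAt ℝ ∞ radF z := contDiffAt_radF hw
  have hY : ContDiffAt ℝ ∞ (fun z : (𝔼 2) × (𝔼 2) ↦ Real.log (2 / radF z)) z :=
    (contDiffAt_const.div hrad hr.ne').log (div_pos two_pos hr).ne'
  have hψY : ContDiffAt ℝ ∞ (fun z : (𝔼 2) × (𝔼 2) ↦ TraceCollar.ψ (Real.log (2 / radF z))) z :=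
    ContDiffAt.comp (g := TraceCollar.ψ) (f := fun z : (𝔼 2) × (𝔼 2) ↦ Real.log (2 / radF z)) z
      TraceCollar.contDiff_ψ.contDiffAt hY
  have hsq : ContDiffAt ℝ ∞ (fun z : (𝔼 2) × (𝔼 2) ↦ (1 - ‖z.1‖ ^ 2)⁻¹) z := by
    have h1 : ‖z.1‖ ^ 2 < 1 := by nlinarith [norm_nonneg z.1]
    exact (contDiffAt_const.sub ((contDiff_norm_sq ℝ).contDiffAt.comp z contDiffAt_fst)).inv (by
      simp only [Function.comp_apply]; exact (sub_pos.2 h1).ne')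
  have hs : ContDiffAt ℝ ∞ (fun z : (𝔼 2) × (𝔼 2) ↦
      radF z / TraceCollar.ψ (Real.log (2 / radF z)) * (1 - ‖z.1‖ ^ 2)⁻¹) z :=
    (hrad.div hψY hψ.ne').mul hsq
  have hp : ContDiffAt ℝ ∞ (fun z : (𝔼 2) × (𝔼 2) ↦
      (radF z / TraceCollar.ψ (Real.log (2 / radF z)) * (1 - ‖z.1‖ ^ 2)⁻¹) • z.1) z := hs.smul contDiffAt_fst
  -- the direction `v̂`
  have hv : ContMDiffAt 𝓘(ℝ, (𝔼 2) × (𝔼 2)) (𝓡 1) ∞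
      (fun z : (𝔼 2) × (𝔼 2) ↦ radialProjection (spherePt 1) (OpenPartialHomeomorph.univBall (0 : 𝔼 2) 2 z.2)) z := by
    have hr' : ContMDiffAt 𝓘(ℝ, 𝔼 2) (𝓡 1) ∞ (radialProjection (spherePt 1)) (OpenPartialHomeomorph.univBall (0 : 𝔼 2) 2 z.2) :=
      (contMDiffOn_radialProjection (spherePt 1)).contMDiffAt (isOpen_ne.mem_nhds hw')
    exact hr'.comp z (((OpenPartialHomeomorph.contDiff_univBall (c := (0 : 𝔼 2)) (r := 2)).comp contDiff_snd).contMDiff z)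
  -- the solid-torus point `(p, v̂)` lies in the open solid torus
  have hpt : ContMDiffAt 𝓘(ℝ, (𝔼 2) × (𝔼 2)) (𝓘(ℝ, 𝔼 2).prod (𝓡 1)) ∞
      (fun z : (𝔼 2) × (𝔼 2) ↦ ((radF z / TraceCollar.ψ (Real.log (2 / radF z)) * (1 - ‖z.1‖ ^ 2)⁻¹) • z.1,
        radialProjection (spherePt 1) (OpenPartialHomeomorph.univBall (0 : 𝔼 2) 2 z.2))) z :=
    hp.contMDiffAt.prodMk hv
  have hmem : (((radF z / TraceCollar.ψ (Real.log (2 / radF z)) * (1 - ‖z.1‖ ^ 2)⁻¹) • z.1,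
      radialProjection (spherePt 1) (OpenPartialHomeomorph.univBall (0 : 𝔼 2) 2 z.2)) : (𝔼 2) × (𝕊 1)) ∈ solidTorus := by
    rw [mem_solidTorus_iff]
    simp only
    have h1 : ‖z.1‖ ^ 2 < 1 := by nlinarith [norm_nonneg z.1]
    have hinv : 0 < (1 - ‖z.1‖ ^ 2)⁻¹ := inv_pos.2 (by linarith)
    rw [norm_smul, Real.norm_of_nonneg (by positivity), mul_assoc, ← TraceCollar.ξ_eq_mul]
    have hflat' : 2 * TraceCollar.ξ ‖z.1‖ < TraceCollar.ψ (Real.log (2 / radF z)) := hflat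
    have hq : TraceCollar.ξ ‖z.1‖ / TraceCollar.ψ (Real.log (2 / radF z)) < 2⁻¹ := by
      rw [div_lt_iff₀ hψ]; linarith
    calc radF z / TraceCollar.ψ (Real.log (2 / radF z)) * TraceCollar.ξ ‖z.1‖
        = radF z * (TraceCollar.ξ ‖z.1‖ / TraceCollar.ψ (Real.log (2 / radF z))) := by ring
      _ ≤ radF z * 2⁻¹ := by gcongr
      _ < 1 := by linarith
  have h1 : ContMDiffAt 𝓘(ℝ, (𝔼 2) × (𝔼 2)) (𝓡 3) ∞ (fun z : (𝔼 2) × (𝔼 2) ↦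
      jBt jB (((radF z / TraceCollar.ψ (Real.log (2 / radF z)) * (1 - ‖z.1‖ ^ 2)⁻¹) • z.1,
        radialProjection (spherePt 1) (OpenPartialHomeomorph.univBall (0 : 𝔼 2) 2 z.2)))) z :=
    ContMDiffAt.comp (g := jBt jB) z
      ((ν.contMDiffOn_jBt hG).contMDiffAt (solidTorus.isOpen.mem_nhds hmem)) hpt
  have h2 : ContMDiffAt 𝓘(ℝ, (𝔼 2) × (𝔼 2)) 𝓘(ℝ, ℝ) ∞
      (fun z : (𝔼 2) × (𝔼 2) ↦ -Real.log (TraceCollar.ψ (Real.log (2 / radF z)))) z :=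
    (hψY.log hψ.ne').neg.contMDiffAt
  exact h1.prodMk h2

omit [TopologicalSpace Y] [ChartedSpace (𝔼 3) Y] in
/-- The ball-chart coordinate `invInl` is smooth on `range inl`. [folklore] -/
theorem contMDiffOn_invInl :
    ContMDiffOn 𝓘(ℝ, 𝔼 4) 𝓘(ℝ, 𝔼 4) ∞ ν.invInl (range ν.shrink.traceGlueData.inl) := by
  have h := contMDiffOn_symm_of_isSmoothEmbedding ν.shrink.traceGlueData.isSmoothEmbedding_inl
    ν.shrink.traceGlueData.isOpenEmbedding_inl
  refine h.congr ?_
  rintro _ ⟨y, rfl⟩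
  rw [invInl_apply]
  exact (ν.shrink.traceGlueData.isOpenEmbedding_inl.toOpenPartialHomeomorph_left_inv (x := y)).symm

omit [TopologicalSpace Y] [ChartedSpace (𝔼 3) Y] in
/-- The handle-chart coordinate `invInr` is smooth on `range inr`. [folklore] -/
theorem contMDiffOn_invInr :
    ContMDiffOn 𝓘(ℝ, 𝔼 4) 𝓘(ℝ, (𝔼 2) × (𝔼 2)) ∞ ν.invInr (range ν.shrink.traceGlueData.inr) := by
  have h := contMDiffOn_symm_of_isSmoothEmbedding ν.shrink.traceGlueData.isSmoothEmbedding_inr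
    ν.shrink.traceGlueData.isOpenEmbedding_inr
  refine h.congr ?_
  rintro _ ⟨z, rfl⟩
  rw [invInr_apply]
  exact (ν.shrink.traceGlueData.isOpenEmbedding_inr.toOpenPartialHomeomorph_left_inv (x := z)).symm

omit [TopologicalSpace Y] [ChartedSpace (𝔼 3) Y] in
/-- The tube region of the open trace (ball-chart points of norm `> 1` with direction in `ν(𝕊¹ × (ℝ² ∖ 0))`) [folklore] -/
def tubeSetT : Set ν.shrink.OpenTrace :=
  ν.shrink.traceGlueData.inl '' {y | 1 < ‖y‖ ∧ radialProjection (spherePt 3) y ∈ ν.toFun '' (univ ×ˢ {w | w ≠ 0})}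

omit [TopologicalSpace Y] [ChartedSpace (𝔼 3) Y] in
/-- The tube part of `Y` is open. [folklore] -/
theorem isOpen_tubeSetT : IsOpen ν.tubeSetT := by
  refine ν.shrink.traceGlueData.isOpenEmbedding_inl.isOpenMap _ ?_
  have h1 : IsOpen {y : 𝔼 4 | 1 < ‖y‖} := isOpen_lt continuous_const continuous_norm
  have h2 : IsOpen (ν.toFun '' ((univ : Set (𝕊 1)) ×ˢ {w : 𝔼 2 | w ≠ 0})) :=
    ν.isOpenEmbedding.isOpenMap _ (isOpen_univ.prod isOpen_ne)
  have hc : ContinuousOn (radialProjection (spherePt 3)) {y : 𝔼 4 | 1 < ‖y‖} :=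
    (contMDiffOn_radialProjection (spherePt 3)).continuousOn.mono fun y hy ↦ by
      rintro rfl; simp only [mem_setOf_eq, norm_zero] at hy; linarith
  exact hc.isOpen_inter_preimage h1 h2

omit [TopologicalSpace Y] [ChartedSpace (𝔼 3) Y] in
/-- The radial part of `Y` is open. [folklore] -/
theorem isOpen_radSetT : IsOpen ν.radSetT := by
  refine ν.shrink.traceGlueData.isOpenEmbedding_inl.isOpenMap _ ?_
  have hc : ContinuousOn (radialProjection (spherePt 3)) {y : 𝔼 4 | y ≠ 0} :=
    (contMDiffOn_radialProjection (spherePt 3)).continuousOn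
  exact hc.isOpen_inter_preimage isOpen_ne ν.isClosed_closedTube.isOpen_compl

omit [TopologicalSpace Y] [ChartedSpace (𝔼 3) Y] in
/-- On the tube region the inverse collar is the tube inverse formula [folklore] -/
theorem collarInv_eq_ΨTube_of_mem {y : 𝔼 4} (hy : 1 < ‖y‖)
    (h : radialProjection (spherePt 3) y ∈ ν.toFun '' (univ ×ˢ {w | w ≠ 0})) :
    ν.collarInv jA jB (ν.shrink.traceGlueData.inl y) = ν.ΨTube jA y := by
  by_cases hc : radialProjection (spherePt 3) y ∈ ν.closedTube
  · exact ν.collarInv_inl_of_mem hc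
  · have hy0 : y ≠ 0 := by rintro rfl; norm_num at hy
    rw [ν.collarInv_inl_of_not_mem hy0 hc]
    obtain ⟨⟨u, w⟩, -, hq⟩ := h
    have hw : 2 ≤ ‖w‖ := by
      by_contra h'
      exact hc (hq ▸ (mem_closedTube_iff ν).2 (not_le.1 h').le)
    exact ν.ΨRad_eq_ΨTube jA hy hw hq.symm

/-- On the flat region the inverse collar is the flat inverse formula [folklore] -/
theorem collarInv_eq_ΨFlat_of_mem (hG : ν.IsSurgeryWith jA jB) {z : (𝔼 2) × (𝔼 2)} (hz : z ∈ flatSetT) :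
    ν.collarInv jA jB (ν.shrink.traceGlueData.inr z) = ΨFlat jB z := by
  obtain ⟨x, w⟩ := z
  obtain ⟨hx1, hw, hflat⟩ := hz
  simp only at hx1 hw hflat
  by_cases hx : x = 0
  · subst hx; exact ν.collarInv_inr_zero w
  · have hinl : ν.shrink.traceGlueData.inr (x, w) = ν.shrink.traceGlueData.inl (ν.shrink.traceBwd (x, w)) :=
      (ν.shrink.inl_eq_inr_iff.2 ⟨hx, rfl⟩).symm
    have hxpos : 0 < ‖x‖ := norm_pos_iff.2 hx
    have hdir : radialProjection (spherePt 3) (ν.shrink.traceBwd (x, w)) =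
        ν.toFun (radialProjection (spherePt 1) x, OpenPartialHomeomorph.univBall (0 : 𝔼 2) 2 w) := by
      conv_lhs => rw [← norm_smul_coe_radialProjection (spherePt 1) x]
      rw [ν.shrink.traceBwd_apply hxpos, shrink_apply, radialProjection_smul _ (inv_pos.2 hxpos)]
    have hmem : radialProjection (spherePt 3) (ν.shrink.traceBwd (x, w)) ∈ ν.closedTube := by
      rw [hdir, mem_closedTube_iff]; exact (norm_univBall_lt w).le
    rw [hinl, ν.collarInv_inl_of_mem hmem]
    exact ν.ΨTube_eq_ΨFlat hG hx hx1 hw hflat.le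

/-- **the inverse collar is smooth off the core** [folklore] -/
theorem contMDiffOn_collarInv (hG : ν.IsSurgeryWith jA jB) :
    ContMDiffOn 𝓘(ℝ, 𝔼 4) ((𝓡 3).prod 𝓘(ℝ, ℝ)) ∞ (ν.collarInv jA jB) (ν.coreC)ᶜ := by
  intro z hz
  refine ContMDiffAt.contMDiffWithinAt ?_
  obtain (⟨y, rfl⟩ | ⟨w, rfl⟩) := ν.shrink.eq_inl_or_eq_inr_zero z
  · have hy : 1 < ‖y‖ := ν.one_lt_norm_of_not_mem_coreC hz
    have hy0 : y ≠ 0 := by rintro rfl; norm_num at hy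
    have hrange : radialProjection (spherePt 3) y ∉ range c := ν.radialProjection_not_mem_range_of_not_mem_coreC hz
    have hinvAt : ContMDiffAt 𝓘(ℝ, 𝔼 4) 𝓘(ℝ, 𝔼 4) ∞ ν.invInl (ν.shrink.traceGlueData.inl y) :=
      ν.contMDiffOn_invInl.contMDiffAt (ν.shrink.traceGlueData.isOpen_range_inl.mem_nhds (mem_range_self y))
    by_cases hc : radialProjection (spherePt 3) y ∈ ν.closedTube
    · -- tube region: `collarInv = ΨTube ∘ invInl`
      obtain ⟨⟨u, w⟩, -, hq⟩ := hc
      have hw : w ≠ 0 := fun h0 ↦ hrange (by rw [← hq, h0, ν.apply_zero]; exact mem_range_self u)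
      have hmemT : ν.shrink.traceGlueData.inl y ∈ ν.tubeSetT := ⟨y, ⟨hy, ⟨(u, w), ⟨mem_univ _, hw⟩, hq⟩⟩, rfl⟩
      have hev : ν.collarInv jA jB =ᶠ[𝓝 (ν.shrink.traceGlueData.inl y)] fun z ↦ ν.ΨTube jA (ν.invInl z) := by
        filter_upwards [ν.isOpen_tubeSetT.mem_nhds hmemT] with z hz
        obtain ⟨y', ⟨hy', h'⟩, rfl⟩ := hz
        rw [invInl_apply]; exact ν.collarInv_eq_ΨTube_of_mem hy' h'
      refine ContMDiffAt.congr_of_eventuallyEq ?_ hev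
      have hw' : (ν.toHomeo.symm (radialProjection (spherePt 3) y)).2 ≠ 0 := by
        rw [← hq, toHomeo_symm_apply']; exact hw
      have hΨ := ν.contMDiffAt_ΨTube hG hy ⟨_, hq⟩ hw'
      rw [← ν.invInl_apply y] at hΨ
      exact ContMDiffAt.comp (g := ν.ΨTube jA) (f := ν.invInl) _ hΨ hinvAt
    · -- radial region: `collarInv = ΨRad ∘ invInl`
      have hmemR : ν.shrink.traceGlueData.inl y ∈ ν.radSetT := ⟨y, ⟨hy0, hc⟩, rfl⟩
      have hev : ν.collarInv jA jB =ᶠ[𝓝 (ν.shrink.traceGlueData.inl y)] fun z ↦ ν.ΨRad jA (ν.invInl z) := by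
        filter_upwards [ν.isOpen_radSetT.mem_nhds hmemR] with z hz
        obtain ⟨y', ⟨hy', h'⟩, rfl⟩ := hz
        rw [invInl_apply]; exact ν.collarInv_inl_of_not_mem hy' h'
      refine ContMDiffAt.congr_of_eventuallyEq ?_ hev
      have hΨ := ν.contMDiffAt_ΨRad hG hy hrange
      rw [← ν.invInl_apply y] at hΨ
      exact ContMDiffAt.comp (g := ν.ΨRad jA) (f := ν.invInl) _ hΨ hinvAt
  · -- flat region: `collarInv = ΨFlat ∘ invInr`
    have hw : w ≠ 0 := ν.inr_zero_not_mem_coreC_iff.1 hz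
    have hmemF : ((0 : 𝔼 2), w) ∈ flatSetT := by
      refine ⟨by simp, hw, ?_⟩
      simp only [norm_zero]
      rw [show TraceCollar.ξ 0 = 0 by simp [TraceCollar.ξ], mul_zero]
      have hr : 0 < ‖OpenPartialHomeomorph.univBall (0 : 𝔼 2) 2 w‖ := norm_pos_iff.2 (univBall_ne_zero hw)
      exact TraceCollar.ψ_pos (Real.log_pos ((lt_div_iff₀ hr).2 (by linarith [norm_univBall_lt w])))
    have hinvAt : ContMDiffAt 𝓘(ℝ, 𝔼 4) 𝓘(ℝ, (𝔼 2) × (𝔼 2)) ∞ ν.invInr (ν.shrink.traceGlueData.inr (0, w)) :=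
      ν.contMDiffOn_invInr.contMDiffAt (ν.shrink.traceGlueData.isOpen_range_inr.mem_nhds (mem_range_self _))
    have hev : ν.collarInv jA jB =ᶠ[𝓝 (ν.shrink.traceGlueData.inr (0, w))] fun z ↦ ΨFlat jB (ν.invInr z) := by
      filter_upwards [(ν.shrink.traceGlueData.isOpenEmbedding_inr.isOpenMap _ isOpen_flatSetT).mem_nhds
        ⟨_, hmemF, rfl⟩] with z hz
      obtain ⟨z', hz', rfl⟩ := hz
      rw [invInr_apply]; exact ν.collarInv_eq_ΨFlat_of_mem hG hz'
    refine ContMDiffAt.congr_of_eventuallyEq ?_ hev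
    have hΨ := ν.contMDiffAt_ΨFlat hG hmemF
    rw [← ν.invInr_apply ((0 : 𝔼 2), w)] at hΨ
    exact ContMDiffAt.comp (g := ΨFlat jB) (f := ν.invInr) _ hΨ hinvAt

end SmoothInv

/-! ### The size function `N = e^{-σ}` of the collar and its lower bounds near the core -/

section SizeBounds

variable {Y : Type*} [TopologicalSpace Y] [ChartedSpace (𝔼 3) Y]
  {jA : ν.complement → Y} {jB : ↥solidTorus → Y}

omit ν in
/-- `ξ` is strictly increasing on `[0, 1)` [folklore] -/
theorem ξ_lt_ξ {α β : ℝ} (hα : 0 ≤ α) (hαβ : α < β) (hβ : β < 1) : TraceCollar.ξ α < TraceCollar.ξ β := by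
  simp only [TraceCollar.ξ]
  have hα2 : α ^ 2 < 1 := by nlinarith
  have hβ2 : β ^ 2 < 1 := by nlinarith
  rw [div_lt_div_iff₀ (by linarith) (by linarith)]
  nlinarith [mul_nonneg hα (by linarith : (0 : ℝ) ≤ β)]

omit [TopologicalSpace Y] [ChartedSpace (𝔼 3) Y] in
/-- **radial/tube lower bound**: off the core, `e^{-σ} ≥ ξ(1/‖y‖)` at `inl y` [folklore] -/
theorem ξ_le_exp_neg_collarInv_inl {y : 𝔼 4} (hC : ν.shrink.traceGlueData.inl y ∉ ν.coreC) :
    TraceCollar.ξ ‖y‖⁻¹ ≤ Real.exp (-(ν.collarInv jA jB (ν.shrink.traceGlueData.inl y)).2) := by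
  have h1 : 1 < ‖y‖ := ν.one_lt_norm_of_not_mem_coreC hC
  have hy : y ≠ 0 := by rintro rfl; norm_num at h1
  have hypos : 0 < ‖y‖ := by linarith
  have hα : 0 < ‖y‖⁻¹ := inv_pos.2 hypos
  have hα1 : ‖y‖⁻¹ < 1 := inv_lt_one_of_one_lt₀ h1
  have hX : 0 < TraceCollar.ξ ‖y‖⁻¹ := TraceCollar.ξ_pos hα hα1
  by_cases hc : radialProjection (spherePt 3) y ∈ ν.closedTube
  · rw [ν.collarInv_inl_of_mem hc, ΨTube]
    simp only [neg_neg]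
    have hΩ : (TraceCollar.ξ ‖y‖⁻¹, Real.log (2 / ‖(ν.toHomeo.symm (radialProjection (spherePt 3) y)).2‖)) ∈
        TraceCollar.Ωpos := hX
    have hN : 0 < (ν.profP y).1 := (TraceCollar.Φ_mem_Quad hΩ).1
    rw [Real.exp_log hN, profP, TraceCollar.Φ, TraceCollar.Nf_of_pos hX]
    exact (le_max_left _ _).trans (TraceCollar.max_le_ρ hX _)
  · rw [ν.collarInv_inl_of_not_mem hy hc, ΨRad]
    simp only [neg_neg]
    rw [Real.exp_log hX]

omit [TopologicalSpace Y] [ChartedSpace (𝔼 3) Y] in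
/-- A handle-chart point `inr (x, w'')` off the core has `‖x‖ < 1` and `w'' ≠ 0`. [folklore] -/
theorem norm_lt_one_of_inr_not_mem_coreC {x w : 𝔼 2} (hC : ν.shrink.traceGlueData.inr (x, w) ∉ ν.coreC) :
    ‖x‖ < 1 ∧ w ≠ 0 := by
  rw [coreC, ν.shrink.inr_mem_core_iff, not_or, not_le, not_and_or] at hC
  exact ⟨hC.1, hC.2.resolve_right (not_not.2 hC.1.le)⟩

omit [TopologicalSpace Y] [ChartedSpace (𝔼 3) Y] in
/-- **flat lower bound**: off the core, `e^{-σ} ≥ ψ(log (2/‖w‖))` at `inr (x, w'')`, `w = univBall w''` [folklore] -/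
theorem ψ_le_exp_neg_collarInv_inr {x w : 𝔼 2} (hC : ν.shrink.traceGlueData.inr (x, w) ∉ ν.coreC) :
    TraceCollar.ψ (Real.log (2 / ‖OpenPartialHomeomorph.univBall (0 : 𝔼 2) 2 w‖)) ≤
      Real.exp (-(ν.collarInv jA jB (ν.shrink.traceGlueData.inr (x, w))).2) := by
  obtain ⟨hx1, hw⟩ := ν.norm_lt_one_of_inr_not_mem_coreC hC
  have hw' : OpenPartialHomeomorph.univBall (0 : 𝔼 2) 2 w ≠ 0 := univBall_ne_zero hw
  have hr : 0 < ‖OpenPartialHomeomorph.univBall (0 : 𝔼 2) 2 w‖ := norm_pos_iff.2 hw'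
  have hYy : 0 < Real.log (2 / ‖OpenPartialHomeomorph.univBall (0 : 𝔼 2) 2 w‖) :=
    Real.log_pos ((lt_div_iff₀ hr).2 (by linarith [norm_univBall_lt w]))
  have hψ : 0 < TraceCollar.ψ (Real.log (2 / ‖OpenPartialHomeomorph.univBall (0 : 𝔼 2) 2 w‖)) := TraceCollar.ψ_pos hYy
  by_cases hx : x = 0
  · subst hx
    rw [ν.collarInv_inr_zero, ΨFlat]
    simp only [neg_neg]
    rw [show radF ((0 : 𝔼 2), w) = ‖OpenPartialHomeomorph.univBall (0 : 𝔼 2) 2 w‖ from rfl, Real.exp_log hψ]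
  · have hxpos : 0 < ‖x‖ := norm_pos_iff.2 hx
    have hinl : ν.shrink.traceGlueData.inr (x, w) = ν.shrink.traceGlueData.inl (ν.shrink.traceBwd (x, w)) :=
      (ν.shrink.inl_eq_inr_iff.2 ⟨hx, rfl⟩).symm
    have hdir : radialProjection (spherePt 3) (ν.shrink.traceBwd (x, w)) =
        ν.toFun (radialProjection (spherePt 1) x, OpenPartialHomeomorph.univBall (0 : 𝔼 2) 2 w) := by
      conv_lhs => rw [← norm_smul_coe_radialProjection (spherePt 1) x]
      rw [ν.shrink.traceBwd_apply hxpos, shrink_apply, radialProjection_smul _ (inv_pos.2 hxpos)]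
    have hmem : radialProjection (spherePt 3) (ν.shrink.traceBwd (x, w)) ∈ ν.closedTube := by
      rw [hdir, mem_closedTube_iff]; exact (norm_univBall_lt w).le
    have hnorm : ‖ν.shrink.traceBwd (x, w)‖ = ‖x‖⁻¹ := by rw [ν.shrink.norm_traceBwd]
    have hX : 0 < TraceCollar.ξ ‖x‖ := TraceCollar.ξ_pos hxpos hx1
    rw [hinl, ν.collarInv_inl_of_mem hmem, ΨTube]
    simp only [neg_neg]
    rw [profP, hnorm, inv_inv, hdir, toHomeo_symm_apply']
    have hΩ : (TraceCollar.ξ ‖x‖, Real.log (2 / ‖OpenPartialHomeomorph.univBall (0 : 𝔼 2) 2 w‖)) ∈ TraceCollar.Ωpos := hX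
    have hN := (TraceCollar.Φ_mem_Quad hΩ).1
    rw [Real.exp_log hN, TraceCollar.Φ, TraceCollar.Nf_of_pos hX]
    exact (le_max_right _ _).trans (TraceCollar.max_le_ρ hX _)

/-- `e^{-σ} > e^{-a}` means `σ < a` [folklore] -/
theorem lt_of_exp_neg_lt {σ a : ℝ} (h : Real.exp (-a) < Real.exp (-σ)) : σ < a := by
  rw [Real.exp_lt_exp] at h; linarith

end SizeBounds

/-! ### The end clauses -/

section Clauses

variable {Y : Type*} [TopologicalSpace Y] [ChartedSpace (𝔼 3) Y]
  {jA : ν.complement → Y} {jB : ↥solidTorus → Y}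

omit [TopologicalSpace Y] [ChartedSpace (𝔼 3) Y] in
/-- The core `C = inl(B̄⁴) ∪ coreDisc(𝔻²)` is compact. [folklore] -/
theorem isCompact_coreC : IsCompact ν.coreC :=
  ((isCompact_closedBall _ _).image ν.shrink.traceGlueData.continuous_inl).union
    ((isCompact_closedBall _ _).image ν.shrink.contMDiff_coreDisc.continuous)

omit [TopologicalSpace Y] [ChartedSpace (𝔼 3) Y] in
/-- The core is closed. [folklore] -/
theorem isClosed_coreC : IsClosed ν.coreC := ν.isCompact_coreC.isClosed

/-- **the collar as an open partial homeomorphism** `Y × ℝ ≅ OpenTrace ν' ∖ C` [folklore] -/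
def collarPH (hG : ν.IsSurgeryWith jA jB) : OpenPartialHomeomorph (Y × ℝ) ν.shrink.OpenTrace where
  toFun := ν.collar jA jB
  invFun := ν.collarInv jA jB
  source := univ
  target := (ν.coreC)ᶜ
  map_source' p _ := ν.collar_not_mem_coreC hG p
  map_target' _ _ := mem_univ _
  left_inv' p _ := ν.collarInv_collar hG p
  right_inv' _ hz := ν.collar_collarInv hG hz
  open_source := isOpen_univ
  open_target := ν.isClosed_coreC.isOpen_compl
  continuousOn_toFun := (ν.contMDiff_collar hG).continuous.continuousOn
  continuousOn_invFun := (ν.contMDiffOn_collarInv hG).continuousOn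

/-- The collar partial homeomorphism as a function. [folklore] -/
theorem collarPH_apply (hG : ν.IsSurgeryWith jA jB) (p : Y × ℝ) : ν.collarPH hG p = ν.collar jA jB p := rfl

/-- The collar is an open map. [folklore] -/
theorem isOpen_image_collar (hG : ν.IsSurgeryWith jA jB) {s : Set (Y × ℝ)} (hs : IsOpen s) :
    IsOpen (ν.collar jA jB '' s) :=
  (ν.collarPH hG).isOpen_image_of_subset_source hs (subset_univ _)

/-- **end clause 1**: `c(Y × [a, ∞))` is closed (the height `σ → -∞` at the core) [folklore] -/
theorem isClosed_image_collar_ge (hG : ν.IsSurgeryWith jA jB) (a : ℝ) :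
    IsClosed (ν.collar jA jB '' {p | a ≤ p.2}) := by
  -- the three open pieces of the complement
  set α₀ : ℝ := TraceCollar.αof (Real.exp (-a)) with hα₀
  have hα₀pos : 0 < α₀ := TraceCollar.αof_pos (Real.exp_pos _)
  have hα₀1 : α₀ < 1 := TraceCollar.αof_lt_one _
  set Y₀ : ℝ := TraceCollar.ψinv (Real.exp (-a)) with hY₀
  have hY₀pos : 0 < Y₀ := TraceCollar.ψinv_pos _
  set U₁ : Set ν.shrink.OpenTrace := ν.collar jA jB '' {p | p.2 < a} with hU₁
  set U₂ : Set ν.shrink.OpenTrace := ν.shrink.traceGlueData.inl '' Metric.ball (0 : 𝔼 4) α₀⁻¹ with hU₂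
  set U₃ : Set ν.shrink.OpenTrace := ν.shrink.traceGlueData.inr ''
    {z | ‖OpenPartialHomeomorph.univBall (0 : 𝔼 2) 2 z.2‖ < 2 * Real.exp (-Y₀)} with hU₃
  have hO₁ : IsOpen U₁ := ν.isOpen_image_collar hG (isOpen_lt continuous_snd continuous_const)
  have hO₂ : IsOpen U₂ := ν.shrink.traceGlueData.isOpenEmbedding_inl.isOpenMap _ Metric.isOpen_ball
  have hO₃ : IsOpen U₃ := by
    refine ν.shrink.traceGlueData.isOpenEmbedding_inr.isOpenMap _ (isOpen_lt ?_ continuous_const)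
    exact continuous_norm.comp ((OpenPartialHomeomorph.contDiff_univBall (n := ⊤) (c := (0 : 𝔼 2)) (r := 2)).continuous.comp
      continuous_snd)
  -- points of these pieces have height `< a` (or are in the core)
  have hlow : ∀ z ∈ U₁ ∪ U₂ ∪ U₃, z ∉ ν.collar jA jB '' {p | a ≤ p.2} := by
    rintro z hz ⟨p, hp, rfl⟩
    have hσ : (ν.collarInv jA jB (ν.collar jA jB p)).2 = p.2 := by rw [ν.collarInv_collar hG]
    have hC : ν.collar jA jB p ∉ ν.coreC := ν.collar_not_mem_coreC hG p
    rcases hz with (⟨p', hp', hpp'⟩ | ⟨y, hy, hyp⟩) | ⟨z', hz', hzp⟩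
    · rw [ν.collar_injective hG hpp'] at hp'
      exact (not_lt.2 hp) (show p.2 < a from hp')
    · rw [← hyp] at hσ hC
      have h1 : 1 < ‖y‖ := ν.one_lt_norm_of_not_mem_coreC hC
      have hbound := ν.ξ_le_exp_neg_collarInv_inl (jA := jA) (jB := jB) hC
      rw [hσ] at hbound
      rw [Metric.mem_ball, dist_zero_right] at hy
      have hinv : α₀ < ‖y‖⁻¹ := by rwa [lt_inv_comm₀ hα₀pos (by linarith)]
      have hξ : Real.exp (-a) < TraceCollar.ξ ‖y‖⁻¹ := by
        rw [← TraceCollar.ξ_αof (Real.exp (-a))]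
        exact ξ_lt_ξ hα₀pos.le hinv (inv_lt_one_of_one_lt₀ h1)
      exact (not_lt.2 hp) (lt_of_exp_neg_lt (hξ.trans_le hbound))
    · obtain ⟨x, w⟩ := z'
      rw [← hzp] at hσ hC
      have hbound := ν.ψ_le_exp_neg_collarInv_inr (jA := jA) (jB := jB) hC
      rw [hσ] at hbound
      obtain ⟨-, hw⟩ := ν.norm_lt_one_of_inr_not_mem_coreC hC
      have hr : 0 < ‖OpenPartialHomeomorph.univBall (0 : 𝔼 2) 2 w‖ := norm_pos_iff.2 (univBall_ne_zero hw)
      simp only [mem_setOf_eq] at hz'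
      have hYy : Y₀ < Real.log (2 / ‖OpenPartialHomeomorph.univBall (0 : 𝔼 2) 2 w‖) := by
        rw [Real.lt_log_iff_exp_lt (by positivity), lt_div_iff₀ hr]
        have := hz'
        rw [Real.exp_neg] at this
        calc Real.exp Y₀ * ‖OpenPartialHomeomorph.univBall (0 : 𝔼 2) 2 w‖
            < Real.exp Y₀ * (2 * (Real.exp Y₀)⁻¹) := by gcongr
          _ = 2 := by field_simp
      have hψ : Real.exp (-a) < TraceCollar.ψ (Real.log (2 / ‖OpenPartialHomeomorph.univBall (0 : 𝔼 2) 2 w‖)) := by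
        rw [← TraceCollar.ψ_ψinv (Real.exp_pos (-a))]
        exact TraceCollar.strictMonoOn_ψ hY₀pos.le (hY₀pos.trans hYy).le hYy
      exact (not_lt.2 hp) (lt_of_exp_neg_lt (hψ.trans_le hbound))
  -- the complement is the union of the three pieces
  have heq : (ν.collar jA jB '' {p | a ≤ p.2})ᶜ = U₁ ∪ U₂ ∪ U₃ := by
    refine Subset.antisymm ?_ fun z hz ↦ hlow z hz
    intro z hz
    by_cases hC : z ∈ ν.coreC
    · rcases hC with ⟨y, hy, rfl⟩ | ⟨x, hx, rfl⟩
      · refine Or.inl (Or.inr ⟨y, ?_, rfl⟩)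
        rw [Metric.mem_closedBall, dist_zero_right] at hy
        rw [Metric.mem_ball, dist_zero_right]
        exact hy.trans_lt ((one_lt_inv₀ hα₀pos).2 hα₀1)
      · refine Or.inr ⟨(x, 0), ?_, rfl⟩
        simp only [mem_setOf_eq, OpenPartialHomeomorph.univBall_apply_zero, norm_zero]
        positivity
    · obtain ⟨p, rfl⟩ : z ∈ range (ν.collar jA jB) := by rw [ν.range_collar hG]; exact hC
      refine Or.inl (Or.inl ⟨p, ?_, rfl⟩)
      simp only [mem_setOf_eq]
      by_contra h
      exact hz ⟨p, not_lt.1 h, rfl⟩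
  rw [← isOpen_compl_iff, heq]
  exact (hO₁.union hO₂).union hO₃

/-- `univBall⁻¹ 0 = 0`. [folklore] -/
theorem univBall_symm_zero : (OpenPartialHomeomorph.univBall (0 : 𝔼 2) 2).symm 0 = 0 := by
  have h := univBall_symm_apply_apply (0 : 𝔼 2)
  rwa [OpenPartialHomeomorph.univBall_apply_zero] at h

/-- **end clause 2**: `C ∪ c(Y × (-∞, a])` is compact (the collar is proper towards the core) [folklore] -/
theorem isCompact_coreC_union_image_le (hG : ν.IsSurgeryWith jA jB) (a : ℝ) :
    IsCompact (ν.coreC ∪ ν.collar jA jB '' {p | p.2 ≤ a}) := by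
  -- constants
  set N₀ : ℝ := Real.exp (-a) with hN₀
  have hN₀pos : 0 < N₀ := Real.exp_pos _
  set R₁ : ℝ := (TraceCollar.αof N₀)⁻¹ with hR₁
  set R₂ : ℝ := (TraceCollar.αof (N₀ / 4))⁻¹ with hR₂
  have hα₁ : 0 < TraceCollar.αof N₀ := TraceCollar.αof_pos hN₀pos
  have hα₁1 : TraceCollar.αof N₀ < 1 := TraceCollar.αof_lt_one _
  have hα₂ : 0 < TraceCollar.αof (N₀ / 4) := TraceCollar.αof_pos (by positivity)
  have hα₂1 : TraceCollar.αof (N₀ / 4) < 1 := TraceCollar.αof_lt_one _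
  have hR₁1 : 1 ≤ R₁ := (one_lt_inv₀ hα₁ |>.2 hα₁1).le
  set R : ℝ := max R₁ R₂ with hR
  set Y₁ : ℝ := TraceCollar.ψinv (N₀ / 2) with hY₁
  have hY₁pos : 0 < Y₁ := TraceCollar.ψinv_pos _
  have hψY₁ : TraceCollar.ψ Y₁ = N₀ / 2 := TraceCollar.ψ_ψinv (by positivity)
  set r₁ : ℝ := 2 * Real.exp (-Y₁) with hr₁
  have hr₁pos : 0 < r₁ := by positivity
  have hr₁2 : r₁ < 2 := by
    have : Real.exp (-Y₁) < 1 := Real.exp_lt_one_iff.2 (by linarith)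
    simp only [hr₁]; linarith
  set κ := OpenPartialHomeomorph.univBall (0 : 𝔼 2) 2 with hκ
  -- the compact set
  set K : Set ν.shrink.OpenTrace := ν.shrink.traceGlueData.inl '' Metric.closedBall (0 : 𝔼 4) R ∪
    ν.shrink.traceGlueData.inr '' (Metric.closedBall (0 : 𝔼 2) 1 ×ˢ (κ.symm '' Metric.closedBall (0 : 𝔼 2) r₁)) with hK
  have hKc : IsCompact K := by
    refine ((isCompact_closedBall _ _).image ν.shrink.traceGlueData.continuous_inl).union
      (((isCompact_closedBall _ _).prod ?_).image ν.shrink.traceGlueData.continuous_inr)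
    refine (isCompact_closedBall _ _).image_of_continuousOn (κ.continuousOn_symm.mono ?_)
    rw [hκ, OpenPartialHomeomorph.univBall_target _ (by norm_num : (0 : ℝ) < 2)]
    exact Metric.closedBall_subset_ball hr₁2
  -- closedness: the complement is `c(Y × (a, ∞))`
  have hclosed : IsClosed (ν.coreC ∪ ν.collar jA jB '' {p | p.2 ≤ a}) := by
    have heq : (ν.coreC ∪ ν.collar jA jB '' {p | p.2 ≤ a})ᶜ = ν.collar jA jB '' {p | a < p.2} := by
      ext z
      constructor
      · intro hz
        have hC : z ∉ ν.coreC := fun h ↦ hz (Or.inl h)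
        have hle : z ∉ ν.collar jA jB '' {p | p.2 ≤ a} := fun h ↦ hz (Or.inr h)
        obtain ⟨p, rfl⟩ : z ∈ range (ν.collar jA jB) := by rw [ν.range_collar hG]; exact hC
        exact ⟨p, show a < p.2 from not_le.1 fun h ↦ hle ⟨p, h, rfl⟩, rfl⟩
      · rintro ⟨p, hp, rfl⟩ (hC | ⟨p', hp', hpp'⟩)
        · exact ν.collar_not_mem_coreC hG p hC
        · rw [ν.collar_injective hG hpp'] at hp'
          exact (not_le.2 (show a < p.2 from hp)) hp'
    rw [← isOpen_compl_iff, heq]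
    exact ν.isOpen_image_collar hG (isOpen_lt continuous_const continuous_snd)
  refine hKc.of_isClosed_subset hclosed ?_
  -- the inclusion
  rintro z (hz | ⟨p, hp, rfl⟩)
  · -- the core lies in `K`
    rcases hz with ⟨y, hy, rfl⟩ | ⟨x, hx, rfl⟩
    · refine Or.inl ⟨y, ?_, rfl⟩
      rw [Metric.mem_closedBall, dist_zero_right] at hy ⊢
      exact hy.trans (hR₁1.trans (le_max_left _ _))
    · refine Or.inr ⟨(x, 0), ⟨hx, ⟨0, by simp [hr₁pos.le], ?_⟩⟩, rfl⟩
      exact univBall_symm_zero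
  · -- a collar point of height `σ ≤ a` has size `N = e^{-σ} ≥ N₀`
    have hC : ν.collar jA jB p ∉ ν.coreC := ν.collar_not_mem_coreC hG p
    have hσ : (ν.collarInv jA jB (ν.collar jA jB p)).2 = p.2 := by rw [ν.collarInv_collar hG]
    have hN : N₀ ≤ Real.exp (-(ν.collarInv jA jB (ν.collar jA jB p)).2) := by
      rw [hσ]; exact Real.exp_le_exp.2 (by simpa using hp)
    obtain (⟨y, hyz⟩ | ⟨w, hwz⟩) := ν.shrink.eq_inl_or_eq_inr_zero (ν.collar jA jB p)
    · rw [← hyz] at hC hN ⊢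
      have h1 : 1 < ‖y‖ := ν.one_lt_norm_of_not_mem_coreC hC
      have hy0 : y ≠ 0 := by rintro rfl; norm_num at h1
      have hypos : 0 < ‖y‖ := by linarith
      have hα : 0 < ‖y‖⁻¹ := inv_pos.2 hypos
      have hα1 : ‖y‖⁻¹ < 1 := inv_lt_one_of_one_lt₀ h1
      have hX : 0 < TraceCollar.ξ ‖y‖⁻¹ := TraceCollar.ξ_pos hα hα1
      -- a lower bound `X ≥ X₀` on `X = ξ(1/‖y‖)` bounds `‖y‖`
      have key : ∀ {X₀ : ℝ}, 0 < X₀ → X₀ ≤ TraceCollar.ξ ‖y‖⁻¹ → ‖y‖ ≤ (TraceCollar.αof X₀)⁻¹ := by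
        intro X₀ hX₀ hle
        have hαX : TraceCollar.αof X₀ ≤ ‖y‖⁻¹ := by
          by_contra h
          have := ξ_lt_ξ hα.le (not_le.1 h) (TraceCollar.αof_lt_one _)
          rw [TraceCollar.ξ_αof] at this
          linarith
        rwa [le_inv_comm₀ hypos (TraceCollar.αof_pos hX₀)]
      by_cases hc : radialProjection (spherePt 3) y ∈ ν.closedTube
      · -- tube branch: `N = ρ X (ψ Y) ≤ max X (ψ Y) + X/4`
        obtain ⟨⟨u, w⟩, ⟨-, hw2⟩, hq⟩ := hc
        rw [Metric.mem_closedBall, dist_zero_right] at hw2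
        have hrange : radialProjection (spherePt 3) y ∉ range c := ν.radialProjection_not_mem_range_of_not_mem_coreC hC
        have hw : w ≠ 0 := fun h0 ↦ hrange (by rw [← hq, h0, ν.apply_zero]; exact mem_range_self u)
        have hwpos : 0 < ‖w‖ := norm_pos_iff.2 hw
        have hYy : 0 ≤ Real.log (2 / ‖w‖) := Real.log_nonneg ((le_div_iff₀ hwpos).2 (by linarith))
        rw [ν.collarInv_inl_of_mem ⟨(u, w), ⟨mem_univ _, by simpa using hw2⟩, hq⟩, ΨTube] at hN
        simp only [neg_neg] at hN
        have hΩ : (TraceCollar.ξ ‖y‖⁻¹, Real.log (2 / ‖(ν.toHomeo.symm (radialProjection (spherePt 3) y)).2‖)) ∈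
            TraceCollar.Ωpos := hX
        have hNpos : 0 < (ν.profP y).1 := (TraceCollar.Φ_mem_Quad hΩ).1
        rw [Real.exp_log hNpos, profP, ← hq, toHomeo_symm_apply', TraceCollar.Φ,
          TraceCollar.Nf_of_pos hX] at hN
        have hρ := TraceCollar.ρ_le hX (TraceCollar.ψ (Real.log (2 / ‖w‖)))
        simp only at hN
        by_cases hXb : N₀ / 4 ≤ TraceCollar.ξ ‖y‖⁻¹
        · refine Or.inl ⟨y, ?_, rfl⟩
          rw [Metric.mem_closedBall, dist_zero_right]
          exact (key (by positivity) hXb).trans (le_max_right _ _)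
        · -- `X < N₀/4` forces `ψ Y ≥ N₀/2`, hence `Y ≥ Y₁` and `‖w‖ ≤ r₁`
          rw [not_le] at hXb
          have hψb : N₀ / 2 ≤ TraceCollar.ψ (Real.log (2 / ‖w‖)) := by
            by_contra h
            rw [not_le] at h
            have : max (TraceCollar.ξ ‖y‖⁻¹) (TraceCollar.ψ (Real.log (2 / ‖w‖))) < N₀ / 2 :=
              max_lt (by linarith) h
            linarith
          have hYb : Y₁ ≤ Real.log (2 / ‖w‖) := by
            by_contra h
            rw [not_le] at h
            have := TraceCollar.strictMonoOn_ψ hYy hY₁pos.le h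
            linarith
          have hwr : ‖w‖ ≤ r₁ := by
            rw [← two_mul_exp_neg_log hwpos, hr₁]
            gcongr
          -- rewrite the point in the handle chart
          have hyeq : y = (‖y‖⁻¹)⁻¹ • ((ν.toFun (u, ‖w‖ • ((radialProjection (spherePt 1) w : 𝕊 1) : 𝔼 2)) : 𝕊 3) : 𝔼 4) := by
            rw [norm_smul_coe_radialProjection, hq, inv_inv, norm_smul_coe_radialProjection]
          have hpt : ν.shrink.traceGlueData.inl y = ν.shrink.traceGlueData.inr
              (‖y‖⁻¹ • (u : 𝔼 2), κ.symm (‖w‖ • ((radialProjection (spherePt 1) w : 𝕊 1) : 𝔼 2))) := by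
            conv_lhs => rw [hyeq]
            exact ν.ptT_eq_inr hα hwpos (hwr.trans_lt hr₁2) u _
          rw [hpt]
          refine Or.inr ⟨_, ⟨?_, ⟨w, ?_, ?_⟩⟩, rfl⟩
          · rw [Metric.mem_closedBall, dist_zero_right, norm_smul_coe_sphere hα.le]; exact hα1.le
          · rw [Metric.mem_closedBall, dist_zero_right]; exact hwr
          · rw [norm_smul_coe_radialProjection]
      · -- radial branch: `N = ξ(1/‖y‖)`
        rw [ν.collarInv_inl_of_not_mem hy0 hc, ΨRad] at hN
        simp only [neg_neg] at hN
        rw [Real.exp_log hX] at hN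
        refine Or.inl ⟨y, ?_, rfl⟩
        rw [Metric.mem_closedBall, dist_zero_right]
        exact (key hN₀pos hN).trans (le_max_left _ _)
    · -- cocore branch: `N = ψ Y`
      rw [← hwz] at hC hN ⊢
      obtain ⟨-, hw⟩ := ν.norm_lt_one_of_inr_not_mem_coreC hC
      have hw' : κ w ≠ 0 := univBall_ne_zero hw
      have hr : 0 < ‖κ w‖ := norm_pos_iff.2 hw'
      have hYy : 0 < Real.log (2 / ‖κ w‖) := Real.log_pos ((lt_div_iff₀ hr).2 (by linarith [norm_univBall_lt w]))
      have hψ : 0 < TraceCollar.ψ (Real.log (2 / ‖κ w‖)) := TraceCollar.ψ_pos hYy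
      rw [ν.collarInv_inr_zero, ΨFlat] at hN
      simp only [neg_neg] at hN
      rw [show radF ((0 : 𝔼 2), w) = ‖κ w‖ from rfl, Real.exp_log hψ] at hN
      have hYb : Y₁ ≤ Real.log (2 / ‖κ w‖) := by
        by_contra h
        rw [not_le] at h
        have := TraceCollar.strictMonoOn_ψ hYy.le hY₁pos.le h
        linarith
      have hwr : ‖κ w‖ ≤ r₁ := by
        rw [← two_mul_exp_neg_log hr, hr₁]
        gcongr
      refine Or.inr ⟨(0, w), ⟨by simp, ⟨κ w, ?_, ?_⟩⟩, rfl⟩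
      · rw [Metric.mem_closedBall, dist_zero_right]; exact hwr
      · exact univBall_symm_apply_apply w

end Clauses

end TubeNbhd

/-! ### The open trace and its collared end -/

/-- **The open trace of an integral knot surgery and its collared end** (discharge of the named fact
`Knot.exists_openTrace_of_isIntegralSurgery`, D-0014): if `Y` is the `m`-surgery on the knot `K`,
witnessed by the tubular neighbourhood `ν`, then the open trace `T = OpenTrace ν.shrink` contains
`K` as the boundary of its smooth core disc, and `T ∖ (inl(B̄⁴) ∪ coreDisc(𝔻²)) ≅ Y × ℝ` by the
collar `TubeNbhd.collarPH`, smooth with smooth inverse, proper towards the core and closed towards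
infinity. Kirby (1989), Ch. I §5; Gompf–Stipsicz (1999), §5.3; Manolescu–Piccirillo (2023), §3.2.
[cite: Kirby1989, Ch. I §5] -/
theorem Knot.exists_openTrace_of_isIntegralSurgery_holds : Knot.exists_openTrace_of_isIntegralSurgery := by
  intro K m Y _ _ hY
  obtain ⟨νK, -, jA, jB, hG⟩ := hY
  have hG' : νK.toTubeNbhd.IsSurgeryWith jA jB := hG
  exact ⟨νK.toTubeNbhd.shrink.OpenTrace, inferInstance, inferInstance, inferInstance, inferInstance,
    νK.toTubeNbhd.shrink.traceGlueData.inl, νK.toTubeNbhd.shrink.coreDisc, νK.toTubeNbhd.collarPH hG',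
    TubeNbhd.isSliceDiscIn K νK.toTubeNbhd.shrink, rfl, (νK.toTubeNbhd.contMDiff_collar hG').contMDiffOn,
    νK.toTubeNbhd.contMDiffOn_collarInv hG', rfl, νK.toTubeNbhd.isCompact_coreC_union_image_le hG',
    νK.toTubeNbhd.isClosed_image_collar_ge hG'⟩

end Literature.Topology.FourManifolds
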